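import Literature.NumberTheory.GaloisRepresentations.PrimeDegreeCyclicSylowFree
import Mathlib.LinearAlgebra.CrossProduct
import Mathlib.Data.Finite.Perm
import HarnessLib

/-!
# Weak adequacy of orthogonal groups of degree `3` in characteristic `3`, and Theorem 1.7 of
# Guralnick–Herzig–Tiep for subgroups of `GO₃` with `9 ∤ |G|` — classification-free

Theorem 1.7 of [GHT17] (vendored as the named fact `ght2017_adequate_or_index_p_or_psl29` in
`AdequacyDegreeP.lean`): for `k` of characteristic `p` and `G ≤ GL_p(k)` finite absolutely
irreducible, either (a) `G` is adequate (extended sense), or (b) `G` has an abelian normal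
subgroup of index `p`, or (c) `p = 3` and the image of `G` in `PGL₃` is `A₆ ≅ PSL₂(9)`.  Its
printed proof rests on Theorem 2.2 (Guralnick's classification of primitive groups containing
elements with an eigenspace of codimension `≤ 2`, CFSG) and the case analysis of
Props. 6.8–6.14.  The sibling files prove without the classification: descent to `k̄`
(`AdequacyDegreeP`), the imprimitive case Prop. 6.6 (`isExtendedAdequate_of_monomial`),
clauses (i) `H¹`-comparison and (ii) `End_G = k` when `p ∥ |G|` (Lemmas 6.2–6.3,
`PrimeDegreeCyclicSylowFree`), and the reduction of a primitive `H ≤ GL_p(k̄)` to a simple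
non-abelian normal `L ⊴ H`, irreducible, inside `SL_p`, with `p ∣ |L|`
(`PrimeDegreePrimitiveQuasisimple.Subgroup.exists_simple_normal_dvd_card_of_primitive`).  What
the classification supplies is the identity of `L` and with it clause (iii), WEAK ADEQUACY: the
`p`-regular elements of `L` span `M_p(k̄)`.

This file proves clause (iii) uniformly, without the classification, for `p = 3` and subgroups
of the orthogonal similitude group `GO₃(B)` of a non-degenerate symmetric form `B` — the home of
the symmetric square `Sym² : GL₂ → GO₃`, i.e. of the images `Sym² ρ̄(Γ)` (`ρ̄ : Γ → GL₂(𝔽̄₃)`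
with projective image `S₄`, `A₅`, `PSL₂(3^a)`, `PGL₂(3^a)`) met in `3`-adic adequate-image
questions — and deduces Theorem 1.7 in the form "(a) or (b)" for such images when `9 ∤ |G|`
(alternative (c) has `9 ∣ |A₆|`), over any field of characteristic `3`.

## Main results

* `OrthogonalDegreeThree.semisimpleSpan_eq_top_of_orthogonal`: `K = K̄`, `char K = 3`,
  `Bᵀ = B` invertible, `L ≤ SO₃(B)` finite, irreducible on `K³`, simple non-abelian `⇒`
  `Subgroup.semisimpleSpan L = ⊤` (the `3`-regular elements of `L` span `M₃(K)`).
* `Subgroup.semisimpleSpan_eq_top_of_primitive_of_similitude`: the same for every finite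
  irreducible primitive `H ≤ GO₃(B)` (`gᵀ B g = μ_g B`), via the simple socle layer `L ≤ SO₃(B)`.
* `isExtendedAdequate_or_index_three_of_similitude_of_not_dvd` (column convention
  `σ(g)ᵀ B σ(g) = μ B`) and `…_not_dvd'` (row convention `σ(g) B σ(g)ᵀ = μ B`, that of `Sym²`
  on Veronese row vectors): `σ : G →* GL₃(k)` faithful, absolutely irreducible, image in
  `GO₃(B)`, `9 ∤ |G|` `⇒` `Subgroup.IsExtendedAdequate σ.range` or `G` has an abelian normal
  subgroup of index `3`.
* `isExtendedAdequate_of_similitude_of_not_isSolvable`: hence adequate if moreover `G` is not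
  solvable (e.g. the icosahedral cell, projective image `A₅`).

## The argument (ours; elementary, over `K = K̄` of characteristic `3`)

Let `L ≤ SO(B)` be finite, irreducible, simple non-abelian, and let `Y ∈ M₃(K)` be
trace-orthogonal to every `3`-regular `g ∈ L` (`traceAnn`; by trace duality,
`semisimpleSpan_eq_top_of_traceAnn`, it suffices to show `Y = 0`).  The `B`-adjoint
`Y* = B⁻¹ Yᵀ B` is again in the annihilator (`g* = g⁻¹`), so the `B`-skew part
`J_B(a) = B⁻¹ [a]ₓ` (`[a]ₓ` the cross-product matrix, § CrossMatrix, § Orthogonal) and the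
`B`-symmetric part (`B Y` symmetric) may be treated separately (§ Main).
* § Elements — a regular non-involution exists (`exists_coprime_mul_self_ne_one`): if every
  `3`-regular element of `L` were an involution then `|L| = 2^a 3^b` with a Sylow `2`-subgroup of
  exponent `2`, of order `≤ 4` because three commuting non-central involutions `t` give rank-one
  idempotents `-(1 + t)` with too many orthogonality relations in dimension `3`
  (`false_of_three_involutions`); then a Sylow `3`-subgroup has index `≤ 4`, impossible.
* § SkewPart — `g J_B(a) g⁻¹ = J_B(g a)` for `g ∈ SO(B)` (`conj_skewOf`), so
  `{a | J_B(a) ∈ traceAnn L}` is an `L`-submodule of `K³`: zero, or everything; in the latter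
  case `g₀ - g₀⁻¹ = J_B(a₁)` (`a₁ = axisOf B g₀ ≠ 0` for a regular non-involution `g₀`) is
  trace-orthogonal to every `J_B(a)`, contradicting `tr(J_B(a) J_B(b)) = -2 aᵀ (adj B) b`-type
  non-degeneracy (`trace_skewOf_mul_skewOf`).
* § Axes, § Geometry, § LinesAction, § Main — the symmetric part.  A regular `g` fixes its axis
  `a` (`mulVec_axisOf`), and `a aᵀ B = det B · J_B(a)² + Q_B(a) · 1 ∈ K[g]` (Cayley–Hamilton,
  `vecMulVec_eq_skewOf_sq`), so `S := B Y` has `Q_S(a) = aᵀ S a = 0` at the axis of every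
  regular non-involution (`qf_axisOf_eq_zero`).  The set `P` of these axes is `L`-stable
  (`axisOf_conj`).  If every conic through `P` is proportional to `S`, then `gᵀ S g = c_g S`,
  so `g⁻¹ Y g = c_g Y` with `c_g³ = 1`, i.e. `c_g = 1`; Schur makes `Y` scalar and
  `Q_S(a) = 0` makes it `0` (`eq_zero_of_mem_traceAnn_of_symm`).  Otherwise two independent
  conics pass through `P`; a pencil of ternary conics over `K̄` has a singular member
  (`exists_singular_comb`), a line pair or a double line, and intersecting
  (`conics_through_points`) puts `P` on at most four lines — then `L` permutes these lines, with
  a kernel that fixes a line (reducible) or is trivial (`|L| ∣ 24`), `false_of_cover_by_four_lines`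
  — or produces an `L`-stable plane (`false_of_plane`): contradiction either way.
* § SmallGroups — no non-abelian simple group has order dividing `24` or a subgroup of index
  `≤ 4` (Sylow theory and Burnside's transfer theorem from Mathlib).
* § Consequences — a similitude of determinant `1` is an isometry (`μ³ = 1 ⇒ μ = 1` in
  characteristic `3`), so the simple socle layer of a primitive `H ≤ GO₃(B)` lies in `SO₃(B)`;
  Theorem 1.7 (a) ∨ (b) then follows exactly as in `PrimeDegreeCyclicSylowFree`
  (imprimitive: Prop. 6.6; primitive: (i), (ii) by Lemma 6.2, (iii) here), and descends to `k`.

GHT prove these cells through Theorem 2.2 (the socle of a primitive irreducible `H ≤ GL₃(𝔽̄₃)`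
with `9 ∤ |H|` is `A₅`) and [GHT15]; the orthogonal hypothesis is what makes a uniform
elementary proof possible (`so₃(B) ≅ K³` as `L`-modules, and conics).

## What is not here

* The cells with `9 ∣ |G|` (`PSL₂(9) ≅ A₆` — alternative (c) —, `PSL₂(3^a)`, `PGL₂(3^a)`,
  `a ≥ 2`): weak adequacy (iii) IS covered by `semisimpleSpan_eq_top_of_orthogonal` (no
  hypothesis on the `3`-part of `|L|`), but clauses (i)–(ii) there are GHT Props. 6.10–6.12
  (`Ext¹` computations from [GHT15]), not formalised; for them the named fact remains the
  reference.
* Degrees `p > 3`: the argument is special to `so₃` and plane conics.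

## References

* [GHT17] R. Guralnick, F. Herzig, P. H. Tiep, *Adequate subgroups and indecomposable modules*,
  J. Eur. Math. Soc. 19 (2017), 1231–1291, Theorem 1.7, §6 (Props. 6.5–6.6, Lemmas 6.2–6.3,
  Props. 6.8–6.14, proof of Theorem 6.15). [cite: GuralnickHerzigTiep2017]
* [GHT15] R. Guralnick, F. Herzig, P. H. Tiep, *Adequate groups of low degree*, Algebra Number
  Theory 9 (2015), 77–147 (cited by [GHT17] for the degree-`3` tables; not used here).
-/

open scoped MatrixGroups Matrix

namespace Literature.NumberTheory.GaloisRepresentations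

universe u v

namespace OrthogonalDegreeThree

section CrossMatrix

variable {R : Type u} [CommRing R]

/-- The cross-product matrix `[a]ₓ` of a vector `a`: `[a]ₓ v = a × v`. [folklore] -/
def crossMatrix (a : Fin 3 → R) : Matrix (Fin 3) (Fin 3) R :=
  !![0, -a 2, a 1; a 2, 0, -a 0; -a 1, a 0, 0]

/-- `crossMatrix` as a linear map. [folklore] -/
def crossMatrixLin : (Fin 3 → R) →ₗ[R] Matrix (Fin 3) (Fin 3) R where
  toFun := crossMatrix
  map_add' a b := by
    ext i j; fin_cases i <;> fin_cases j <;> simp [crossMatrix] <;> ring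
  map_smul' c a := by
    ext i j; fin_cases i <;> fin_cases j <;> simp [crossMatrix]

/-- Unfolding `crossMatrixLin`. [folklore] -/
@[simp] theorem crossMatrixLin_apply (a : Fin 3 → R) : crossMatrixLin a = crossMatrix a := rfl

/-- `[a]ₓ = 0 ↔ a = 0`. [folklore] -/
theorem crossMatrix_eq_zero_iff (a : Fin 3 → R) : crossMatrix a = 0 ↔ a = 0 := by
  constructor
  · intro h
    ext i
    fin_cases i
    · have := congrFun (congrFun h 2) 1; simpa [crossMatrix] using this
    · have := congrFun (congrFun h 0) 2; simpa [crossMatrix] using this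
    · have := congrFun (congrFun h 1) 0; simpa [crossMatrix] using this
  · rintro rfl
    ext i j; fin_cases i <;> fin_cases j <;> simp [crossMatrix]

/-- `[a]ₓ` is skew-symmetric. [folklore] -/
theorem transpose_crossMatrix (a : Fin 3 → R) : (crossMatrix a)ᵀ = -crossMatrix a := by
  ext i j; fin_cases i <;> fin_cases j <;> simp [crossMatrix]

/-- Equivariance of the cross product: `Mᵀ [M a]ₓ M = det M · [a]ₓ`. [folklore] -/
theorem transpose_mul_crossMatrix_mulVec_mul (M : Matrix (Fin 3) (Fin 3) R) (a : Fin 3 → R) :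
    Mᵀ * crossMatrix (M *ᵥ a) * M = M.det • crossMatrix a := by
  ext i j
  fin_cases i <;> fin_cases j <;>
    simp [crossMatrix, Matrix.mul_apply, Matrix.mulVec, dotProduct, Fin.sum_univ_three,
      Matrix.det_fin_three] <;> ring

/-- `[u]ₓ [b]ₓ = b uᵀ - (u · b) 1` (the `bac-cab` rule). [folklore] -/
theorem crossMatrix_mul_crossMatrix (u b : Fin 3 → R) :
    crossMatrix u * crossMatrix b = Matrix.vecMulVec b u - (u ⬝ᵥ b) • (1 : Matrix (Fin 3) (Fin 3) R) := by
  ext i j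
  fin_cases i <;> fin_cases j <;>
    simp [crossMatrix, Matrix.mul_apply, Matrix.vecMulVec_apply, dotProduct, Fin.sum_univ_three] <;>
    ring

/-- `tr([u]ₓ [b]ₓ) = -2 (u · b)`. [folklore] -/
theorem trace_crossMatrix_mul_crossMatrix (u b : Fin 3 → R) :
    (crossMatrix u * crossMatrix b).trace = -2 * (u ⬝ᵥ b) := by
  rw [crossMatrix_mul_crossMatrix, Matrix.trace_sub, Matrix.trace_vecMulVec, Matrix.trace_smul,
    Matrix.trace_one, Fintype.card_fin, dotProduct_comm b u]
  simp only [smul_eq_mul, Nat.cast_ofNat]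
  ring

/-- A skew-symmetric matrix with zero diagonal is a cross-product matrix. [folklore] -/
theorem exists_eq_crossMatrix_of_transpose {S : Matrix (Fin 3) (Fin 3) R} (hS : Sᵀ = -S)
    (hd : ∀ i, S i i = 0) : S = crossMatrix ![S 2 1, S 0 2, S 1 0] := by
  have h : ∀ i j, S j i = -S i j := fun i j => by
    have := congrFun (congrFun hS i) j
    simpa using this
  ext i j
  fin_cases i <;> fin_cases j <;> simp [crossMatrix, hd, h 1 0, h 2 1, h 0 2]

/-- Cayley–Hamilton for `3 × 3` matrices, with the middle coefficient `tr(adj A)`. [folklore] -/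
theorem cayleyHamilton_fin_three (A : Matrix (Fin 3) (Fin 3) R) :
    A ^ 3 - A.trace • A ^ 2 + (Matrix.adjugate A).trace • A - A.det • (1 : Matrix (Fin 3) (Fin 3) R)
      = 0 := by
  ext i j
  fin_cases i <;> fin_cases j <;>
    simp [pow_succ, Matrix.mul_apply, Fin.sum_univ_three, Matrix.trace, Matrix.diag,
      Matrix.adjugate_fin_three, Matrix.det_fin_three] <;> ring

end CrossMatrix

/-! ## Orthogonal groups of a symmetric form in dimension 3 -/

section Orthogonal

variable {K : Type u} [Field K]

/-- The `B`-adjoint `X* = B⁻¹ Xᵀ B` (so that `B(Xv, w) = B(v, X* w)`). [folklore] -/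
noncomputable def adjB (B X : Matrix (Fin 3) (Fin 3) K) : Matrix (Fin 3) (Fin 3) K := B⁻¹ * Xᵀ * B

/-- The skew operator `J_B(a) = B⁻¹ [a]_×` attached to a vector `a`. [folklore] -/
noncomputable def skewOf (B : Matrix (Fin 3) (Fin 3) K) (a : Fin 3 → K) : Matrix (Fin 3) (Fin 3) K :=
  B⁻¹ * crossMatrix a

/-- `skewOf B` as a linear map. [folklore] -/
noncomputable def skewOfLin (B : Matrix (Fin 3) (Fin 3) K) : (Fin 3 → K) →ₗ[K] Matrix (Fin 3) (Fin 3) K :=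
  (LinearMap.mulLeft K B⁻¹).comp crossMatrixLin

/-- Unfolding `skewOfLin`. [folklore] -/
@[simp] theorem skewOfLin_apply (B : Matrix (Fin 3) (Fin 3) K) (a : Fin 3 → K) :
    skewOfLin B a = skewOf B a := rfl

/-- `J_B(a) = 0 ↔ a = 0` for non-degenerate `B`. [folklore] -/
theorem skewOf_eq_zero_iff {B : Matrix (Fin 3) (Fin 3) K} (hB : IsUnit B.det) (a : Fin 3 → K) :
    skewOf B a = 0 ↔ a = 0 := by
  rw [← crossMatrix_eq_zero_iff]
  constructor
  · intro h
    have h2 : B * (B⁻¹ * crossMatrix a) = 0 := by rw [← skewOf, h, Matrix.mul_zero]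
    rwa [← Matrix.mul_assoc, Matrix.mul_nonsing_inv B hB, Matrix.one_mul] at h2
  · intro h; rw [skewOf, h, Matrix.mul_zero]

/-- For `g` orthogonal (`gᵀ B g = B`): `g B⁻¹ = B⁻¹ (g⁻¹)ᵀ`. [folklore] -/
theorem mul_inv_eq_of_orthogonal {B : Matrix (Fin 3) (Fin 3) K} (hB : IsUnit B.det)
    (g : GL (Fin 3) K) (hg : ((g : GL (Fin 3) K) : Matrix (Fin 3) (Fin 3) K)ᵀ * B * g = B) :
    (g : Matrix (Fin 3) (Fin 3) K) * B⁻¹ =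
      B⁻¹ * (((g⁻¹ : GL (Fin 3) K) : Matrix (Fin 3) (Fin 3) K))ᵀ := by
  set G : Matrix (Fin 3) (Fin 3) K := ((g : GL (Fin 3) K) : Matrix (Fin 3) (Fin 3) K) with hGdef
  set Gi : Matrix (Fin 3) (Fin 3) K := ((g⁻¹ : GL (Fin 3) K) : Matrix (Fin 3) (Fin 3) K) with hGidef
  have hGGi : G * Gi = 1 := by
    rw [hGdef, hGidef, ← Units.val_mul, mul_inv_cancel, Units.val_one]
  -- `B G = Giᵀ B`
  have h1 : B * G = Giᵀ * B := by
    have h2 : Giᵀ * (Gᵀ * B * G) = Giᵀ * B := by rw [hg]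
    rw [← Matrix.mul_assoc, ← Matrix.mul_assoc, ← Matrix.transpose_mul, hGGi,
      Matrix.transpose_one, Matrix.one_mul] at h2
    exact h2
  -- `G = B⁻¹ Giᵀ B`
  have h3 : G = B⁻¹ * Giᵀ * B := by
    rw [Matrix.mul_assoc, ← h1, ← Matrix.mul_assoc, Matrix.nonsing_inv_mul B hB, Matrix.one_mul]
  calc G * B⁻¹ = B⁻¹ * Giᵀ * B * B⁻¹ := by rw [← h3]
    _ = B⁻¹ * Giᵀ := by rw [Matrix.mul_assoc, Matrix.mul_nonsing_inv B hB, Matrix.mul_one]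

/-- **Equivariance of `J_B`**: for `g ∈ SO(B)`, `g J_B(a) g⁻¹ = J_B(g a)`. [folklore] -/
theorem conj_skewOf {B : Matrix (Fin 3) (Fin 3) K} (hB : IsUnit B.det) (g : GL (Fin 3) K)
    (hg : ((g : GL (Fin 3) K) : Matrix (Fin 3) (Fin 3) K)ᵀ * B * g = B)
    (hdet : Matrix.det ((g : GL (Fin 3) K) : Matrix (Fin 3) (Fin 3) K) = 1) (a : Fin 3 → K) :
    (g : Matrix (Fin 3) (Fin 3) K) * skewOf B a * ((g⁻¹ : GL (Fin 3) K) : Matrix (Fin 3) (Fin 3) K) =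
      skewOf B ((g : Matrix (Fin 3) (Fin 3) K) *ᵥ a) := by
  set G : Matrix (Fin 3) (Fin 3) K := ((g : GL (Fin 3) K) : Matrix (Fin 3) (Fin 3) K) with hGdef
  set Gi : Matrix (Fin 3) (Fin 3) K := ((g⁻¹ : GL (Fin 3) K) : Matrix (Fin 3) (Fin 3) K) with hGidef
  have hGGi : G * Gi = 1 := by
    rw [hGdef, hGidef, ← Units.val_mul, mul_inv_cancel, Units.val_one]
  -- `[G a]_× = Giᵀ [a]_× Gi`
  have hlaw := transpose_mul_crossMatrix_mulVec_mul G a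
  rw [hdet, one_smul] at hlaw
  have h1 : crossMatrix (G *ᵥ a) = Giᵀ * crossMatrix a * Gi := by
    have h2 : Giᵀ * (Gᵀ * crossMatrix (G *ᵥ a) * G) * Gi = Giᵀ * crossMatrix a * Gi := by rw [hlaw]
    rw [show Giᵀ * (Gᵀ * crossMatrix (G *ᵥ a) * G) * Gi =
        (G * Gi)ᵀ * crossMatrix (G *ᵥ a) * (G * Gi) by
      rw [Matrix.transpose_mul]; simp only [Matrix.mul_assoc], hGGi, Matrix.transpose_one,
      Matrix.one_mul, Matrix.mul_one] at h2
    exact h2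
  rw [skewOf, skewOf, h1, ← Matrix.mul_assoc, ← Matrix.mul_assoc, mul_inv_eq_of_orthogonal hB g hg]
  simp only [hGidef, Matrix.mul_assoc]

/-- `[B a]_× = det B · B⁻¹ [a]_× B⁻¹` for symmetric invertible `B`. [folklore] -/
theorem crossMatrix_mulVec_symm {B : Matrix (Fin 3) (Fin 3) K} (hBs : Bᵀ = B) (hB : IsUnit B.det)
    (a : Fin 3 → K) : crossMatrix (B *ᵥ a) = B.det • (B⁻¹ * crossMatrix a * B⁻¹) := by
  have hlaw := transpose_mul_crossMatrix_mulVec_mul B a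
  rw [hBs] at hlaw
  calc crossMatrix (B *ᵥ a) = B⁻¹ * (B * crossMatrix (B *ᵥ a) * B) * B⁻¹ := by
        rw [Matrix.mul_assoc B, ← Matrix.mul_assoc B⁻¹, Matrix.nonsing_inv_mul B hB,
          Matrix.one_mul, Matrix.mul_assoc, Matrix.mul_nonsing_inv B hB, Matrix.mul_one]
    _ = B.det • (B⁻¹ * crossMatrix a * B⁻¹) := by
        rw [hlaw, Matrix.mul_smul, Matrix.smul_mul]

/-- `J_B(a) J_B(b) = (det B)⁻¹ (b (Ba)ᵀ - (Ba · b) 1)`. [folklore] -/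
theorem skewOf_mul_skewOf {B : Matrix (Fin 3) (Fin 3) K} (hBs : Bᵀ = B) (hB : IsUnit B.det)
    (a b : Fin 3 → K) :
    skewOf B a * skewOf B b =
      B.det⁻¹ • (Matrix.vecMulVec b (B *ᵥ a) - ((B *ᵥ a) ⬝ᵥ b) • (1 : Matrix (Fin 3) (Fin 3) K)) := by
  have hdet : B.det ≠ 0 := hB.ne_zero
  rw [← crossMatrix_mul_crossMatrix, crossMatrix_mulVec_symm hBs hB, Matrix.smul_mul, smul_smul,
    inv_mul_cancel₀ hdet, one_smul, skewOf, skewOf]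
  simp only [Matrix.mul_assoc]

/-- `tr (J_B(a) J_B(b)) = -2 (det B)⁻¹ B(a, b)`. [folklore] -/
theorem trace_skewOf_mul_skewOf {B : Matrix (Fin 3) (Fin 3) K} (hBs : Bᵀ = B) (hB : IsUnit B.det)
    (a b : Fin 3 → K) :
    (skewOf B a * skewOf B b).trace = B.det⁻¹ * (-2 * ((B *ᵥ a) ⬝ᵥ b)) := by
  have hdet : B.det ≠ 0 := hB.ne_zero
  have h : skewOf B a * skewOf B b = B.det⁻¹ • (crossMatrix (B *ᵥ a) * crossMatrix b) := by
    rw [skewOf_mul_skewOf hBs hB, crossMatrix_mul_crossMatrix]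
  rw [h, Matrix.trace_smul, trace_crossMatrix_mul_crossMatrix, smul_eq_mul]

/-- **The axis identity**: `b (Bb)ᵀ = det B · J_B(b)² + Q(b) · 1`. [folklore] -/
theorem vecMulVec_eq_skewOf_sq {B : Matrix (Fin 3) (Fin 3) K} (hBs : Bᵀ = B) (hB : IsUnit B.det)
    (b : Fin 3 → K) :
    Matrix.vecMulVec b (B *ᵥ b) =
      B.det • (skewOf B b * skewOf B b) + ((B *ᵥ b) ⬝ᵥ b) • (1 : Matrix (Fin 3) (Fin 3) K) := by
  have hdet : B.det ≠ 0 := hB.ne_zero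
  rw [skewOf_mul_skewOf hBs hB, smul_smul, mul_inv_cancel₀ hdet, one_smul, sub_add_cancel]

/-- A `B`-skew matrix (`(BY)ᵀ = -BY`) with `diag (BY) = 0` is `J_B(a)`. [folklore] -/
theorem exists_eq_skewOf {B : Matrix (Fin 3) (Fin 3) K} (hB : IsUnit B.det)
    {Y : Matrix (Fin 3) (Fin 3) K} (hY : (B * Y)ᵀ = -(B * Y)) (hd : ∀ i, (B * Y) i i = 0) :
    ∃ a, Y = skewOf B a := by
  refine ⟨![(B * Y) 2 1, (B * Y) 0 2, (B * Y) 1 0], ?_⟩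
  rw [skewOf, ← exists_eq_crossMatrix_of_transpose hY hd, ← Matrix.mul_assoc,
    Matrix.nonsing_inv_mul B hB, Matrix.one_mul]

/-- `tr (Y · b (Bb)ᵀ) = (Bb) · (Y b) = bᵀ B Y b`. [folklore] -/
theorem trace_mul_vecMulVec (Y : Matrix (Fin 3) (Fin 3) K) (b u : Fin 3 → K) :
    (Y * Matrix.vecMulVec b u).trace = u ⬝ᵥ (Y *ᵥ b) := by
  simp [Matrix.trace, Matrix.diag, Matrix.mul_apply, Matrix.vecMulVec_apply, Matrix.mulVec,
    dotProduct, Fin.sum_univ_three]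
  ring

end Orthogonal


section SmallGroups

variable {G : Type*} [Group G]

/-- In a simple group, a normal subgroup of order `≠ 1, ≠ |G|` is impossible. [folklore] -/
theorem false_of_normal_of_card [Finite G] [IsSimpleGroup G] (H : Subgroup G) [hn : H.Normal]
    (h1 : Nat.card H ≠ 1) (h2 : Nat.card H ≠ Nat.card G) : False := by
  rcases hn.eq_bot_or_eq_top with h | h
  · exact h1 (by rw [h, Subgroup.card_bot])
  · exact h2 (by rw [h, Subgroup.card_top])

/-- A simple `p`-group is commutative. [folklore] -/
theorem comm_of_isPGroup [Finite G] [IsSimpleGroup G] {p : ℕ} [Fact p.Prime] (hG : IsPGroup p G)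
    (a b : G) : a * b = b * a := by
  haveI : Nontrivial G := IsSimpleGroup.toNontrivial
  have hZ : Nontrivial (Subgroup.center G) := hG.center_nontrivial
  rcases (inferInstance : (Subgroup.center G).Normal).eq_bot_or_eq_top with h | h
  · rw [h] at hZ
    exact absurd hZ (not_nontrivial _)
  · have hb : b ∈ Subgroup.center G := by rw [h]; exact Subgroup.mem_top b
    exact (Subgroup.mem_center_iff.1 hb) a

/-- A group of prime order is commutative. [folklore] -/
theorem comm_of_prime_card [Finite G] {p : ℕ} [hp : Fact p.Prime] (h : Nat.card G = p)
    (a b : G) : a * b = b * a := by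
  haveI : IsCyclic G := isCyclic_of_prime_card h
  obtain ⟨g, hg⟩ := IsCyclic.exists_generator (α := G)
  obtain ⟨i, rfl⟩ := hg a
  obtain ⟨j, rfl⟩ := hg b
  rw [← zpow_add, ← zpow_add, add_comm]

/-- A Sylow `p`-subgroup has order `p` when `p ∥ |G|`. [folklore] -/
theorem card_sylow_eq_of_not_sq_dvd [Finite G] {p : ℕ} [hp : Fact p.Prime] (P : Sylow p G)
    (h1 : p ∣ Nat.card G) (h2 : ¬p ^ 2 ∣ Nat.card G) : Nat.card P = p := by
  obtain ⟨n, hn⟩ := IsPGroup.iff_card.mp P.isPGroup'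
  have hd : p ∣ Nat.card P := P.dvd_card_of_dvd_card h1
  have hdvd : Nat.card P ∣ Nat.card G := (P : Subgroup G).card_subgroup_dvd_card
  rw [hn] at hd hdvd ⊢
  rcases n with _ | _ | n
  · rw [pow_zero, Nat.dvd_one] at hd
    exact absurd hd hp.out.ne_one
  · rw [zero_add, pow_one]
  · exact absurd (dvd_trans (pow_dvd_pow p (by omega : 2 ≤ n + 1 + 1)) hdvd) h2

/-- **No non-commutative simple group has order dividing `24`.** (Orders `1, 2, 3, 4, 8`:
trivial, cyclic or `p`-groups; `6`: the Sylow `3`-subgroup has index `2`; `12`: four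
self-normalising Sylow `3`-subgroups give a normal `3`-complement by Burnside's transfer theorem;
`24`: the conjugation action on the four Sylow `3`-subgroups is an isomorphism onto `S₄`, and the
sign character has a proper kernel.) [folklore] -/
theorem false_of_isSimpleGroup_of_card_dvd [Finite G] [IsSimpleGroup G]
    (hcomm : ¬∀ a b : G, a * b = b * a) (h24 : Nat.card G ∣ 24) : False := by
  classical
  haveI : Nontrivial G := IsSimpleGroup.toNontrivial
  haveI : Fact (Nat.Prime 3) := ⟨Nat.prime_three⟩
  haveI : Fact (Nat.Prime 2) := ⟨Nat.prime_two⟩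
  have h1 : Nat.card G ≠ 1 := (Finite.one_lt_card (α := G)).ne'
  -- `p`-group orders
  have hpg : ∀ (p k : ℕ) [Fact p.Prime], Nat.card G = p ^ k → False := by
    intro p k _ h
    exact hcomm (comm_of_isPGroup (IsPGroup.of_card h))
  -- Sylow `3`
  let T : Sylow 3 G := default
  have hT3 : ∀ m : ℕ, Nat.card G = 3 * m → ¬(3 ∣ m) → Nat.card T = 3 := by
    intro m hm hm3
    refine card_sylow_eq_of_not_sq_dvd T ⟨m, hm⟩ ?_
    rintro ⟨c, hc⟩
    apply hm3
    refine ⟨c, ?_⟩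
    have : 3 * m = 3 * (3 * c) := by rw [← hm, hc]; ring
    omega
  have hTnormal : Nat.card T = 3 → (T : Subgroup G).Normal → False := by
    intro hc hno
    haveI := hno
    refine false_of_normal_of_card (T : Subgroup G) (by rw [hc]; norm_num) ?_
    rw [hc]; intro h
    exact hpg 3 1 (by rw [← h]; norm_num)
  -- number of Sylow `3`-subgroups is `1` or `4` when the index divides `8`
  have hn3 : (T : Subgroup G).index ∣ 8 →
      (Subgroup.normalizer (T : Set G)).index = 1 ∨
        (Subgroup.normalizer (T : Set G)).index = 4 := by
    intro hidx
    have hmod := card_sylow_modEq_one 3 G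
    have hdvd : Nat.card (Sylow 3 G) ∣ 8 := dvd_trans T.card_dvd_index hidx
    rw [T.card_eq_index_normalizer] at hmod hdvd
    obtain ⟨k, hk⟩ : ∃ k, (Subgroup.normalizer (T : Set G)).index = k := ⟨_, rfl⟩
    rw [hk] at hmod hdvd ⊢
    have hk8 : k ≤ 8 := Nat.le_of_dvd (by norm_num) hdvd
    rw [Nat.ModEq] at hmod
    interval_cases k <;> omega
  have hN1 : (Subgroup.normalizer (T : Set G)).index = 1 →
      (T : Subgroup G).Normal := by
    intro h
    rw [Subgroup.index_eq_one] at h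
    exact Subgroup.normalizer_eq_top_iff.mp h
  -- the order is a divisor of `24`
  have hmem : Nat.card G ∈ Nat.divisors 24 := Nat.mem_divisors.mpr ⟨h24, by norm_num⟩
  have hdiv : Nat.divisors 24 = {1, 2, 3, 4, 6, 8, 12, 24} := by decide
  rw [hdiv] at hmem
  simp only [Finset.mem_insert, Finset.mem_singleton] at hmem
  rcases hmem with h | h | h | h | h | h | h | h
  · exact h1 h
  · exact hpg 2 1 (by rw [h]; norm_num)
  · exact hpg 3 1 (by rw [h]; norm_num)
  · exact hpg 2 2 (by rw [h]; norm_num)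
  · -- `|G| = 6`
    have hc := hT3 2 (by rw [h]) (by norm_num)
    have hidx : (T : Subgroup G).index = 2 := by
      have := (T : Subgroup G).card_mul_index
      rw [hc, h] at this
      omega
    exact hTnormal hc (Subgroup.normal_of_index_eq_two hidx)
  · exact hpg 2 3 (by rw [h]; norm_num)
  · -- `|G| = 12`
    have hc := hT3 4 (by rw [h]) (by norm_num)
    have hidx : (T : Subgroup G).index = 4 := by
      have := (T : Subgroup G).card_mul_index
      rw [hc, h] at this
      omega
    rcases hn3 (by rw [hidx]; norm_num) with h' | h'
    · exact hTnormal hc (hN1 h')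
    · -- self-normalising Sylow `3`: Burnside
      have hNcard : Nat.card (Subgroup.normalizer (T : Set G)) = 3 := by
        have := (Subgroup.normalizer (T : Set G)).card_mul_index
        rw [h', h] at this
        omega
      have hNT : (T : Subgroup G) = Subgroup.normalizer (T : Set G) :=
        Subgroup.eq_of_le_of_card_ge Subgroup.le_normalizer (by rw [hNcard, hc])
      have hcommT : ∀ a b : (T : Subgroup G), a * b = b * a := comm_of_prime_card (p := 3) hc
      have hP : Subgroup.normalizer (T : Set G) ≤
          Subgroup.centralizer (T : Set G) := by
        rw [← hNT]
        intro x hx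
        rw [Subgroup.mem_centralizer_iff]
        intro y hy
        exact congrArg Subtype.val (hcommT ⟨y, hy⟩ ⟨x, hx⟩)
      have hcomp := MonoidHom.ker_transferSylow_isComplement' T hP
      have hK : Nat.card (MonoidHom.transferSylow T hP).ker = 4 := by
        have := hcomp.card_mul
        rw [hc, h] at this
        omega
      exact false_of_normal_of_card (MonoidHom.transferSylow T hP).ker (by rw [hK]; norm_num)
        (by rw [hK, h]; norm_num)
  · -- `|G| = 24`
    have hc := hT3 8 (by rw [h]) (by norm_num)
    have hidx : (T : Subgroup G).index = 8 := by
      have := (T : Subgroup G).card_mul_index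
      rw [hc, h] at this
      omega
    rcases hn3 (by rw [hidx]) with h' | h'
    · exact hTnormal hc (hN1 h')
    · have hcardS : Nat.card (Sylow 3 G) = 4 := by rw [T.card_eq_index_normalizer, h']
      haveI : Fintype (Sylow 3 G) := Fintype.ofFinite _
      haveI : Nontrivial (Sylow 3 G) := by
        rw [← Finite.one_lt_card_iff_nontrivial, hcardS]; norm_num
      let φ : G →* Equiv.Perm (Sylow 3 G) := MulAction.toPermHom G (Sylow 3 G)
      rcases (inferInstance : φ.ker.Normal).eq_bot_or_eq_top with hk | hk
      · -- faithful: `G ≅ S₄`, and the sign character has a proper kernel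
        have hinj : Function.Injective φ := (MonoidHom.ker_eq_bot_iff φ).mp hk
        have hcardP : Nat.card (Equiv.Perm (Sylow 3 G)) = 24 := by
          rw [Nat.card_perm, hcardS]; rfl
        have hbij : Function.Bijective φ := by
          refine (Nat.bijective_iff_injective_and_card φ).mpr ⟨hinj, ?_⟩
          rw [hcardP, h]
        let ψ : G →* ℤˣ := (Equiv.Perm.sign).comp φ
        have hψ : Function.Surjective ψ := by
          intro u
          obtain ⟨σ, hσ⟩ := Equiv.Perm.sign_surjective (α := Sylow 3 G) u
          obtain ⟨g, hg⟩ := hbij.surjective σ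
          exact ⟨g, by rw [← hσ, ← hg]; rfl⟩
        rcases (inferInstance : ψ.ker.Normal).eq_bot_or_eq_top with hk' | hk'
        · have hinj' : Function.Injective ψ := (MonoidHom.ker_eq_bot_iff ψ).mp hk'
          have hle' := Nat.card_le_card_of_injective ψ hinj'
          rw [h, Nat.card_eq_fintype_card (α := ℤˣ), Fintype.card_units_int] at hle'
          norm_num at hle'
        · obtain ⟨g, hg⟩ := hψ (-1)
          have hmem : g ∈ ψ.ker := by rw [hk']; exact Subgroup.mem_top g
          rw [MonoidHom.mem_ker, hg] at hmem
          exact absurd hmem (by decide)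
      · -- trivial action contradicts transitivity on the `4` Sylow subgroups
        obtain ⟨Q, hQ⟩ := exists_ne T
        obtain ⟨g, hg⟩ := MulAction.exists_smul_eq G T Q
        have hgk : g ∈ φ.ker := by rw [hk]; exact Subgroup.mem_top g
        rw [MonoidHom.mem_ker] at hgk
        have h1 : φ g T = T := by rw [hgk]; rfl
        have h2 : φ g T = g • T := rfl
        rw [h2, hg] at h1
        exact hQ h1

/-- **A non-commutative simple group has no proper subgroup of index `≤ 4`** (the action on
cosets would embed it into `S₄`). [folklore] -/
theorem false_of_index_le_four [Finite G] [IsSimpleGroup G] (hcomm : ¬∀ a b : G, a * b = b * a)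
    (T : Subgroup G) (hT : T ≠ ⊤) (hidx : T.index ≤ 4) : False := by
  classical
  let φ : G →* Equiv.Perm (G ⧸ T) := MulAction.toPermHom G (G ⧸ T)
  have hker : φ.ker = T.normalCore := T.normalCore_eq_ker.symm
  rcases (inferInstance : φ.ker.Normal).eq_bot_or_eq_top with hk | hk
  · have hinj : Function.Injective φ := (MonoidHom.ker_eq_bot_iff φ).mp hk
    have hdvd : Nat.card G ∣ Nat.card (Equiv.Perm (G ⧸ T)) :=
      Subgroup.card_dvd_of_injective φ hinj
    rw [Nat.card_perm] at hdvd
    have h24 : Nat.card G ∣ 24 :=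
      dvd_trans hdvd (Nat.factorial_dvd_factorial hidx)
    exact false_of_isSimpleGroup_of_card_dvd hcomm h24
  · apply hT
    rw [hker] at hk
    exact top_le_iff.mp (hk ▸ T.normalCore_le)

end SmallGroups


section Geometry

variable {K : Type u} [Field K]

/-- The quadratic form `v ↦ vᵀ S v` of a matrix. [folklore] -/
def qf (S : Matrix (Fin 3) (Fin 3) K) (v : Fin 3 → K) : K := v ⬝ᵥ S *ᵥ v

/-- Unfolding `qf`. [folklore] -/
theorem qf_def (S : Matrix (Fin 3) (Fin 3) K) (v : Fin 3 → K) : qf S v = v ⬝ᵥ S *ᵥ v := rfl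

/-- For symmetric `S` the polar form is symmetric. [folklore] -/
theorem dotProduct_mulVec_symm {S : Matrix (Fin 3) (Fin 3) K} (hS : Sᵀ = S) (v w : Fin 3 → K) :
    v ⬝ᵥ S *ᵥ w = w ⬝ᵥ S *ᵥ v := by
  rw [Matrix.dotProduct_mulVec, ← Matrix.mulVec_transpose, hS, dotProduct_comm]

/-- `Q(c v) = c² Q(v)`. [folklore] -/
theorem qf_smul (S : Matrix (Fin 3) (Fin 3) K) (c : K) (v : Fin 3 → K) :
    qf S (c • v) = c ^ 2 * qf S v := by
  rw [qf, qf, Matrix.mulVec_smul, dotProduct_smul, smul_dotProduct, smul_eq_mul, smul_eq_mul]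
  ring

/-- `Q(v + w) = Q(v) + 2 B_S(v, w) + Q(w)` for symmetric `S`. [folklore] -/
theorem qf_add {S : Matrix (Fin 3) (Fin 3) K} (hS : Sᵀ = S) (v w : Fin 3 → K) :
    qf S (v + w) = qf S v + 2 * (v ⬝ᵥ S *ᵥ w) + qf S w := by
  rw [qf, qf, qf, Matrix.mulVec_add, add_dotProduct, dotProduct_add, dotProduct_add,
    dotProduct_mulVec_symm hS w v]
  ring

/-- `Q(a p + b q)` expanded, for symmetric `S`. [folklore] -/
theorem qf_lin {S : Matrix (Fin 3) (Fin 3) K} (hS : Sᵀ = S) (a b : K) (p q : Fin 3 → K) :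
    qf S (a • p + b • q) = a ^ 2 * qf S p + 2 * a * b * (p ⬝ᵥ S *ᵥ q) + b ^ 2 * qf S q := by
  rw [qf_add hS, qf_smul, qf_smul, Matrix.mulVec_smul, dotProduct_smul, smul_dotProduct,
    smul_eq_mul, smul_eq_mul]
  ring

/-- `Q(v - t w)` expanded, for symmetric `S`. [folklore] -/
theorem qf_sub_smul {S : Matrix (Fin 3) (Fin 3) K} (hS : Sᵀ = S) (v w : Fin 3 → K) (t : K) :
    qf S (v - t • w) = qf S v - 2 * t * (v ⬝ᵥ S *ᵥ w) + t ^ 2 * qf S w := by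
  rw [sub_eq_add_neg, ← neg_smul, show v = (1 : K) • v from (one_smul K v).symm, qf_lin hS,
    one_smul]
  ring

/-- `qf` is linear in the matrix. [folklore] -/
theorem qf_linear_comb (S T : Matrix (Fin 3) (Fin 3) K) (a b : K) (v : Fin 3 → K) :
    qf (a • S + b • T) v = a * qf S v + b * qf T v := by
  rw [qf, qf, qf, Matrix.add_mulVec, Matrix.smul_mulVec, Matrix.smul_mulVec,
    dotProduct_add, dotProduct_smul, dotProduct_smul, smul_eq_mul, smul_eq_mul]

/-- **A symmetric matrix with identically vanishing quadratic form is zero** (`char ≠ 2`).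
[folklore] -/
theorem eq_zero_of_qf_eq_zero {S : Matrix (Fin 3) (Fin 3) K} (hS : Sᵀ = S) (h2 : (2 : K) ≠ 0)
    (h : ∀ v, qf S v = 0) : S = 0 := by
  have hsym : ∀ i j, S j i = S i j := fun i j => by
    have := congrFun (congrFun hS i) j
    rwa [Matrix.transpose_apply] at this
  have hij : ∀ i j, (Pi.single i 1 : Fin 3 → K) ⬝ᵥ S *ᵥ (Pi.single j 1) = S i j := by
    intro i j
    rw [Matrix.mulVec_single_one, single_one_dotProduct, Matrix.col_apply]
  ext i j
  have h1 := h (Pi.single i 1 + Pi.single j 1)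
  rw [qf_add hS, qf, qf, hij, hij, hij] at h1
  have hii : S i i = 0 := by have := h (Pi.single i 1); rwa [qf, hij] at this
  have hjj : S j j = 0 := by have := h (Pi.single j 1); rwa [qf, hij] at this
  rw [hii, hjj, zero_add, add_zero, mul_eq_zero] at h1
  rcases h1 with h1 | h1
  · exact absurd h1 h2
  · rw [h1, Matrix.zero_apply]

/-- The symmetric matrix of the product of two linear forms. [folklore] -/
theorem qf_vecMulVec_add (l m : Fin 3 → K) (v : Fin 3 → K) :
    qf (Matrix.vecMulVec l m + Matrix.vecMulVec m l) v = 2 * ((l ⬝ᵥ v) * (m ⬝ᵥ v)) := by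
  simp [qf, Matrix.mulVec, dotProduct, Matrix.vecMulVec_apply, Fin.sum_univ_three]
  ring

/-- **Two quadratic forms both proportional to `ℓ₁ ℓ₂` have proportional matrices.**
[folklore] -/
theorem eq_smul_of_qf_eq_mul {S : Matrix (Fin 3) (Fin 3) K} (hS : Sᵀ = S) (h2 : (2 : K) ≠ 0)
    (l m : Fin 3 → K) (d : K) (h : ∀ v, qf S v = d * ((l ⬝ᵥ v) * (m ⬝ᵥ v))) :
    S = (d / 2) • (Matrix.vecMulVec l m + Matrix.vecMulVec m l) := by
  rw [← sub_eq_zero]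
  refine eq_zero_of_qf_eq_zero ?_ h2 fun v => ?_
  · rw [Matrix.transpose_sub, Matrix.transpose_smul, Matrix.transpose_add,
      Matrix.transpose_vecMulVec, Matrix.transpose_vecMulVec, hS, add_comm]
  · rw [sub_eq_add_neg, ← neg_smul, show S = (1 : K) • S from (one_smul K S).symm, qf_linear_comb,
      one_mul, qf_vecMulVec_add, h]
    field_simp
    ring

/-! ### Lines and planes via cross products -/

/-- A vector orthogonal to two independent covectors is a multiple of their cross product.
[folklore] -/
theorem exists_smul_cross_of_dot_eq_zero {l m p : Fin 3 → K} (hlm : LinearIndependent K ![l, m])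
    (h1 : l ⬝ᵥ p = 0) (h2 : m ⬝ᵥ p = 0) : ∃ a : K, a • (l ⨯₃ m) = p := by
  have hn : l ⨯₃ m ≠ 0 := crossProduct_ne_zero_iff_linearIndependent.mpr hlm
  have h0 : (l ⨯₃ m) ⨯₃ p = 0 := by
    rw [cross_cross_eq_smul_sub_smul, h1, h2, zero_smul, zero_smul, sub_zero]
  have hdep : ¬LinearIndependent K ![l ⨯₃ m, p] := fun h =>
    (crossProduct_ne_zero_iff_linearIndependent.mpr h) h0
  rw [LinearIndependent.pair_iff' hn] at hdep
  push Not at hdep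
  exact hdep

/-- Two vectors orthogonal to two independent covectors are proportional. [folklore] -/
theorem exists_smul_of_dot_eq_zero {l m p q : Fin 3 → K} (hlm : LinearIndependent K ![l, m])
    (hp1 : l ⬝ᵥ p = 0) (hp2 : m ⬝ᵥ p = 0) (hq1 : l ⬝ᵥ q = 0) (hq2 : m ⬝ᵥ q = 0) (hp : p ≠ 0) :
    ∃ c : K, q = c • p := by
  obtain ⟨a, rfl⟩ := exists_smul_cross_of_dot_eq_zero hlm hp1 hp2
  obtain ⟨b, rfl⟩ := exists_smul_cross_of_dot_eq_zero hlm hq1 hq2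
  have ha : a ≠ 0 := by rintro rfl; exact hp (zero_smul _ _)
  exact ⟨b / a, by rw [smul_smul, div_mul_cancel₀ b ha]⟩

/-- **A plane is spanned by any two independent vectors in it**: if `ℓ ≠ 0` vanishes on
`p₁, p₂, w` with `p₁, p₂` independent, then `w ∈ span(p₁, p₂)`. [folklore] -/
theorem exists_eq_lin_of_dot_eq_zero {l p₁ p₂ w : Fin 3 → K} (hl : l ≠ 0) (h1 : l ⬝ᵥ p₁ = 0)
    (h2 : l ⬝ᵥ p₂ = 0) (hw : l ⬝ᵥ w = 0) (hind : LinearIndependent K ![p₁, p₂]) :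
    ∃ a b : K, w = a • p₁ + b • p₂ := by
  -- the rows `w, p₁, p₂` are dependent since they are orthogonal to `ℓ ≠ 0`
  have hdet : Matrix.det ![w, p₁, p₂] = 0 := by
    rw [← Matrix.exists_mulVec_eq_zero_iff]
    refine ⟨l, hl, ?_⟩
    ext i
    fin_cases i
    · simpa [Matrix.mulVec, dotProduct_comm] using hw
    · simpa [Matrix.mulVec, dotProduct_comm] using h1
    · simpa [Matrix.mulVec, dotProduct_comm] using h2
  obtain ⟨c, hc0, hc⟩ := Matrix.exists_vecMul_eq_zero_iff.mpr hdet
  have hcomb : c 0 • w + c 1 • p₁ + c 2 • p₂ = 0 := by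
    have : c ᵥ* ![w, p₁, p₂] = c 0 • w + c 1 • p₁ + c 2 • p₂ := by
      ext j
      simp [Matrix.vecMul, dotProduct, Fin.sum_univ_three]
    rw [← this, hc]
  by_cases h0 : c 0 = 0
  · exfalso
    rw [h0, zero_smul, zero_add] at hcomb
    have := (LinearIndependent.pair_iff.mp hind) (c 1) (c 2) hcomb
    apply hc0
    ext i; fin_cases i
    · exact h0
    · exact this.1
    · exact this.2
  · refine ⟨-(c 1 / c 0), -(c 2 / c 0), ?_⟩
    rw [add_assoc] at hcomb
    have key : c 0 • w = -(c 1 • p₁ + c 2 • p₂) := eq_neg_of_add_eq_zero_left hcomb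
    calc w = (c 0)⁻¹ • (c 0 • w) := by rw [smul_smul, inv_mul_cancel₀ h0, one_smul]
      _ = -(c 1 / c 0) • p₁ + -(c 2 / c 0) • p₂ := by rw [key]; module

/-- **A binary quadratic form with three projective zeros vanishes**: if the symmetric `S`
vanishes at three pairwise independent vectors of the plane `ker ℓ`, it vanishes on `ker ℓ`
(`char ≠ 2`). [folklore] -/
theorem qf_eq_zero_on_ker_of_three {S : Matrix (Fin 3) (Fin 3) K} (hS : Sᵀ = S) (h2 : (2 : K) ≠ 0)
    {l p₁ p₂ p₃ : Fin 3 → K} (hl : l ≠ 0) (hl1 : l ⬝ᵥ p₁ = 0) (hl2 : l ⬝ᵥ p₂ = 0)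
    (hl3 : l ⬝ᵥ p₃ = 0) (hq1 : qf S p₁ = 0) (hq2 : qf S p₂ = 0) (hq3 : qf S p₃ = 0)
    (h12 : LinearIndependent K ![p₁, p₂]) (h13 : LinearIndependent K ![p₁, p₃])
    (h23 : LinearIndependent K ![p₂, p₃]) :
    ∀ w, l ⬝ᵥ w = 0 → qf S w = 0 := by
  have hp1 : p₁ ≠ 0 := h12.ne_zero 0
  have hp2 : p₂ ≠ 0 := h23.ne_zero 0
  -- the polar form vanishes on `(p₁, p₂)`
  obtain ⟨a, b, h3⟩ := exists_eq_lin_of_dot_eq_zero hl hl1 hl2 hl3 h12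
  have ha : a ≠ 0 := by
    rintro rfl
    rw [zero_smul, zero_add] at h3
    rw [LinearIndependent.pair_iff' hp2] at h23
    exact h23 b h3.symm
  have hb : b ≠ 0 := by
    rintro rfl
    rw [zero_smul, add_zero] at h3
    rw [LinearIndependent.pair_iff' hp1] at h13
    exact h13 a h3.symm
  have hpolar : p₁ ⬝ᵥ S *ᵥ p₂ = 0 := by
    have := hq3
    rw [h3, qf_lin hS, hq1, hq2, mul_zero, mul_zero, zero_add, add_zero] at this
    simpa [h2, ha, hb] using this
  intro w hw
  obtain ⟨c, d, rfl⟩ := exists_eq_lin_of_dot_eq_zero hl hl1 hl2 hw h12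
  rw [qf_lin hS, hq1, hq2, hpolar, mul_zero, mul_zero, mul_zero, zero_add, add_zero]

/-- **A ternary quadratic form vanishing on the plane `ker ℓ` is `ℓ · ℓ₃`.** [folklore] -/
theorem exists_qf_eq_mul_of_vanish {S : Matrix (Fin 3) (Fin 3) K} (hS : Sᵀ = S)
    {l : Fin 3 → K} (hl : l ≠ 0) (h : ∀ w, l ⬝ᵥ w = 0 → qf S w = 0) :
    ∃ l₃ : Fin 3 → K, ∀ v, qf S v = (l ⬝ᵥ v) * (l₃ ⬝ᵥ v) := by
  obtain ⟨i, hi⟩ := Function.ne_iff.mp hl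
  rw [Pi.zero_apply] at hi
  -- `v₁` with `ℓ(v₁) = 1`
  set v₁ : Fin 3 → K := (l i)⁻¹ • Pi.single i 1 with hv₁
  have hlv₁ : l ⬝ᵥ v₁ = 1 := by
    rw [hv₁, dotProduct_smul, dotProduct_single_one, smul_eq_mul, inv_mul_cancel₀ hi]
  refine ⟨(2 : K) • (v₁ ᵥ* S) - qf S v₁ • l, fun v => ?_⟩
  -- `v - ℓ(v) v₁ ∈ ker ℓ`
  have hker : l ⬝ᵥ (v - (l ⬝ᵥ v) • v₁) = 0 := by
    rw [dotProduct_sub, dotProduct_smul, hlv₁, smul_eq_mul, mul_one, sub_self]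
  have h0 := h _ hker
  rw [qf_sub_smul hS] at h0
  have hpol : v ⬝ᵥ S *ᵥ v₁ = v₁ ᵥ* S ⬝ᵥ v := by
    rw [dotProduct_mulVec_symm hS, Matrix.dotProduct_mulVec]
  rw [sub_dotProduct, smul_dotProduct, smul_dotProduct, smul_eq_mul, smul_eq_mul, ← hpol]
  linear_combination h0

/-- **A covector vanishing on `ker ℓ` is a multiple of `ℓ`.** [folklore] -/
theorem exists_eq_smul_of_vanish_on_ker {l l₄ : Fin 3 → K} (hl : l ≠ 0)
    (h : ∀ w, l ⬝ᵥ w = 0 → l₄ ⬝ᵥ w = 0) : ∃ c : K, l₄ = c • l := by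
  obtain ⟨i, hi⟩ := Function.ne_iff.mp hl
  rw [Pi.zero_apply] at hi
  refine ⟨l₄ i / l i, ?_⟩
  -- `ℓ₄ - c ℓ` vanishes on `ker ℓ` and on `e_i`
  have key : ∀ v, (l₄ - (l₄ i / l i) • l) ⬝ᵥ v = 0 := by
    intro v
    set w := v - (l ⬝ᵥ v / l i) • (Pi.single i 1 : Fin 3 → K) with hw
    have hw0 : l ⬝ᵥ w = 0 := by
      rw [hw, dotProduct_sub, dotProduct_smul, dotProduct_single_one, smul_eq_mul,
        div_mul_cancel₀ _ hi, sub_self]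
    have hv : v = w + (l ⬝ᵥ v / l i) • (Pi.single i 1 : Fin 3 → K) := by rw [hw, sub_add_cancel]
    have hA : (l₄ - (l₄ i / l i) • l) ⬝ᵥ w = 0 := by
      rw [sub_dotProduct, smul_dotProduct, h w hw0, hw0, smul_zero, sub_zero]
    have hB : (l₄ - (l₄ i / l i) • l) ⬝ᵥ (Pi.single i 1 : Fin 3 → K) = 0 := by
      rw [dotProduct_single_one, Pi.sub_apply, Pi.smul_apply, smul_eq_mul, div_mul_cancel₀ _ hi,
        sub_self]
    rw [hv, dotProduct_add, dotProduct_smul, hA, hB, smul_zero, add_zero]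
  have : l₄ - (l₄ i / l i) • l = 0 := by
    ext j
    have := key (Pi.single j 1)
    rwa [dotProduct_single_one] at this
  exact sub_eq_zero.mp this

/-- Representatives: a set of vectors with no pairwise-independent triple is covered by two lines.
[folklore] -/
theorem exists_two_reps {A : Set (Fin 3 → K)} (hA0 : ∀ p ∈ A, p ≠ 0)
    (h : ¬∃ p₁ ∈ A, ∃ p₂ ∈ A, ∃ p₃ ∈ A, LinearIndependent K ![p₁, p₂] ∧
      LinearIndependent K ![p₁, p₃] ∧ LinearIndependent K ![p₂, p₃]) :
    ∃ r₁ r₂ : Fin 3 → K, ∀ p ∈ A, (∃ c : K, p = c • r₁) ∨ (∃ c : K, p = c • r₂) := by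
  by_cases hA : ∃ p₁, p₁ ∈ A
  · obtain ⟨p₁, hp₁⟩ := hA
    by_cases hall : ∀ p ∈ A, ∃ c : K, p = c • p₁
    · exact ⟨p₁, p₁, fun p hp => Or.inl (hall p hp)⟩
    · push Not at hall
      obtain ⟨p₂, hp₂, hne⟩ := hall
      have h12 : LinearIndependent K ![p₁, p₂] := by
        rw [LinearIndependent.pair_iff' (hA0 p₁ hp₁)]
        intro a ha; exact hne a ha.symm
      refine ⟨p₁, p₂, fun p hp => ?_⟩
      by_contra hcon
      push Not at hcon
      apply h
      refine ⟨p₁, hp₁, p₂, hp₂, p, hp, h12, ?_, ?_⟩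
      · rw [LinearIndependent.pair_iff' (hA0 p₁ hp₁)]
        intro a ha; exact hcon.1 a ha.symm
      · rw [LinearIndependent.pair_iff' (hA0 p₂ hp₂)]
        intro a ha; exact hcon.2 a ha.symm
  · push Not at hA
    exact ⟨0, 0, fun p hp => absurd hp (hA p)⟩


/-- **The asymmetric step.**  Two independent conics `Q_S, Q_T` through points of the two planes
`ker ℓ₁ ∪ ker ℓ₂` (both through `v₀`), with `Q_S` and `Q_T` vanishing on `ker ℓ₁` and `Q_S` on
`ker ℓ₂`: the points off `ker ℓ₁` are pairwise proportional. [folklore] -/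
theorem exists_smul_of_two_conics (h2 : (2 : K) ≠ 0) {S T : Matrix (Fin 3) (Fin 3) K}
    (hS : Sᵀ = S) (hT : Tᵀ = T) (hind : ∀ x y : K, x • S + y • T = 0 → x = 0 ∧ y = 0)
    {l₁ l₂ v₀ z₂ : Fin 3 → K} (hl₁ : l₁ ≠ 0) (hl₂ : l₂ ≠ 0)
    (hl₂v : l₂ ⬝ᵥ v₀ = 0) (hl₂z : l₂ ⬝ᵥ z₂ = 0) (hvz : LinearIndependent K ![v₀, z₂])
    (hl₁v : l₁ ⬝ᵥ v₀ = 0) (hl₁z : l₁ ⬝ᵥ z₂ ≠ 0)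
    (hS₁ : ∀ w, l₁ ⬝ᵥ w = 0 → qf S w = 0) (hSz : qf S z₂ = 0) (hSzv : qf S (z₂ + v₀) = 0)
    (hT₁ : ∀ w, l₁ ⬝ᵥ w = 0 → qf T w = 0)
    {p p' : Fin 3 → K} (hp0 : p ≠ 0) (hp : l₁ ⬝ᵥ p ≠ 0) (hp' : l₁ ⬝ᵥ p' ≠ 0)
    (hp2 : l₂ ⬝ᵥ p = 0) (hp'2 : l₂ ⬝ᵥ p' = 0) (hTp : qf T p = 0) (hTp' : qf T p' = 0) :
    ∃ c : K, p' = c • p := by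
  obtain ⟨l₃, hl₃⟩ := exists_qf_eq_mul_of_vanish hT hl₁ hT₁
  have h3p : l₃ ⬝ᵥ p = 0 := by
    have := hTp; rw [hl₃] at this
    exact (mul_eq_zero.mp this).resolve_left hp
  have h3p' : l₃ ⬝ᵥ p' = 0 := by
    have := hTp'; rw [hl₃] at this
    exact (mul_eq_zero.mp this).resolve_left hp'
  by_cases hli : LinearIndependent K ![l₂, l₃]
  · exact exists_smul_of_dot_eq_zero hli hp2 h3p hp'2 h3p' hp0
  · exfalso
    rw [LinearIndependent.pair_iff' hl₂] at hli
    push Not at hli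
    obtain ⟨c, hc⟩ := hli
    -- `Q_T = c ℓ₁ ℓ₂`
    have hTq : ∀ v, qf T v = c * ((l₁ ⬝ᵥ v) * (l₂ ⬝ᵥ v)) := by
      intro v; rw [hl₃, ← hc, smul_dotProduct, smul_eq_mul]; ring
    -- `Q_S = ℓ₁ ℓ₄` with `ℓ₄` vanishing on `ker ℓ₂ = span(v₀, z₂)`
    obtain ⟨l₄, hl₄⟩ := exists_qf_eq_mul_of_vanish hS hl₁ hS₁
    have h4z : l₄ ⬝ᵥ z₂ = 0 := by
      have := hSz; rw [hl₄] at this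
      exact (mul_eq_zero.mp this).resolve_left hl₁z
    have h4v : l₄ ⬝ᵥ v₀ = 0 := by
      have h1 : l₁ ⬝ᵥ (z₂ + v₀) ≠ 0 := by rwa [dotProduct_add, hl₁v, add_zero]
      have := hSzv; rw [hl₄] at this
      have h2' := (mul_eq_zero.mp this).resolve_left h1
      rwa [dotProduct_add, h4z, zero_add] at h2'
    have h4ker : ∀ w, l₂ ⬝ᵥ w = 0 → l₄ ⬝ᵥ w = 0 := by
      intro w hw
      obtain ⟨a, b, rfl⟩ := exists_eq_lin_of_dot_eq_zero hl₂ hl₂v hl₂z hw hvz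
      rw [dotProduct_add, dotProduct_smul, dotProduct_smul, h4v, h4z, smul_zero, smul_zero, add_zero]
    obtain ⟨d, hd⟩ := exists_eq_smul_of_vanish_on_ker hl₂ h4ker
    have hSq : ∀ v, qf S v = d * ((l₁ ⬝ᵥ v) * (l₂ ⬝ᵥ v)) := by
      intro v; rw [hl₄, hd, smul_dotProduct, smul_eq_mul]; ring
    have hSM := eq_smul_of_qf_eq_mul hS h2 l₁ l₂ d hSq
    have hTM := eq_smul_of_qf_eq_mul hT h2 l₁ l₂ c hTq
    -- `c S - d T = 0`, so `d = 0`, so `S = 0`: contradiction with independence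
    have hrel : c • S + (-d) • T = 0 := by
      rw [hSM, hTM, smul_smul, smul_smul, ← add_smul]
      have : c * (d / 2) + -d * (c / 2) = 0 := by ring
      rw [this, zero_smul]
    obtain ⟨-, hd0⟩ := hind c (-d) hrel
    have hS0 : S = 0 := by rw [hSM, neg_eq_zero.mp hd0, zero_div, zero_smul]
    have := (hind 1 0 (by rw [hS0, smul_zero, zero_smul, add_zero])).1
    exact one_ne_zero this

/-- **A singular member of a pencil of conics** (`K` algebraically closed): for linearly
independent `S₁, S₂` there are a non-zero singular combination `S = a S₁ + b S₂` (with a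
non-zero null vector) and a complementary `T = a' S₁ + b' S₂`. [folklore] -/
theorem exists_singular_comb [IsAlgClosed K] (S₁ S₂ : Matrix (Fin 3) (Fin 3) K) :
    ∃ a b a' b' : K, a * b' - b * a' ≠ 0 ∧
      ∃ v₀ : Fin 3 → K, v₀ ≠ 0 ∧ (a • S₁ + b • S₂) *ᵥ v₀ = 0 := by
  by_cases hsing : ∃ v₀ : Fin 3 → K, v₀ ≠ 0 ∧ S₁ *ᵥ v₀ = 0
  · obtain ⟨v₀, hv₀, h0⟩ := hsing
    exact ⟨1, 0, 0, 1, by norm_num, v₀, hv₀, by rw [one_smul, zero_smul, add_zero, h0]⟩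
  · -- `S₁` is invertible; take an eigenvector of `S₁⁻¹ S₂`
    have hdet : S₁.det ≠ 0 := by
      intro hd
      obtain ⟨v, hv, h0⟩ := Matrix.exists_mulVec_eq_zero_iff.mpr hd
      exact hsing ⟨v, hv, h0⟩
    have hU : IsUnit S₁.det := isUnit_iff_ne_zero.mpr hdet
    haveI : Nontrivial (Fin 3 → K) := inferInstance
    obtain ⟨μ, hμ⟩ := Module.End.exists_eigenvalue (Matrix.toLin' (S₁⁻¹ * S₂))
    obtain ⟨v, hv⟩ := hμ.exists_hasEigenvector
    have hv0 : v ≠ 0 := hv.2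
    have hev : (S₁⁻¹ * S₂) *ᵥ v = μ • v := by
      have := Module.End.mem_eigenspace_iff.mp hv.1
      rwa [Matrix.toLin'_apply] at this
    refine ⟨-μ, 1, 1, 0, by norm_num, v, hv0, ?_⟩
    have h1 : S₂ *ᵥ v = μ • (S₁ *ᵥ v) := by
      have h3 : S₁ *ᵥ ((S₁⁻¹ * S₂) *ᵥ v) = S₁ *ᵥ (μ • v) := by rw [hev]
      rwa [Matrix.mulVec_mulVec, ← Matrix.mul_assoc, Matrix.mul_nonsing_inv S₁ hU, Matrix.one_mul,
        Matrix.mulVec_smul] at h3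
    rw [Matrix.add_mulVec, Matrix.smul_mulVec, Matrix.smul_mulVec, one_smul, h1, neg_smul,
      neg_add_cancel]

/-- **Conics through a configuration of points.**  If two linearly independent ternary quadratic
forms over an algebraically closed field of characteristic `≠ 2` vanish on a set `P` of non-zero
vectors, then EITHER the points of `P` lie on at most four lines, OR there is a plane `ker ℓ`
containing three pairwise independent points of `P` such that all points of `P` off `ker ℓ` are
pairwise proportional.  (A pencil of conics contains a line pair; intersect.) [folklore] -/
theorem conics_through_points [IsAlgClosed K] (h2 : (2 : K) ≠ 0) {S₁ S₂ : Matrix (Fin 3) (Fin 3) K}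
    (hS₁ : S₁ᵀ = S₁) (hS₂ : S₂ᵀ = S₂) (hind : ∀ a b : K, a • S₁ + b • S₂ = 0 → a = 0 ∧ b = 0)
    (P : Set (Fin 3 → K)) (hP0 : ∀ p ∈ P, p ≠ 0) (hP1 : ∀ p ∈ P, qf S₁ p = 0)
    (hP2 : ∀ p ∈ P, qf S₂ p = 0) :
    (∃ u : Fin 4 → (Fin 3 → K), ∀ p ∈ P, ∃ i, ∃ c : K, p = c • u i) ∨
    (∃ l : Fin 3 → K, l ≠ 0 ∧
      (∃ p₁ ∈ P, ∃ p₂ ∈ P, ∃ p₃ ∈ P, l ⬝ᵥ p₁ = 0 ∧ l ⬝ᵥ p₂ = 0 ∧ l ⬝ᵥ p₃ = 0 ∧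
        LinearIndependent K ![p₁, p₂] ∧ LinearIndependent K ![p₁, p₃] ∧
        LinearIndependent K ![p₂, p₃]) ∧
      ∀ p ∈ P, ∀ p' ∈ P, l ⬝ᵥ p ≠ 0 → l ⬝ᵥ p' ≠ 0 → ∃ c : K, p' = c • p) := by
  -- the singular member `S` of the pencil and its complement `T`
  obtain ⟨a, b, a', b', hdet, v₀, hv₀, hSv₀⟩ := exists_singular_comb S₁ S₂
  set S := a • S₁ + b • S₂ with hSdef
  set T := a' • S₁ + b' • S₂ with hTdef
  have hS : Sᵀ = S := by
    rw [hSdef, Matrix.transpose_add, Matrix.transpose_smul, Matrix.transpose_smul, hS₁, hS₂]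
  have hT : Tᵀ = T := by
    rw [hTdef, Matrix.transpose_add, Matrix.transpose_smul, Matrix.transpose_smul, hS₁, hS₂]
  have hindST : ∀ x y : K, x • S + y • T = 0 → x = 0 ∧ y = 0 := by
    intro x y hxy
    have h' : (x * a + y * a') • S₁ + (x * b + y * b') • S₂ = 0 := by
      rw [← hxy, hSdef, hTdef, smul_add, smul_add, smul_smul, smul_smul, smul_smul, smul_smul,
        add_smul, add_smul]
      abel
    obtain ⟨h1, h2'⟩ := hind _ _ h'
    constructor
    · have : x * (a * b' - b * a') = 0 := by linear_combination b' * h1 - a' * h2'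
      exact (mul_eq_zero.mp this).resolve_right hdet
    · have : y * (a * b' - b * a') = 0 := by linear_combination (-b) * h1 + a * h2'
      exact (mul_eq_zero.mp this).resolve_right hdet
  have hS0 : S ≠ 0 := by
    intro h0
    exact one_ne_zero (hindST 1 0 (by rw [h0, smul_zero, zero_smul, add_zero])).1
  have hPS : ∀ p ∈ P, qf S p = 0 := fun p hp => by
    rw [hSdef, qf_linear_comb, hP1 p hp, hP2 p hp, mul_zero, mul_zero, add_zero]
  have hPT : ∀ p ∈ P, qf T p = 0 := fun p hp => by
    rw [hTdef, qf_linear_comb, hP1 p hp, hP2 p hp, mul_zero, mul_zero, add_zero]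
  -- `ℓ₀` with `ℓ₀(v₀) = 1` and the projection `π` onto `ker ℓ₀` along `v₀`
  obtain ⟨i, hi⟩ := Function.ne_iff.mp hv₀
  rw [Pi.zero_apply] at hi
  set l₀ : Fin 3 → K := (v₀ i)⁻¹ • Pi.single i 1 with hl₀
  have hl₀v : l₀ ⬝ᵥ v₀ = 1 := by
    rw [hl₀, smul_dotProduct, single_one_dotProduct, smul_eq_mul, inv_mul_cancel₀ hi]
  let π : (Fin 3 → K) → (Fin 3 → K) := fun v => v - (l₀ ⬝ᵥ v) • v₀
  have hπker : ∀ v, l₀ ⬝ᵥ π v = 0 := fun v => by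
    simp only [π]; rw [dotProduct_sub, dotProduct_smul, hl₀v, smul_eq_mul, mul_one, sub_self]
  have hSv : ∀ v, v ⬝ᵥ S *ᵥ v₀ = 0 := fun v => by rw [hSv₀, dotProduct_zero]
  have hqv₀ : qf S v₀ = 0 := hSv v₀
  have hπq : ∀ v, qf S (π v) = qf S v := fun v => by
    simp only [π]; rw [qf_sub_smul hS, hSv, hqv₀, mul_zero, sub_zero, mul_zero, add_zero]
  have hπadd : ∀ v, v = π v + (l₀ ⬝ᵥ v) • v₀ := fun v => by simp only [π]; rw [sub_add_cancel]
  -- the zeros of `Q_S` in `ker ℓ₀` have no pairwise independent triple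
  have hnotriple : ∀ z₁ z₂ z₃ : Fin 3 → K, l₀ ⬝ᵥ z₁ = 0 → l₀ ⬝ᵥ z₂ = 0 → l₀ ⬝ᵥ z₃ = 0 →
      qf S z₁ = 0 → qf S z₂ = 0 → qf S z₃ = 0 → LinearIndependent K ![z₁, z₂] →
      LinearIndependent K ![z₁, z₃] → LinearIndependent K ![z₂, z₃] → False := by
    intro z₁ z₂ z₃ h1 h2' h3 q1 q2 q3 i12 i13 i23
    have hl₀0 : l₀ ≠ 0 := by
      intro h; rw [h, zero_dotProduct] at hl₀v; exact one_ne_zero hl₀v.symm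
    have hker := qf_eq_zero_on_ker_of_three hS h2 hl₀0 h1 h2' h3 q1 q2 q3 i12 i13 i23
    apply hS0
    refine eq_zero_of_qf_eq_zero hS h2 fun v => ?_
    rw [← hπq]
    exact hker _ (hπker v)
  -- planes through `v₀`: `ℓ_z := v₀ × z`
  have hcrossv : ∀ z, (v₀ ⨯₃ z) ⬝ᵥ v₀ = 0 := fun z => by rw [dotProduct_comm]; exact dot_self_cross v₀ z
  have hcrossz : ∀ z, (v₀ ⨯₃ z) ⬝ᵥ z = 0 := fun z => by rw [dotProduct_comm]; exact dot_cross_self v₀ z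
  have hindvz : ∀ z, l₀ ⬝ᵥ z = 0 → z ≠ 0 → LinearIndependent K ![v₀, z] := by
    intro z hz hz0
    rw [LinearIndependent.pair_iff]
    intro s t hst
    have h1 : s = 0 := by
      have := congrArg (fun w => l₀ ⬝ᵥ w) hst
      simp only [dotProduct_add, dotProduct_smul, hl₀v, hz, smul_eq_mul, mul_one, mul_zero,
        add_zero, dotProduct_zero] at this
      exact this
    rw [h1, zero_smul, zero_add] at hst
    exact ⟨h1, (smul_eq_zero.mp hst).resolve_right hz0⟩
  have hcross0 : ∀ z, l₀ ⬝ᵥ z = 0 → z ≠ 0 → v₀ ⨯₃ z ≠ 0 := fun z hz hz0 =>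
    crossProduct_ne_zero_iff_linearIndependent.mpr (hindvz z hz hz0)
  -- membership in the plane of `z`: `p ∈ ker (v₀ × z)` iff `π p ∈ K z` (for the direction we need)
  have hmem_of_prop : ∀ z p : Fin 3 → K, (∃ c : K, c • z = π p) → (v₀ ⨯₃ z) ⬝ᵥ p = 0 := by
    rintro z p ⟨c, hc⟩
    rw [hπadd p, ← hc, dotProduct_add, dotProduct_smul, dotProduct_smul, hcrossz, hcrossv,
      smul_zero, smul_zero, add_zero]
  have hmem_of_zero : ∀ z p : Fin 3 → K, π p = 0 → (v₀ ⨯₃ z) ⬝ᵥ p = 0 := by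
    intro z p hp
    exact hmem_of_prop z p ⟨0, by rw [zero_smul, hp]⟩
  -- `Q_S` vanishes on the whole plane `ker (v₀ × z)` when `Q_S z = 0`
  have hSplane : ∀ z, l₀ ⬝ᵥ z = 0 → z ≠ 0 → qf S z = 0 →
      ∀ w, (v₀ ⨯₃ z) ⬝ᵥ w = 0 → qf S w = 0 := by
    intro z hz hz0 hqz w hw
    obtain ⟨s, t, rfl⟩ := exists_eq_lin_of_dot_eq_zero (hcross0 z hz hz0) (hcrossv z) (hcrossz z)
      hw (hindvz z hz hz0)
    rw [qf_lin hS, hqv₀, dotProduct_mulVec_symm hS v₀ z, hSv, hqz]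
    ring
  -- `z₂ ∉` plane of `z₁` when `z₁, z₂ ∈ ker ℓ₀` are independent
  have hoff : ∀ z₁ z₂, l₀ ⬝ᵥ z₁ = 0 → z₁ ≠ 0 → l₀ ⬝ᵥ z₂ = 0 → LinearIndependent K ![z₁, z₂] →
      (v₀ ⨯₃ z₁) ⬝ᵥ z₂ ≠ 0 := by
    intro z₁ z₂ hz₁ hz₁0 hz₂ h12 h
    obtain ⟨s, t, hst⟩ := exists_eq_lin_of_dot_eq_zero (hcross0 z₁ hz₁ hz₁0) (hcrossv z₁)
      (hcrossz z₁) h (hindvz z₁ hz₁ hz₁0)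
    have hs : s = 0 := by
      have := congrArg (fun w => l₀ ⬝ᵥ w) hst
      simp only [dotProduct_add, dotProduct_smul, hl₀v, hz₁, hz₂, smul_eq_mul, mul_one, mul_zero,
        add_zero] at this
      exact this.symm
    rw [hs, zero_smul, zero_add] at hst
    rw [LinearIndependent.pair_iff' hz₁0] at h12
    exact h12 t hst.symm
  -- conversion of "no triple" statements for `exists_two_reps`
  have hconv : ∀ l : Fin 3 → K,
      (¬∃ p₁ ∈ P, ∃ p₂ ∈ P, ∃ p₃ ∈ P, l ⬝ᵥ p₁ = 0 ∧ l ⬝ᵥ p₂ = 0 ∧ l ⬝ᵥ p₃ = 0 ∧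
        LinearIndependent K ![p₁, p₂] ∧ LinearIndependent K ![p₁, p₃] ∧
        LinearIndependent K ![p₂, p₃]) →
      ¬∃ p₁ ∈ {p | p ∈ P ∧ l ⬝ᵥ p = 0}, ∃ p₂ ∈ {p | p ∈ P ∧ l ⬝ᵥ p = 0},
        ∃ p₃ ∈ {p | p ∈ P ∧ l ⬝ᵥ p = 0}, LinearIndependent K ![p₁, p₂] ∧
          LinearIndependent K ![p₁, p₃] ∧ LinearIndependent K ![p₂, p₃] := by
    rintro l hno ⟨p₁, ⟨hp₁, h1⟩, p₂, ⟨hp₂, h2'⟩, p₃, ⟨hp₃, h3⟩, i12, i13, i23⟩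
    exact hno ⟨p₁, hp₁, p₂, hp₂, p₃, hp₃, h1, h2', h3, i12, i13, i23⟩
  have hA0 : ∀ l : Fin 3 → K, ∀ p ∈ {p | p ∈ P ∧ l ⬝ᵥ p = 0}, p ≠ 0 :=
    fun l p hp => hP0 p hp.1
  by_cases hC1 : ∃ z₁ z₂ : Fin 3 → K, (l₀ ⬝ᵥ z₁ = 0 ∧ z₁ ≠ 0 ∧ qf S z₁ = 0) ∧
      (l₀ ⬝ᵥ z₂ = 0 ∧ z₂ ≠ 0 ∧ qf S z₂ = 0) ∧ LinearIndependent K ![z₁, z₂]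
  · -- two planes `ker ℓ₁ ∪ ker ℓ₂`
    obtain ⟨z₁, z₂, ⟨hz₁l, hz₁0, hz₁q⟩, ⟨hz₂l, hz₂0, hz₂q⟩, hz12⟩ := hC1
    have hz21 : LinearIndependent K ![z₂, z₁] := by
      rw [LinearIndependent.pair_symm_iff]; exact hz12
    set l₁ := v₀ ⨯₃ z₁ with hl₁
    set l₂ := v₀ ⨯₃ z₂ with hl₂
    have hl₁0 : l₁ ≠ 0 := hcross0 z₁ hz₁l hz₁0
    have hl₂0 : l₂ ≠ 0 := hcross0 z₂ hz₂l hz₂0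
    have hcover : ∀ p, qf S p = 0 → l₁ ⬝ᵥ p = 0 ∨ l₂ ⬝ᵥ p = 0 := by
      intro p hp
      by_cases hπ0 : π p = 0
      · exact Or.inl (hmem_of_zero z₁ p hπ0)
      by_cases h1 : LinearIndependent K ![z₁, π p]
      · by_cases h2'' : LinearIndependent K ![z₂, π p]
        · exact (hnotriple z₁ z₂ (π p) hz₁l hz₂l (hπker p) hz₁q hz₂q (by rw [hπq]; exact hp) hz12
            h1 h2'').elim
        · rw [LinearIndependent.pair_iff' hz₂0] at h2''
          push Not at h2''
          exact Or.inr (hmem_of_prop z₂ p h2'')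
      · rw [LinearIndependent.pair_iff' hz₁0] at h1
        push Not at h1
        exact Or.inl (hmem_of_prop z₁ p h1)
    have hl₁z₂ : l₁ ⬝ᵥ z₂ ≠ 0 := hoff z₁ z₂ hz₁l hz₁0 hz₂l hz12
    have hl₂z₁ : l₂ ⬝ᵥ z₁ ≠ 0 := hoff z₂ z₁ hz₂l hz₂0 hz₁l hz21
    have hS₁ : ∀ w, l₁ ⬝ᵥ w = 0 → qf S w = 0 := hSplane z₁ hz₁l hz₁0 hz₁q
    have hS₂ : ∀ w, l₂ ⬝ᵥ w = 0 → qf S w = 0 := hSplane z₂ hz₂l hz₂0 hz₂q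
    have hq₂v : qf S (z₂ + v₀) = 0 := hS₂ _ (by rw [dotProduct_add, hcrossz, hcrossv, add_zero])
    have hq₁v : qf S (z₁ + v₀) = 0 := hS₁ _ (by rw [dotProduct_add, hcrossz, hcrossv, add_zero])
    by_cases hA : ∃ p₁ ∈ P, ∃ p₂ ∈ P, ∃ p₃ ∈ P, l₁ ⬝ᵥ p₁ = 0 ∧ l₁ ⬝ᵥ p₂ = 0 ∧ l₁ ⬝ᵥ p₃ = 0 ∧
        LinearIndependent K ![p₁, p₂] ∧ LinearIndependent K ![p₁, p₃] ∧
        LinearIndependent K ![p₂, p₃]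
    · right
      refine ⟨l₁, hl₁0, hA, ?_⟩
      obtain ⟨p₁, hp₁, p₂, hp₂, p₃, hp₃, h1, h2', h3, i12, i13, i23⟩ := hA
      have hT₁ : ∀ w, l₁ ⬝ᵥ w = 0 → qf T w = 0 :=
        qf_eq_zero_on_ker_of_three hT h2 hl₁0 h1 h2' h3 (hPT _ hp₁) (hPT _ hp₂) (hPT _ hp₃)
          i12 i13 i23
      intro p hp p' hp' hl hl'
      have hp2 : l₂ ⬝ᵥ p = 0 := (hcover p (hPS p hp)).resolve_left hl
      have hp'2 : l₂ ⬝ᵥ p' = 0 := (hcover p' (hPS p' hp')).resolve_left hl'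
      exact exists_smul_of_two_conics h2 hS hT hindST hl₁0 hl₂0 (hcrossv z₂) (hcrossz z₂)
        (hindvz z₂ hz₂l hz₂0) (hcrossv z₁) hl₁z₂ hS₁ hz₂q hq₂v hT₁ (hP0 p hp) hl hl' hp2 hp'2
        (hPT p hp) (hPT p' hp')
    by_cases hA' : ∃ p₁ ∈ P, ∃ p₂ ∈ P, ∃ p₃ ∈ P, l₂ ⬝ᵥ p₁ = 0 ∧ l₂ ⬝ᵥ p₂ = 0 ∧ l₂ ⬝ᵥ p₃ = 0 ∧
        LinearIndependent K ![p₁, p₂] ∧ LinearIndependent K ![p₁, p₃] ∧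
        LinearIndependent K ![p₂, p₃]
    · right
      refine ⟨l₂, hl₂0, hA', ?_⟩
      obtain ⟨p₁, hp₁, p₂, hp₂, p₃, hp₃, h1, h2', h3, i12, i13, i23⟩ := hA'
      have hT₂ : ∀ w, l₂ ⬝ᵥ w = 0 → qf T w = 0 :=
        qf_eq_zero_on_ker_of_three hT h2 hl₂0 h1 h2' h3 (hPT _ hp₁) (hPT _ hp₂) (hPT _ hp₃)
          i12 i13 i23
      intro p hp p' hp' hl hl'
      have hp1 : l₁ ⬝ᵥ p = 0 := (hcover p (hPS p hp)).resolve_right hl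
      have hp'1 : l₁ ⬝ᵥ p' = 0 := (hcover p' (hPS p' hp')).resolve_right hl'
      exact exists_smul_of_two_conics h2 hS hT hindST hl₂0 hl₁0 (hcrossv z₁) (hcrossz z₁)
        (hindvz z₁ hz₁l hz₁0) (hcrossv z₂) hl₂z₁ hS₂ hz₁q hq₁v hT₂ (hP0 p hp) hl hl' hp1 hp'1
        (hPT p hp) (hPT p' hp')
    · left
      obtain ⟨r₁, r₂, hr⟩ := exists_two_reps (hA0 l₁) (hconv l₁ hA)
      obtain ⟨r₃, r₄, hr'⟩ := exists_two_reps (hA0 l₂) (hconv l₂ hA')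
      refine ⟨![r₁, r₂, r₃, r₄], fun p hp => ?_⟩
      rcases hcover p (hPS p hp) with h | h
      · rcases hr p ⟨hp, h⟩ with ⟨c, hc⟩ | ⟨c, hc⟩
        · exact ⟨0, c, hc⟩
        · exact ⟨1, c, hc⟩
      · rcases hr' p ⟨hp, h⟩ with ⟨c, hc⟩ | ⟨c, hc⟩
        · exact ⟨2, c, hc⟩
        · exact ⟨3, c, hc⟩
  · -- at most one direction of zeros in `ker ℓ₀`
    push Not at hC1
    by_cases hex : ∃ z₁ : Fin 3 → K, l₀ ⬝ᵥ z₁ = 0 ∧ z₁ ≠ 0 ∧ qf S z₁ = 0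
    · obtain ⟨z₁, hz₁l, hz₁0, hz₁q⟩ := hex
      set l₁ := v₀ ⨯₃ z₁ with hl₁
      have hl₁0 : l₁ ≠ 0 := hcross0 z₁ hz₁l hz₁0
      have hall : ∀ p, qf S p = 0 → l₁ ⬝ᵥ p = 0 := by
        intro p hp
        by_cases hπ0 : π p = 0
        · exact hmem_of_zero z₁ p hπ0
        · have := hC1 z₁ (π p) ⟨hz₁l, hz₁0, hz₁q⟩ ⟨hπker p, hπ0, by rw [hπq]; exact hp⟩
          rw [LinearIndependent.pair_iff' hz₁0] at this
          push Not at this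
          exact hmem_of_prop z₁ p this
      by_cases hA : ∃ p₁ ∈ P, ∃ p₂ ∈ P, ∃ p₃ ∈ P, l₁ ⬝ᵥ p₁ = 0 ∧ l₁ ⬝ᵥ p₂ = 0 ∧ l₁ ⬝ᵥ p₃ = 0 ∧
          LinearIndependent K ![p₁, p₂] ∧ LinearIndependent K ![p₁, p₃] ∧
          LinearIndependent K ![p₂, p₃]
      · right
        refine ⟨l₁, hl₁0, hA, ?_⟩
        intro p hp p' _ hl _
        exact absurd (hall p (hPS p hp)) hl
      · left
        obtain ⟨r₁, r₂, hr⟩ := exists_two_reps (hA0 l₁) (hconv l₁ hA)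
        refine ⟨![r₁, r₂, 0, 0], fun p hp => ?_⟩
        rcases hr p ⟨hp, hall p (hPS p hp)⟩ with ⟨c, hc⟩ | ⟨c, hc⟩
        · exact ⟨0, c, hc⟩
        · exact ⟨1, c, hc⟩
    · push Not at hex
      left
      refine ⟨![v₀, 0, 0, 0], fun p hp => ⟨0, l₀ ⬝ᵥ p, ?_⟩⟩
      have hπ0 : π p = 0 := by
        by_contra hne
        exact hex (π p) (hπker p) hne (by rw [hπq]; exact hPS p hp)
      calc p = π p + (l₀ ⬝ᵥ p) • v₀ := hπadd p
        _ = (l₀ ⬝ᵥ p) • ![v₀, 0, 0, 0] 0 := by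
          rw [hπ0, zero_add]; rfl

end Geometry


/-! ## Involutions of `SL₃` in characteristic `3` and the existence of a semisimple element of
order `≥ 4` in a simple subgroup -/

section Elements

variable {K : Type u} [Field K]

/-- **An involution of `SL₃` has trace `-1`** (Cayley–Hamilton with `adj g = g⁻¹ = g`).
[folklore] -/
theorem trace_eq_neg_one_of_mul_self {G : Matrix (Fin 3) (Fin 3) K} (hG2 : G * G = 1)
    (hdet : G.det = 1) (hG1 : G ≠ 1) : G.trace = -1 := by
  have hadj : G.adjugate = G := by
    have h := Matrix.mul_adjugate G
    rw [hdet, one_smul] at h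
    calc G.adjugate = (G * G) * G.adjugate := by rw [hG2, Matrix.one_mul]
      _ = G * (G * G.adjugate) := by rw [Matrix.mul_assoc]
      _ = G := by rw [h, Matrix.mul_one]
  have hCH := cayleyHamilton_fin_three G
  have hG3 : G ^ 3 = G := by rw [pow_succ, pow_two, hG2, Matrix.one_mul]
  rw [hG3, pow_two, hG2, hadj, hdet, one_smul] at hCH
  have h2 : (1 + G.trace) • (G - 1) = 0 := by rw [← hCH]; module
  by_contra ht
  have hne : 1 + G.trace ≠ 0 := fun h0 => ht (by linear_combination h0)
  apply hG1
  have := congrArg (fun M => (1 + G.trace)⁻¹ • M) h2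
  simp only [smul_smul, inv_mul_cancel₀ hne, one_smul, smul_zero] at this
  exact sub_eq_zero.mp this

/-- For an involution `g` in characteristic `3`, `E = -(1 + g)` (`= (1 + g)/2`) is idempotent.
[folklore] -/
theorem idempotent_neg_one_add [CharP K 3] {G : Matrix (Fin 3) (Fin 3) K} (hG2 : G * G = 1) :
    (-(1 + G)) * (-(1 + G)) = -(1 + G) := by
  have h3 : (3 : K) = 0 := by exact_mod_cast CharP.cast_eq_zero K 3
  rw [neg_mul_neg]
  have key : (1 + G) * (1 + G) + (1 + G) = (3 : K) • (1 + G) := by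
    rw [add_mul, mul_add, mul_add, one_mul, mul_one, one_mul, hG2]
    module
  rw [h3, zero_smul] at key
  exact eq_neg_of_add_eq_zero_left key

/-- ... and has trace `1` when `g ≠ 1` has determinant `1`. [folklore] -/
theorem trace_neg_one_add [CharP K 3] {G : Matrix (Fin 3) (Fin 3) K} (hG2 : G * G = 1)
    (hdet : G.det = 1) (hG1 : G ≠ 1) : (-(1 + G)).trace = 1 := by
  have h3 : ((3 : ℕ) : K) = 0 := CharP.cast_eq_zero K 3
  rw [Matrix.trace_neg, Matrix.trace_add, Matrix.trace_one, Fintype.card_fin, h3,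
    trace_eq_neg_one_of_mul_self hG2 hdet hG1]
  ring

/-- **An idempotent of trace `1` has rank one** (characteristic `3`): `adj E = 0`.  (By
Cayley–Hamilton `tr(adj E) = 0`; `adj E` is idempotent with vanishing trace, determinant and
adjugate, hence nilpotent, hence zero.) [folklore] -/
theorem adjugate_eq_zero_of_idempotent [CharP K 3] {E : Matrix (Fin 3) (Fin 3) K}
    (hE : E * E = E) (htr : E.trace = 1) : E.adjugate = 0 := by
  have h3 : ((3 : ℕ) : K) = 0 := CharP.cast_eq_zero K 3
  have hE0 : E ≠ 0 := by rintro rfl; rw [Matrix.trace_zero] at htr; exact one_ne_zero htr.symm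
  -- `det E = 0`
  have hdet : E.det = 0 := by
    by_contra hd
    have hU : IsUnit E.det := isUnit_iff_ne_zero.mpr hd
    have h1 : E = 1 := by
      calc E = E⁻¹ * (E * E) := by rw [← Matrix.mul_assoc, Matrix.nonsing_inv_mul E hU, Matrix.one_mul]
        _ = 1 := by rw [hE, Matrix.nonsing_inv_mul E hU]
    rw [h1, Matrix.trace_one, Fintype.card_fin, h3] at htr
    exact one_ne_zero htr.symm
  -- `tr (adj E) = 0`
  have hCH := cayleyHamilton_fin_three E
  have hE3 : E ^ 3 = E := by rw [pow_succ, pow_two, hE, hE]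
  rw [hE3, pow_two, hE, htr, one_smul, sub_self, zero_add, hdet, zero_smul, sub_zero] at hCH
  have hc2 : E.adjugate.trace = 0 := by
    by_contra hc
    apply hE0
    have := congrArg (fun M => (E.adjugate.trace)⁻¹ • M) hCH
    simpa only [smul_smul, inv_mul_cancel₀ hc, one_smul, smul_zero] using this
  -- `F = adj E` is idempotent, with `tr F = det F = 0` and `adj F = 0`
  set F := E.adjugate with hF
  have hFF : F * F = F := by rw [hF, ← Matrix.adjugate_mul_distrib, hE]
  have hdetF : F.det = 0 := by rw [hF, Matrix.det_adjugate, hdet, Fintype.card_fin]; norm_num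
  have hadjF : F.adjugate = 0 := by
    rw [hF, Matrix.adjugate_adjugate E (by rw [Fintype.card_fin]; norm_num), hdet,
      Fintype.card_fin]
    norm_num
  have hCHF := cayleyHamilton_fin_three F
  rw [hc2, zero_smul, sub_zero, hadjF, Matrix.trace_zero, zero_smul, add_zero, hdetF, zero_smul,
    sub_zero] at hCHF
  -- `F³ = 0` and `F` idempotent
  have : F ^ 3 = F := by rw [pow_succ, pow_two, hFF, hFF]
  rw [this] at hCHF
  exact hCHF

/-- The rows of a `3 × 3` matrix with vanishing adjugate have vanishing cross products (the
adjugate's columns are the cross products of pairs of rows). [folklore] -/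
theorem cross_row_eq_zero_of_adjugate_eq_zero {E : Matrix (Fin 3) (Fin 3) K} (h : E.adjugate = 0)
    (i j : Fin 3) : E i ⨯₃ E j = 0 := by
  have e := fun a b => congrFun (congrFun h a) b
  have c01 : E 0 ⨯₃ E 1 = 0 := by
    have e0 := e 0 2; have e1 := e 1 2; have e2 := e 2 2
    simp [Matrix.adjugate_fin_three] at e0 e1 e2
    rw [cross_apply]
    ext k; fin_cases k <;> simp <;>
      first
      | linear_combination e0 | linear_combination -e0
      | linear_combination e1 | linear_combination -e1
      | linear_combination e2
  have c12 : E 1 ⨯₃ E 2 = 0 := by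
    have e0 := e 0 0; have e1 := e 1 0; have e2 := e 2 0
    simp [Matrix.adjugate_fin_three] at e0 e1 e2
    rw [cross_apply]
    ext k; fin_cases k <;> simp <;>
      first
      | linear_combination e0 | linear_combination -e0
      | linear_combination e1 | linear_combination -e1
      | linear_combination e2
  have c20 : E 2 ⨯₃ E 0 = 0 := by
    have e0 := e 0 1; have e1 := e 1 1; have e2 := e 2 1
    simp [Matrix.adjugate_fin_three] at e0 e1 e2
    rw [cross_apply]
    ext k; fin_cases k <;> simp <;>
      first
      | linear_combination e0 | linear_combination -e0
      | linear_combination e1 | linear_combination -e1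
      | linear_combination e2
  have c10 : E 1 ⨯₃ E 0 = 0 := by rw [← cross_anticomm, c01, neg_zero]
  have c21 : E 2 ⨯₃ E 1 = 0 := by rw [← cross_anticomm, c12, neg_zero]
  have c02 : E 0 ⨯₃ E 2 = 0 := by rw [← cross_anticomm, c20, neg_zero]
  fin_cases i <;> fin_cases j <;>
    first
    | exact cross_self _
    | exact c01 | exact c10 | exact c12 | exact c21 | exact c20 | exact c02

/-- **A non-zero `3 × 3` matrix with vanishing adjugate is an outer product.** [folklore] -/
theorem exists_eq_vecMulVec_of_adjugate_eq_zero {E : Matrix (Fin 3) (Fin 3) K}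
    (h : E.adjugate = 0) (hE : E ≠ 0) : ∃ a φ : Fin 3 → K, E = Matrix.vecMulVec a φ := by
  obtain ⟨i₀, hi₀⟩ : ∃ i₀, E i₀ ≠ 0 := by
    by_contra hc
    push Not at hc
    exact hE (funext fun i => hc i)
  have hdep : ∀ i, ∃ a : K, a • E i₀ = E i := by
    intro i
    have h0 : E i₀ ⨯₃ E i = 0 := cross_row_eq_zero_of_adjugate_eq_zero h i₀ i
    have : ¬LinearIndependent K ![E i₀, E i] := fun hli =>
      (crossProduct_ne_zero_iff_linearIndependent.mpr hli) h0
    rw [LinearIndependent.pair_iff' hi₀] at this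
    push Not at this
    exact this
  choose a ha using hdep
  refine ⟨a, E i₀, ?_⟩
  ext i j
  rw [Matrix.vecMulVec_apply, ← ha i, Pi.smul_apply, smul_eq_mul]

/-- The sandwich identity `(a φᵀ) X (a φᵀ) = (φᵀ X a) · a φᵀ`. [folklore] -/
theorem vecMulVec_mul_mul_vecMulVec (a φ : Fin 3 → K) (X : Matrix (Fin 3) (Fin 3) K) :
    Matrix.vecMulVec a φ * X * Matrix.vecMulVec a φ = ((φ ᵥ* X) ⬝ᵥ a) • Matrix.vecMulVec a φ := by
  rw [Matrix.vecMulVec_mul, Matrix.vecMulVec_mul_vecMulVec, Matrix.vecMulVec_smul]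

/-- **Two distinct commuting rank-one idempotents are orthogonal**: `E E' = 0`. [folklore] -/
theorem mul_eq_zero_of_idempotent_of_ne {E E' : Matrix (Fin 3) (Fin 3) K} (hE : E * E = E)
    (hE' : E' * E' = E') (ha : ∃ a φ : Fin 3 → K, E = Matrix.vecMulVec a φ)
    (ha' : ∃ a φ : Fin 3 → K, E' = Matrix.vecMulVec a φ) (hcomm : E * E' = E' * E)
    (hne : E ≠ E') : E * E' = 0 := by
  obtain ⟨a, φ, hEa⟩ := ha
  obtain ⟨a', φ', hEa'⟩ := ha'
  -- `E E' = E E' E = c E` and `E E' = E' E E' = c' E'`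
  have hP1 : E * E' = ((φ ᵥ* E') ⬝ᵥ a) • E := by
    have h1 : E * E' = E * E' * E := by
      calc E * E' = E * (E * E') := by rw [← Matrix.mul_assoc, hE]
        _ = E * (E' * E) := by rw [hcomm]
        _ = E * E' * E := by rw [Matrix.mul_assoc]
    rw [h1, hEa, vecMulVec_mul_mul_vecMulVec a φ]
  have hP2 : E * E' = ((φ' ᵥ* E) ⬝ᵥ a') • E' := by
    have h1 : E * E' = E' * E * E' := by
      calc E * E' = E * (E' * E') := by rw [hE']
        _ = E * E' * E' := by rw [Matrix.mul_assoc]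
        _ = E' * E * E' := by rw [hcomm]
    rw [h1, hEa', vecMulVec_mul_mul_vecMulVec a' φ']
  have hPP : (E * E') * (E * E') = E * E' := by
    calc E * E' * (E * E') = E * (E' * E) * E' := by simp only [Matrix.mul_assoc]
      _ = E * (E * E') * E' := by rw [hcomm]
      _ = (E * E) * (E' * E') := by simp only [Matrix.mul_assoc]
      _ = E * E' := by rw [hE, hE']
  -- the scalars are `0` or `1`
  have hsc : ∀ (c : K) (M : Matrix (Fin 3) (Fin 3) K), M * M = M → E * E' = c • M →
      c = 0 ∨ E * E' = M := by
    intro c M hM hPc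
    by_cases hc : c = 0
    · exact Or.inl hc
    · right
      have h1 : (c * c - c) • M = 0 := by
        have := hPP
        rw [hPc, Matrix.smul_mul, Matrix.mul_smul, hM, smul_smul] at this
        rw [sub_smul, this, sub_self]
      rcases smul_eq_zero.mp h1 with h1 | h1
      · have : c = 1 := by
          have : c * (c - 1) = 0 := by rw [mul_sub, mul_one]; exact h1
          rcases mul_eq_zero.mp this with h | h
          · exact absurd h hc
          · exact sub_eq_zero.mp h
        rw [hPc, this, one_smul]
      · rw [hPc, h1, smul_zero]
  rcases hsc _ _ hE hP1 with h1 | h1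
  · rw [hP1, h1, zero_smul]
  rcases hsc _ _ hE' hP2 with h2 | h2
  · rw [hP2, h2, zero_smul]
  · exact absurd (h1.symm.trans h2) hne

/-- **There are no three pairwise commuting involutions `t₁, t₂, t₃ ≠ t₁ t₂` in `SL₃(K)`,
`char K = 3`** (an elementary abelian `2`-subgroup of `SL₃` in characteristic `3` has order `≤ 4`):
the rank-one idempotents `E_t = -(1 + t)` of `t₁, t₂, t₁t₂` are orthogonal and sum to `1`, and
`E_{t₃}` is orthogonal to all three. [folklore] -/
theorem false_of_three_involutions [CharP K 3] {T₁ T₂ T₃ : Matrix (Fin 3) (Fin 3) K}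
    (h1 : T₁ * T₁ = 1) (h2 : T₂ * T₂ = 1) (h3 : T₃ * T₃ = 1) (hd1 : T₁.det = 1) (hd2 : T₂.det = 1)
    (hd3 : T₃.det = 1) (hne1 : T₁ ≠ 1) (hne2 : T₂ ≠ 1) (hne3 : T₃ ≠ 1) (h12 : T₁ ≠ T₂)
    (h13 : T₃ ≠ T₁) (h23 : T₃ ≠ T₂) (h312 : T₃ ≠ T₁ * T₂) (c12 : T₁ * T₂ = T₂ * T₁)
    (c13 : T₁ * T₃ = T₃ * T₁) (c23 : T₂ * T₃ = T₃ * T₂) : False := by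
  have hK3 : (3 : K) = 0 := by exact_mod_cast CharP.cast_eq_zero K 3
  -- the product `t₁ t₂` is a fourth involution
  have h4 : (T₁ * T₂) * (T₁ * T₂) = 1 := by
    calc T₁ * T₂ * (T₁ * T₂) = T₁ * (T₂ * T₁) * T₂ := by simp only [Matrix.mul_assoc]
      _ = T₁ * (T₁ * T₂) * T₂ := by rw [c12]
      _ = (T₁ * T₁) * (T₂ * T₂) := by simp only [Matrix.mul_assoc]
      _ = 1 := by rw [h1, h2, Matrix.mul_one]
  have hd4 : (T₁ * T₂).det = 1 := by rw [Matrix.det_mul, hd1, hd2, mul_one]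
  have hne4 : T₁ * T₂ ≠ 1 := by
    intro h
    apply h12
    calc T₁ = T₁ * (T₂ * T₂) := by rw [h2, Matrix.mul_one]
      _ = T₂ := by rw [← Matrix.mul_assoc, h, Matrix.one_mul]
  -- rank-one idempotents
  have hidem := fun (T : Matrix (Fin 3) (Fin 3) K) (h : T * T = 1) => idempotent_neg_one_add h
  have houter : ∀ T : Matrix (Fin 3) (Fin 3) K, T * T = 1 → T.det = 1 → T ≠ 1 →
      ∃ a φ : Fin 3 → K, -(1 + T) = Matrix.vecMulVec a φ := by
    intro T h hd hne
    refine exists_eq_vecMulVec_of_adjugate_eq_zero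
      (adjugate_eq_zero_of_idempotent (hidem T h) (trace_neg_one_add h hd hne)) ?_
    intro h0
    have := trace_neg_one_add h hd hne
    rw [h0, Matrix.trace_zero] at this
    exact one_ne_zero this.symm
  have hcommE : ∀ T T' : Matrix (Fin 3) (Fin 3) K, T * T' = T' * T →
      (-(1 + T)) * (-(1 + T')) = (-(1 + T')) * (-(1 + T)) := by
    intro T T' hc
    rw [neg_mul_neg, neg_mul_neg, add_mul, mul_add, mul_add, add_mul, mul_add, mul_add, hc]
    simp only [one_mul, mul_one]
    abel
  have hneE : ∀ T T' : Matrix (Fin 3) (Fin 3) K, T ≠ T' → -(1 + T) ≠ -(1 + T') := by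
    intro T T' hne h
    exact hne (add_left_cancel (neg_injective h))
  have horth : ∀ T T' : Matrix (Fin 3) (Fin 3) K, T * T = 1 → T.det = 1 → T ≠ 1 → T' * T' = 1 →
      T'.det = 1 → T' ≠ 1 → T * T' = T' * T → T ≠ T' → (-(1 + T)) * (-(1 + T')) = 0 := by
    intro T T' h hd hne h' hd' hne' hc hne''
    exact mul_eq_zero_of_idempotent_of_ne (hidem T h) (hidem T' h') (houter T h hd hne)
      (houter T' h' hd' hne') (hcommE T T' hc) (hneE T T' hne'')
  -- `E₁ E₂ = 0` gives `E₁ + E₂ + E₁₂ = 1`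
  have h12z := horth T₁ T₂ h1 hd1 hne1 h2 hd2 hne2 c12 h12
  have hexp : 1 + T₂ + T₁ + T₁ * T₂ = 0 := by
    rw [neg_mul_neg, add_mul, mul_add, mul_add, one_mul, mul_one, one_mul] at h12z
    rw [← h12z]; abel
  have hsum : -(1 + T₁) + -(1 + T₂) + -(1 + T₁ * T₂) = 1 := by
    have key : -(1 + T₁) + -(1 + T₂) + -(1 + T₁ * T₂) =
        1 - (3 : K) • (1 : Matrix (Fin 3) (Fin 3) K) - (1 + T₂ + T₁ + T₁ * T₂) := by module
    rw [key, hexp, hK3, zero_smul, sub_zero, sub_zero]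
  -- `E₃` is orthogonal to `E₁, E₂, E₁₂`
  have c312 : T₃ * (T₁ * T₂) = T₁ * T₂ * T₃ := by
    rw [← Matrix.mul_assoc, ← c13, Matrix.mul_assoc, ← c23, Matrix.mul_assoc]
  have h31 := horth T₃ T₁ h3 hd3 hne3 h1 hd1 hne1 c13.symm h13
  have h32 := horth T₃ T₂ h3 hd3 hne3 h2 hd2 hne2 c23.symm h23
  have h34 := horth T₃ (T₁ * T₂) h3 hd3 hne3 h4 hd4 hne4 c312 h312
  have hE3 : -(1 + T₃) = 0 := by
    calc -(1 + T₃) = -(1 + T₃) * (-(1 + T₁) + -(1 + T₂) + -(1 + T₁ * T₂)) := by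
          rw [hsum, Matrix.mul_one]
      _ = 0 := by rw [mul_add, mul_add, h31, h32, h34, add_zero, add_zero]
  have := trace_neg_one_add h3 hd3 hne3
  rw [hE3, Matrix.trace_zero] at this
  exact one_ne_zero this.symm

/-- **A non-commutative simple finite subgroup of `SL₃(K)`, `char K = 3`, contains an element of
order prime to `3` which is not an involution.**  Otherwise every element of odd prime order
`≠ 3` would be an involution, so `|L| = 2^a 3^b`; the Sylow `2`-subgroup has exponent `2` and, by
`false_of_three_involutions`, order `≤ 4`; so a Sylow `3`-subgroup has index `≤ 4`,
contradicting simplicity (`false_of_index_le_four`). [folklore] -/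
theorem exists_coprime_mul_self_ne_one [CharP K 3] {L : Subgroup (GL (Fin 3) K)} [Finite L]
    (hsimple : IsSimpleGroup L) (hcomm : ¬∀ a b : L, a * b = b * a)
    (hdet : ∀ g ∈ L, Matrix.det ((g : GL (Fin 3) K) : Matrix (Fin 3) (Fin 3) K) = 1) :
    ∃ g ∈ L, (orderOf g).Coprime 3 ∧ g * g ≠ 1 := by
  classical
  haveI := hsimple
  haveI : Fact (Nat.Prime 3) := ⟨Nat.prime_three⟩
  haveI : Fact (Nat.Prime 2) := ⟨Nat.prime_two⟩
  by_contra hno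
  push Not at hno
  -- every element of order prime to `3` is an involution; in particular in the Sylow `2`
  have hinv : ∀ x : L, (orderOf x).Coprime 3 → x * x = 1 := by
    intro x hx
    have h := hno x x.2 (by rwa [Subgroup.orderOf_coe])
    exact Subtype.ext (by simpa using h)
  -- primes dividing `|L|` are `2` or `3`
  have hprime : ∀ q : ℕ, q.Prime → q ∣ Nat.card L → q = 2 ∨ q = 3 := by
    intro q hq hqd
    by_cases hq3 : q = 3
    · exact Or.inr hq3
    · left
      haveI : Fact q.Prime := ⟨hq⟩
      obtain ⟨x, hx⟩ := exists_prime_orderOf_dvd_card' q hqd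
      have hcop : (orderOf x).Coprime 3 := by
        rw [hx]; exact (Nat.coprime_primes hq Nat.prime_three).mpr hq3
      have h2 : orderOf x ∣ 2 := orderOf_dvd_of_pow_eq_one (by rw [pow_two]; exact hinv x hcop)
      rw [hx] at h2
      have := Nat.le_of_dvd (by norm_num) h2
      interval_cases q
      · exact absurd hq Nat.not_prime_zero
      · exact absurd hq Nat.not_prime_one
      · rfl
  -- the Sylow `2`-subgroup has order `≤ 4`
  let S : Sylow 2 L := default
  have hSinv : ∀ x : L, x ∈ (S : Subgroup L) → x * x = 1 := by
    intro x hx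
    obtain ⟨k, hk⟩ := (IsPGroup.iff_orderOf.mp S.isPGroup') ⟨x, hx⟩
    rw [Subgroup.orderOf_mk] at hk
    refine hinv x ?_
    rw [hk]
    exact Nat.Coprime.pow_left k (by norm_num)
  have hScomm : ∀ x y : L, x ∈ (S : Subgroup L) → y ∈ (S : Subgroup L) → x * y = y * x := by
    intro x y hx hy
    have hxy := hSinv (x * y) ((S : Subgroup L).mul_mem hx hy)
    have hx2 := hSinv x hx
    have hy2 := hSinv y hy
    -- `xy = (xy)⁻¹ = y⁻¹ x⁻¹ = y x`
    have ex : x⁻¹ = x := by rw [inv_eq_iff_mul_eq_one, hx2]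
    have ey : y⁻¹ = y := by rw [inv_eq_iff_mul_eq_one, hy2]
    have exy : (x * y)⁻¹ = x * y := by rw [inv_eq_iff_mul_eq_one, hxy]
    rw [mul_inv_rev, ex, ey] at exy
    exact exy.symm
  have hS4 : Nat.card S ≤ 4 := by
    by_contra hlt
    push Not at hlt
    -- the finite set of elements of `S`
    set Sf : Finset L := (Set.toFinite ((S : Subgroup L) : Set L)).toFinset with hSf
    have hmemSf : ∀ x : L, x ∈ Sf ↔ x ∈ (S : Subgroup L) := fun x => by
      rw [hSf, Set.Finite.mem_toFinset]; rfl
    have hcardSf : 4 < Sf.card := by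
      have : Nat.card S = Sf.card := by
        rw [hSf, ← Set.ncard_eq_toFinset_card _ (Set.toFinite _)]
        exact (Nat.card_coe_set_eq _)
      rwa [← this]
    -- pick `t₁ ≠ 1`, `t₂ ∉ {1, t₁}`, `t₃ ∉ {1, t₁, t₂, t₁ t₂}` in `S`
    obtain ⟨t₁, ht₁S, ht₁⟩ := Finset.exists_mem_notMem_of_card_lt_card
      (s := ({1} : Finset L)) (t := Sf) (by simp; omega)
    obtain ⟨t₂, ht₂S, ht₂⟩ := Finset.exists_mem_notMem_of_card_lt_card
      (s := ({1, t₁} : Finset L)) (t := Sf) (lt_of_le_of_lt (Finset.card_le_two) (by omega))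
    obtain ⟨t₃, ht₃S, ht₃⟩ := Finset.exists_mem_notMem_of_card_lt_card
      (s := ({1, t₁, t₂, t₁ * t₂} : Finset L)) (t := Sf)
      (lt_of_le_of_lt (Finset.card_le_four) hcardSf)
    rw [hmemSf] at ht₁S ht₂S ht₃S
    simp only [Finset.mem_singleton, Finset.mem_insert, not_or] at ht₁ ht₂ ht₃
    -- pass to matrices
    let M : L → Matrix (Fin 3) (Fin 3) K := fun t => ((t : GL (Fin 3) K) : Matrix (Fin 3) (Fin 3) K)
    have hMmul : ∀ t t' : L, M (t * t') = M t * M t' := fun t t' => by simp [M]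
    have hMinj : ∀ t t' : L, M t = M t' → t = t' := fun t t' h => Subtype.ext (Units.ext h)
    have hM1 : M 1 = 1 := by simp [M]
    have hsq : ∀ t : L, t ∈ (S : Subgroup L) → M t * M t = 1 := fun t ht => by
      rw [← hMmul, ← hM1, hSinv t ht]
    have hdetM : ∀ t : L, (M t).det = 1 := fun t => hdet _ t.2
    have hne : ∀ t t' : L, t ≠ t' → M t ≠ M t' := fun t t' h hM => h (hMinj t t' hM)
    have hc : ∀ t t' : L, t ∈ (S : Subgroup L) → t' ∈ (S : Subgroup L) →
        M t * M t' = M t' * M t := fun t t' ht ht' => by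
      rw [← hMmul, ← hMmul, hScomm t t' ht ht']
    refine false_of_three_involutions (hsq t₁ ht₁S) (hsq t₂ ht₂S) (hsq t₃ ht₃S) (hdetM t₁)
      (hdetM t₂) (hdetM t₃) ?_ ?_ ?_ (hne _ _ (Ne.symm ht₂.2)) (hne _ _ ht₃.2.1) (hne _ _ ht₃.2.2.1)
      ?_ (hc _ _ ht₁S ht₂S) (hc _ _ ht₁S ht₃S) (hc _ _ ht₂S ht₃S)
    · rw [← hM1]; exact hne _ _ ht₁
    · rw [← hM1]; exact hne _ _ ht₂.1
    · rw [← hM1]; exact hne _ _ ht₃.1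
    · rw [← hMmul]; exact hne _ _ ht₃.2.2.2
  -- a Sylow `3`-subgroup has index `≤ 4`
  let T : Sylow 3 L := default
  have hidx3 : ¬(3 ∣ (T : Subgroup L).index) := T.not_dvd_index
  have hidxpos : (T : Subgroup L).index ≠ 0 := Subgroup.index_ne_zero_of_finite
  have hidx2 : (T : Subgroup L).index = 2 ^ ((T : Subgroup L).index).primeFactorsList.length := by
    refine Nat.eq_prime_pow_of_unique_prime_dvd hidxpos fun {d} hd hdd => ?_
    rcases hprime d hd (dvd_trans hdd (Subgroup.index_dvd_card _)) with h | h
    · exact h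
    · exact absurd (h ▸ hdd) hidx3
  have hidxle : (T : Subgroup L).index ≤ 4 := by
    set k := ((T : Subgroup L).index).primeFactorsList.length
    have hdvd : 2 ^ k ∣ Nat.card L := hidx2 ▸ Subgroup.index_dvd_card _
    have hdvdS : 2 ^ k ∣ Nat.card S := S.pow_dvd_card_of_pow_dvd_card hdvd
    rw [hidx2]
    exact le_trans (Nat.le_of_dvd Nat.card_pos hdvdS) hS4
  have hTtop : (T : Subgroup L) ≠ ⊤ := by
    intro htop
    have hP : IsPGroup 3 L := by
      have := T.isPGroup'
      rw [htop] at this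
      exact IsPGroup.of_surjective this (Subgroup.topEquiv (G := L)).toMonoidHom
        (Subgroup.topEquiv (G := L)).surjective
    exact hcomm (comm_of_isPGroup hP)
  exact false_of_index_le_four hcomm (T : Subgroup L) hTtop hidxle

end Elements

/-! ## Weak adequacy of simple irreducible subgroups of `SO₃(B)` in characteristic `3` -/

section TraceDuality

variable {k : Type u} [Field k] {n : ℕ}

/-- The annihilator, under the trace pairing, of the `p'`-elements of `H`. [folklore] -/
def traceAnn (H : Subgroup (GL (Fin n) k)) : Submodule k (Matrix (Fin n) (Fin n) k) where
  carrier := {Y | ∀ g : H, (orderOf (g : GL (Fin n) k)).Coprime (ringChar k) →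
    (Y * ((g : GL (Fin n) k) : Matrix (Fin n) (Fin n) k)).trace = 0}
  add_mem' {Y Z} hY hZ g hg := by
    simp only [Set.mem_setOf_eq] at hY hZ ⊢
    rw [Matrix.add_mul, Matrix.trace_add, hY g hg, hZ g hg, add_zero]
  zero_mem' g hg := by simp
  smul_mem' c Y hY g hg := by
    simp only [Set.mem_setOf_eq] at hY ⊢
    rw [Matrix.smul_mul, Matrix.trace_smul, hY g hg, smul_zero]

/-- Membership in `traceAnn`. [folklore] -/
theorem mem_traceAnn_iff (H : Subgroup (GL (Fin n) k)) (Y : Matrix (Fin n) (Fin n) k) :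
    Y ∈ traceAnn H ↔ ∀ g : H, (orderOf (g : GL (Fin n) k)).Coprime (ringChar k) →
      (Y * ((g : GL (Fin n) k) : Matrix (Fin n) (Fin n) k)).trace = 0 := Iff.rfl

/-- **Trace duality**: if the only matrix trace-orthogonal to all `p'`-elements of `H` is `0`,
then the `p'`-elements span `M_n(k)` (weak adequacy). [folklore] -/
theorem semisimpleSpan_eq_top_of_traceAnn (H : Subgroup (GL (Fin n) k))
    (h : ∀ Y ∈ traceAnn H, Y = 0) : Subgroup.semisimpleSpan H = ⊤ := by
  classical
  by_contra hne
  obtain ⟨f, hf0, hle⟩ := Submodule.exists_le_ker_of_lt_top _ (lt_top_iff_ne_top.mpr hne)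
  -- the matrix representing `f` under the trace pairing
  let Y : Matrix (Fin n) (Fin n) k := fun i j => f (Matrix.single j i 1)
  have hYf : ∀ X : Matrix (Fin n) (Fin n) k, (Y * X).trace = f X := by
    intro X
    conv_rhs => rw [Matrix.matrix_eq_sum_single X]
    simp only [map_sum, Matrix.trace, Matrix.diag, Matrix.mul_apply, Y]
    rw [Finset.sum_comm]
    refine Finset.sum_congr rfl fun i _ => Finset.sum_congr rfl fun j _ => ?_
    rw [show Matrix.single i j (X i j) = X i j • Matrix.single i j (1 : k) by
      rw [Matrix.smul_single, smul_eq_mul, mul_one], map_smul, smul_eq_mul, mul_comm]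
  have hY : Y ∈ traceAnn H := by
    intro g hg
    rw [hYf]
    have hmem : ((g : GL (Fin n) k) : Matrix (Fin n) (Fin n) k) ∈ Subgroup.semisimpleSpan H :=
      Subgroup.mem_semisimpleSpan_of_coprime H g hg
    exact (LinearMap.mem_ker.mp (hle hmem))
  have hY0 := h Y hY
  apply hf0
  ext X
  rw [← hYf, hY0, Matrix.zero_mul, Matrix.trace_zero, LinearMap.zero_apply]

end TraceDuality

section Axes

variable {K : Type u} [Field K]

/-- Abbreviation-free helper: the matrix of `g`. -/
local notation "⇑ₘ" g => (((g : GL (Fin 3) K)) : Matrix (Fin 3) (Fin 3) K)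

/-- `g g⁻¹ = 1` on matrices. [folklore] -/
theorem val_mul_val_inv (g : GL (Fin 3) K) : (⇑ₘ g) * (⇑ₘ g⁻¹) = 1 := by
  rw [← Units.val_mul, mul_inv_cancel, Units.val_one]

/-- `g⁻¹ g = 1` on matrices. [folklore] -/
theorem val_inv_mul_val (g : GL (Fin 3) K) : (⇑ₘ g⁻¹) * (⇑ₘ g) = 1 := by
  rw [← Units.val_mul, inv_mul_cancel, Units.val_one]

/-- For `g` orthogonal: `gᵀ B = B g⁻¹`. [folklore] -/
theorem transpose_mul_eq_of_orthogonal {B : Matrix (Fin 3) (Fin 3) K} (g : GL (Fin 3) K)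
    (hg : (⇑ₘ g)ᵀ * B * (⇑ₘ g) = B) : (⇑ₘ g)ᵀ * B = B * (⇑ₘ g⁻¹) := by
  calc (⇑ₘ g)ᵀ * B = (⇑ₘ g)ᵀ * B * ((⇑ₘ g) * (⇑ₘ g⁻¹)) := by rw [val_mul_val_inv, Matrix.mul_one]
    _ = B * (⇑ₘ g⁻¹) := by rw [← Matrix.mul_assoc, hg]

/-- For `g` orthogonal: `B g = (g⁻¹)ᵀ B`. [folklore] -/
theorem mul_eq_transpose_inv_mul_of_orthogonal {B : Matrix (Fin 3) (Fin 3) K} (g : GL (Fin 3) K)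
    (hg : (⇑ₘ g)ᵀ * B * (⇑ₘ g) = B) : B * (⇑ₘ g) = (⇑ₘ g⁻¹)ᵀ * B := by
  have h2 : (⇑ₘ g⁻¹)ᵀ * ((⇑ₘ g)ᵀ * B * (⇑ₘ g)) = (⇑ₘ g⁻¹)ᵀ * B := by rw [hg]
  rw [← Matrix.mul_assoc, ← Matrix.mul_assoc, ← Matrix.transpose_mul, val_mul_val_inv,
    Matrix.transpose_one, Matrix.one_mul] at h2
  exact h2

/-- For `g` orthogonal: `B g⁻¹ = (B g)ᵀ` (`B` symmetric). [folklore] -/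
theorem mul_inv_eq_transpose_of_orthogonal {B : Matrix (Fin 3) (Fin 3) K} (hBs : Bᵀ = B)
    (g : GL (Fin 3) K) (hg : (⇑ₘ g)ᵀ * B * (⇑ₘ g) = B) : B * (⇑ₘ g⁻¹) = (B * (⇑ₘ g))ᵀ := by
  rw [Matrix.transpose_mul, hBs, transpose_mul_eq_of_orthogonal g hg]

/-- The **axis vector** of `g ∈ SO(B)`: the vector `a` with `J_B(a) = g - g⁻¹`. [folklore] -/
noncomputable def axisOf (B : Matrix (Fin 3) (Fin 3) K) (g : GL (Fin 3) K) : Fin 3 → K :=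
  ![(B * ((⇑ₘ g) - (⇑ₘ g⁻¹))) 2 1, (B * ((⇑ₘ g) - (⇑ₘ g⁻¹))) 0 2, (B * ((⇑ₘ g) - (⇑ₘ g⁻¹))) 1 0]

/-- `J_B(axis g) = g - g⁻¹`. [folklore] -/
theorem skewOf_axisOf {B : Matrix (Fin 3) (Fin 3) K} (hBs : Bᵀ = B) (hB : IsUnit B.det)
    (g : GL (Fin 3) K) (hg : (⇑ₘ g)ᵀ * B * (⇑ₘ g) = B) :
    skewOf B (axisOf B g) = (⇑ₘ g) - (⇑ₘ g⁻¹) := by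
  have hskew : (B * ((⇑ₘ g) - (⇑ₘ g⁻¹)))ᵀ = -(B * ((⇑ₘ g) - (⇑ₘ g⁻¹))) := by
    rw [Matrix.mul_sub, Matrix.transpose_sub, ← mul_inv_eq_transpose_of_orthogonal hBs g hg,
      mul_inv_eq_transpose_of_orthogonal hBs g hg, Matrix.transpose_transpose, neg_sub]
  have hd : ∀ i, (B * ((⇑ₘ g) - (⇑ₘ g⁻¹))) i i = 0 := by
    intro i
    rw [Matrix.mul_sub, Matrix.sub_apply, mul_inv_eq_transpose_of_orthogonal hBs g hg,
      Matrix.transpose_apply, sub_self]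
  rw [axisOf, skewOf, ← exists_eq_crossMatrix_of_transpose hskew hd, ← Matrix.mul_assoc,
    Matrix.nonsing_inv_mul B hB, Matrix.one_mul]

/-- `axis g = 0 ↔ g = g⁻¹`. [folklore] -/
theorem axisOf_eq_zero_iff {B : Matrix (Fin 3) (Fin 3) K} (hBs : Bᵀ = B) (hB : IsUnit B.det)
    (g : GL (Fin 3) K) (hg : (⇑ₘ g)ᵀ * B * (⇑ₘ g) = B) :
    axisOf B g = 0 ↔ (⇑ₘ g) = (⇑ₘ g⁻¹) := by
  rw [← skewOf_eq_zero_iff hB, skewOf_axisOf hBs hB g hg, sub_eq_zero]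

/-- **The axis is fixed**: `g (axis g) = axis g`. [folklore] -/
theorem mulVec_axisOf {B : Matrix (Fin 3) (Fin 3) K} (hBs : Bᵀ = B) (hB : IsUnit B.det)
    (g : GL (Fin 3) K) (hg : (⇑ₘ g)ᵀ * B * (⇑ₘ g) = B) (hdet : Matrix.det (⇑ₘ g) = 1) :
    (⇑ₘ g) *ᵥ axisOf B g = axisOf B g := by
  have h1 := conj_skewOf hB g hg hdet (axisOf B g)
  rw [skewOf_axisOf hBs hB g hg, Matrix.mul_sub, Matrix.sub_mul, Matrix.mul_assoc, val_mul_val_inv,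
    Matrix.mul_one, Matrix.one_mul, ← skewOf_axisOf hBs hB g hg] at h1
  have h2 : skewOf B ((⇑ₘ g) *ᵥ axisOf B g - axisOf B g) = 0 := by
    rw [← skewOfLin_apply, map_sub, skewOfLin_apply, skewOfLin_apply, ← h1, sub_self]
  rw [skewOf_eq_zero_iff hB, sub_eq_zero] at h2
  exact h2

/-- **Equivariance of axes**: `axis (h g h⁻¹) = h (axis g)`. [folklore] -/
theorem axisOf_conj {B : Matrix (Fin 3) (Fin 3) K} (hBs : Bᵀ = B) (hB : IsUnit B.det)
    (g h : GL (Fin 3) K) (hg : (⇑ₘ g)ᵀ * B * (⇑ₘ g) = B) (hh : (⇑ₘ h)ᵀ * B * (⇑ₘ h) = B)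
    (hhdet : Matrix.det (⇑ₘ h) = 1) (hconj : (⇑ₘ (h * g * h⁻¹))ᵀ * B * (⇑ₘ (h * g * h⁻¹)) = B) :
    axisOf B (h * g * h⁻¹) = (⇑ₘ h) *ᵥ axisOf B g := by
  have h1 := conj_skewOf hB h hh hhdet (axisOf B g)
  rw [skewOf_axisOf hBs hB g hg, Matrix.mul_sub, Matrix.sub_mul] at h1
  have h2 := skewOf_axisOf hBs hB (h * g * h⁻¹) hconj
  have e1 : (⇑ₘ (h * g * h⁻¹)) = (⇑ₘ h) * (⇑ₘ g) * (⇑ₘ h⁻¹) := by simp [Units.val_mul]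
  have e2 : (⇑ₘ (h * g * h⁻¹)⁻¹) = (⇑ₘ h) * (⇑ₘ g⁻¹) * (⇑ₘ h⁻¹) := by
    rw [mul_inv_rev, mul_inv_rev, inv_inv, ← mul_assoc]; simp [Units.val_mul]
  rw [e1, e2, h1] at h2
  have h3 : skewOf B (axisOf B (h * g * h⁻¹) - (⇑ₘ h) *ᵥ axisOf B g) = 0 := by
    rw [← skewOfLin_apply, map_sub, skewOfLin_apply, skewOfLin_apply, h2, sub_self]
  rw [skewOf_eq_zero_iff hB, sub_eq_zero] at h3
  exact h3

/-- `qf (B Y) a = (B a) · (Y a)`. [folklore] -/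
theorem qf_mul_eq {B : Matrix (Fin 3) (Fin 3) K} (hBs : Bᵀ = B) (Y : Matrix (Fin 3) (Fin 3) K)
    (a : Fin 3 → K) : qf (B * Y) a = (B *ᵥ a) ⬝ᵥ (Y *ᵥ a) := by
  rw [qf, ← Matrix.mulVec_mulVec, Matrix.dotProduct_mulVec, ← Matrix.mulVec_transpose, hBs]

/-- For `Y` in the trace annihilator and `g ∈ L` of order prime to the characteristic, every
power of `g` is annihilated. [folklore] -/
theorem trace_mul_pow_eq_zero {L : Subgroup (GL (Fin 3) K)} {Y : Matrix (Fin 3) (Fin 3) K}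
    (hY : Y ∈ traceAnn L) (g : L) (hg : (orderOf (g : GL (Fin 3) K)).Coprime (ringChar K))
    (n : ℕ) : (Y * (⇑ₘ ((g : GL (Fin 3) K) ^ n))).trace = 0 := by
  have h := hY (g ^ n) (by
    rw [Subgroup.coe_pow]
    exact Nat.Coprime.coprime_dvd_left (orderOf_pow_dvd n) hg)
  simpa using h

/-- For `Y` in the trace annihilator and `g ∈ L` of order prime to the characteristic, `g⁻¹` is
annihilated. [folklore] -/
theorem trace_mul_inv_eq_zero {L : Subgroup (GL (Fin 3) K)} {Y : Matrix (Fin 3) (Fin 3) K}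
    (hY : Y ∈ traceAnn L) (g : L) (hg : (orderOf (g : GL (Fin 3) K)).Coprime (ringChar K)) :
    (Y * (⇑ₘ (g : GL (Fin 3) K)⁻¹)).trace = 0 := by
  have h := hY g⁻¹ (by rw [Subgroup.coe_inv, orderOf_inv]; exact hg)
  simpa using h

/-- **Conics through the axes**: for `Y` in the trace annihilator with `B Y` symmetric... more
precisely for any `Y` there, the quadratic form of `B Y` vanishes at the axis of every `p'`-element
`g ∈ L` (`a aᵀ B = det B · J(a)² + Q(a) · 1` is a combination of `1, g^{±1}, g^{±2}`). [folklore] -/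
theorem qf_axisOf_eq_zero {B : Matrix (Fin 3) (Fin 3) K} (hBs : Bᵀ = B) (hB : IsUnit B.det)
    {L : Subgroup (GL (Fin 3) K)} {Y : Matrix (Fin 3) (Fin 3) K} (hY : Y ∈ traceAnn L) (g : L)
    (hg : (orderOf (g : GL (Fin 3) K)).Coprime (ringChar K))
    (hgO : (⇑ₘ (g : GL (Fin 3) K))ᵀ * B * (⇑ₘ (g : GL (Fin 3) K)) = B) :
    qf (B * Y) (axisOf B (g : GL (Fin 3) K)) = 0 := by
  set a := axisOf B (g : GL (Fin 3) K) with ha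
  have hD : skewOf B a = (⇑ₘ (g : GL (Fin 3) K)) - (⇑ₘ (g : GL (Fin 3) K)⁻¹) :=
    skewOf_axisOf hBs hB _ hgO
  -- traces of `Y` against `1, g, g⁻¹, g², g⁻²` vanish
  have t0 : (Y * 1).trace = 0 := by simpa using trace_mul_pow_eq_zero hY g hg 0
  have t1 : (Y * (⇑ₘ (g : GL (Fin 3) K))).trace = 0 := by
    simpa using trace_mul_pow_eq_zero hY g hg 1
  have t2 : (Y * ((⇑ₘ (g : GL (Fin 3) K)) * (⇑ₘ (g : GL (Fin 3) K)))).trace = 0 := by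
    simpa [pow_two, Units.val_mul] using trace_mul_pow_eq_zero hY g hg 2
  have ti : (Y * (⇑ₘ (g : GL (Fin 3) K)⁻¹)).trace = 0 := trace_mul_inv_eq_zero hY g hg
  have ti2 : (Y * ((⇑ₘ (g : GL (Fin 3) K)⁻¹) * (⇑ₘ (g : GL (Fin 3) K)⁻¹))).trace = 0 := by
    have h := hY (g⁻¹ * g⁻¹) (by
      rw [← pow_two, Subgroup.coe_pow, Subgroup.coe_inv, orderOf_pow' _ (by norm_num), orderOf_inv]
      exact Nat.Coprime.coprime_dvd_left (Nat.div_dvd_of_dvd (Nat.gcd_dvd_left _ _)) hg)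
    simpa [Units.val_mul] using h
  -- `tr (Y D²) = 0` with `D = g - g⁻¹`
  have hD2 : (Y * (skewOf B a * skewOf B a)).trace = 0 := by
    have e : ((⇑ₘ (g : GL (Fin 3) K)) - (⇑ₘ (g : GL (Fin 3) K)⁻¹)) *
        ((⇑ₘ (g : GL (Fin 3) K)) - (⇑ₘ (g : GL (Fin 3) K)⁻¹)) =
        (⇑ₘ (g : GL (Fin 3) K)) * (⇑ₘ (g : GL (Fin 3) K)) - 1 - 1 +
          (⇑ₘ (g : GL (Fin 3) K)⁻¹) * (⇑ₘ (g : GL (Fin 3) K)⁻¹) := by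
      rw [Matrix.sub_mul, Matrix.mul_sub, Matrix.mul_sub, val_mul_val_inv, val_inv_mul_val]
      abel
    rw [hD, e, Matrix.mul_add, Matrix.mul_sub, Matrix.mul_sub, Matrix.trace_add, Matrix.trace_sub,
      Matrix.trace_sub, t2, t0, ti2]
    ring
  -- the axis identity
  have hP := vecMulVec_eq_skewOf_sq hBs hB a
  have htr : (Y * Matrix.vecMulVec a (B *ᵥ a)).trace = 0 := by
    rw [hP, Matrix.mul_add, Matrix.mul_smul, Matrix.mul_smul, Matrix.trace_add, Matrix.trace_smul,
      Matrix.trace_smul, hD2, t0, smul_zero, smul_zero, add_zero]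
  rw [trace_mul_vecMulVec] at htr
  rw [qf_mul_eq hBs]
  exact htr

end Axes

section SkewPart

variable {K : Type u} [Field K]

local notation "⇑ₘ" g => (((g : GL (Fin 3) K)) : Matrix (Fin 3) (Fin 3) K)

open Polynomial in
/-- **A `p`-regular element has no nilpotent `g - g⁻¹` unless `g = g⁻¹`**: `g` is semisimple
(its order `m` is prime to the characteristic, so `X^m - 1` is separable), hence so is the
polynomial `g - g⁻¹ = g - g^{m-1}` in `g`. [folklore] -/
theorem val_eq_val_inv_of_isNilpotent (g : GL (Fin 3) K) (hfin : IsOfFinOrder g)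
    (hm : ((orderOf g : ℕ) : K) ≠ 0) (hnil : IsNilpotent ((⇑ₘ g) - (⇑ₘ g⁻¹))) :
    (⇑ₘ g) = (⇑ₘ g⁻¹) := by
  set m := orderOf g with hmdef
  have hm0 : 0 < m := hfin.orderOf_pos
  have hGm : (⇑ₘ g) ^ m = 1 := by
    rw [← Units.val_pow_eq_pow_val, pow_orderOf_eq_one, Units.val_one]
  have hGi : (⇑ₘ g⁻¹) = (⇑ₘ g) ^ (m - 1) := by
    have h1 : (⇑ₘ g) ^ (m - 1) * (⇑ₘ g) = 1 := by rw [← pow_succ, Nat.sub_add_cancel hm0, hGm]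
    calc (⇑ₘ g⁻¹) = (⇑ₘ g) ^ (m - 1) * (⇑ₘ g) * (⇑ₘ g⁻¹) := by rw [h1, Matrix.one_mul]
      _ = (⇑ₘ g) ^ (m - 1) := by rw [Matrix.mul_assoc, val_mul_val_inv, Matrix.mul_one]
  let e := Matrix.toLinAlgEquiv' (R := K) (n := Fin 3)
  have hf : Module.End.IsSemisimple (e (⇑ₘ g)) := by
    refine Module.End.isSemisimple_of_squarefree_aeval_eq_zero (p := X ^ m - C 1)
      (Polynomial.separable_X_pow_sub_C (1 : K) hm one_ne_zero).squarefree ?_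
    rw [Polynomial.aeval_algEquiv, AlgHom.comp_apply]
    simp [hGm]
  have hD : e ((⇑ₘ g) - (⇑ₘ g⁻¹)) = aeval (e (⇑ₘ g)) (X - X ^ (m - 1) : K[X]) := by
    rw [Polynomial.aeval_algEquiv, AlgHom.comp_apply]
    simp [hGi]
  have hss : Module.End.IsSemisimple (e ((⇑ₘ g) - (⇑ₘ g⁻¹))) := by rw [hD]; exact hf.aeval _
  have hn : IsNilpotent (e ((⇑ₘ g) - (⇑ₘ g⁻¹))) := hnil.map e
  have h0 := Module.End.eq_zero_of_isNilpotent_isSemisimple hn hss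
  rw [map_eq_zero_iff e e.injective, sub_eq_zero] at h0
  exact h0

/-- **The axis of a `p`-regular non-involution of `SO(B)` is anisotropic**: `Q(axis g) ≠ 0`
(otherwise `a aᵀ B = det B · (g - g⁻¹)²` squares to zero, making `g - g⁻¹` nilpotent).
[folklore] -/
theorem dot_axisOf_ne_zero {B : Matrix (Fin 3) (Fin 3) K} (hBs : Bᵀ = B) (hB : IsUnit B.det)
    (g : GL (Fin 3) K) (hg : (⇑ₘ g)ᵀ * B * (⇑ₘ g) = B) (hfin : IsOfFinOrder g)
    (hm : ((orderOf g : ℕ) : K) ≠ 0) (hne : (⇑ₘ g) ≠ (⇑ₘ g⁻¹)) :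
    (B *ᵥ axisOf B g) ⬝ᵥ axisOf B g ≠ 0 := by
  intro hQ
  set a := axisOf B g with ha
  have hP := vecMulVec_eq_skewOf_sq hBs hB a
  rw [hQ, zero_smul, add_zero, skewOf_axisOf hBs hB g hg] at hP
  set D := (⇑ₘ g) - (⇑ₘ g⁻¹) with hDdef
  have hPP : Matrix.vecMulVec a (B *ᵥ a) * Matrix.vecMulVec a (B *ᵥ a) = 0 := by
    rw [Matrix.vecMulVec_mul_vecMulVec, hQ, zero_smul]
    ext i j; simp [Matrix.vecMulVec_apply]
  rw [hP, Matrix.smul_mul, Matrix.mul_smul, smul_smul] at hPP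
  have hD4 : D * D * (D * D) = 0 := by
    rcases smul_eq_zero.mp hPP with h | h
    · exact absurd (mul_eq_zero.mp h) (not_or.mpr ⟨hB.ne_zero, hB.ne_zero⟩)
    · exact h
  have hnil : IsNilpotent D := ⟨4, by rw [show (4 : ℕ) = 2 + 2 by rfl, pow_add, pow_two, hD4]⟩
  exact hne (val_eq_val_inv_of_isNilpotent g hfin hm hnil)

/-- The trace annihilator is stable under conjugation by `L`. [folklore] -/
theorem conj_mem_traceAnn {L : Subgroup (GL (Fin 3) K)} {Y : Matrix (Fin 3) (Fin 3) K}
    (hY : Y ∈ traceAnn L) (h : L) :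
    (⇑ₘ (h : GL (Fin 3) K)) * Y * (⇑ₘ (h : GL (Fin 3) K)⁻¹) ∈ traceAnn L := by
  intro g hg
  have hsc : SemiconjBy ((h : GL (Fin 3) K)⁻¹) (g : GL (Fin 3) K)
      (((h⁻¹ * g * h : L) : GL (Fin 3) K)) := by
    rw [SemiconjBy]; simp [mul_assoc]
  have hreg : (orderOf (((h⁻¹ * g * h : L)) : GL (Fin 3) K)).Coprime (ringChar K) := by
    rwa [← hsc.orderOf_eq]
  have h1 := hY (h⁻¹ * g * h) hreg
  have e1 : (⇑ₘ ((h⁻¹ * g * h : L) : GL (Fin 3) K)) =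
      (⇑ₘ (h : GL (Fin 3) K)⁻¹) * (⇑ₘ (g : GL (Fin 3) K)) * (⇑ₘ (h : GL (Fin 3) K)) := by
    simp [Units.val_mul]
  rw [e1] at h1
  calc ((⇑ₘ (h : GL (Fin 3) K)) * Y * (⇑ₘ (h : GL (Fin 3) K)⁻¹) * (⇑ₘ (g : GL (Fin 3) K))).trace
      = ((⇑ₘ (h : GL (Fin 3) K)) * (Y * (⇑ₘ (h : GL (Fin 3) K)⁻¹) * (⇑ₘ (g : GL (Fin 3) K)))).trace := by
        simp only [Matrix.mul_assoc]
    _ = (Y * (⇑ₘ (h : GL (Fin 3) K)⁻¹) * (⇑ₘ (g : GL (Fin 3) K)) * (⇑ₘ (h : GL (Fin 3) K))).trace := by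
        rw [Matrix.trace_mul_comm]
    _ = (Y * ((⇑ₘ (h : GL (Fin 3) K)⁻¹) * (⇑ₘ (g : GL (Fin 3) K)) * (⇑ₘ (h : GL (Fin 3) K)))).trace := by
        simp only [Matrix.mul_assoc]
    _ = 0 := h1

/-- **The skew part of the annihilator vanishes.**  For `Y = J_B(a₀)` in the trace annihilator of
an irreducible `L ≤ SO(B)` containing a `p`-regular non-involution `g₀`: the subspace
`{a : J_B(a) annihilated}` is `L`-stable, hence `0` or everything, and the latter would make
`J_B(a)` trace-orthogonal to `g₀ - g₀⁻¹ = J_B(a₁)` for all `a`, forcing `a₁ = 0`. [folklore] -/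
theorem skewOf_eq_zero_of_mem_traceAnn [IsAlgClosed K] (h2 : (2 : K) ≠ 0)
    {B : Matrix (Fin 3) (Fin 3) K} (hBs : Bᵀ = B) (hB : IsUnit B.det)
    {L : Subgroup (GL (Fin 3) K)}
    (hLO : ∀ g ∈ L, (⇑ₘ g)ᵀ * B * (⇑ₘ g) = B)
    (hLdet : ∀ g ∈ L, Matrix.det (⇑ₘ g) = 1)
    (hirr : (glRepresentation L.subtype).IsIrreducible)
    (g₀ : L) (hg₀ : (orderOf (g₀ : GL (Fin 3) K)).Coprime (ringChar K))
    (hg₀ne : (⇑ₘ (g₀ : GL (Fin 3) K)) ≠ (⇑ₘ (g₀ : GL (Fin 3) K)⁻¹))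
    {a₀ : Fin 3 → K} (hY : skewOf B a₀ ∈ traceAnn L) : a₀ = 0 := by
  let W : Submodule K (Fin 3 → K) := (traceAnn L).comap (skewOfLin B)
  have hW : ∀ h ∈ L, ∀ v ∈ W, (⇑ₘ h) *ᵥ v ∈ W := by
    intro h hh v hv
    change skewOfLin B ((⇑ₘ h) *ᵥ v) ∈ traceAnn L
    rw [skewOfLin_apply, ← conj_skewOf hB h (hLO h hh) (hLdet h hh) v]
    exact conj_mem_traceAnn hv ⟨h, hh⟩
  rcases PrimeDegreeClifford.eq_bot_or_eq_top_of_stable hirr W hW with h0 | h1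
  · have : a₀ ∈ W := hY
    rw [h0] at this
    exact (Submodule.mem_bot K).mp this
  · exfalso
    set a₁ := axisOf B (g₀ : GL (Fin 3) K) with ha₁
    have hD := skewOf_axisOf hBs hB (g₀ : GL (Fin 3) K) (hLO _ g₀.2)
    have key : ∀ a, (B *ᵥ a) ⬝ᵥ a₁ = 0 := by
      intro a
      have ha : skewOf B a ∈ traceAnn L := by
        have : a ∈ W := h1 ▸ Submodule.mem_top
        exact this
      have t1 := ha g₀ hg₀
      have t2 := trace_mul_inv_eq_zero ha g₀ hg₀
      have : (skewOf B a * skewOf B a₁).trace = 0 := by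
        rw [hD, Matrix.mul_sub, Matrix.trace_sub, t1, t2, sub_zero]
      rw [trace_skewOf_mul_skewOf hBs hB] at this
      have hd : B.det⁻¹ ≠ 0 := inv_ne_zero hB.ne_zero
      have : (-2 : K) * ((B *ᵥ a) ⬝ᵥ a₁) = 0 := (mul_eq_zero.mp this).resolve_left hd
      exact (mul_eq_zero.mp this).resolve_left (neg_ne_zero.mpr h2)
    have ha₁0 : a₁ = 0 := by
      ext i
      have := key (B⁻¹ *ᵥ Pi.single i 1)
      rwa [Matrix.mulVec_mulVec, Matrix.mul_nonsing_inv B hB, Matrix.one_mulVec,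
        single_one_dotProduct] at this
    exact hg₀ne ((axisOf_eq_zero_iff hBs hB _ (hLO _ g₀.2)).mp ha₁0)

end SkewPart

section LinesAction

variable {K : Type u} [Field K]

local notation "⇑ₘ" g => (((g : GL (Fin 3) K)) : Matrix (Fin 3) (Fin 3) K)

/-- The action of a matrix group on subspaces. [folklore] -/
@[reducible] noncomputable def submoduleAction (L : Subgroup (GL (Fin 3) K)) :
    MulAction L (Submodule K (Fin 3 → K)) where
  smul h W := W.map (Matrix.toLin' (⇑ₘ (h : GL (Fin 3) K)))
  one_smul W := by
    change W.map (Matrix.toLin' (⇑ₘ ((1 : L) : GL (Fin 3) K))) = W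
    rw [OneMemClass.coe_one, Units.val_one, Matrix.toLin'_one, Submodule.map_id]
  mul_smul h h' W := by
    change W.map (Matrix.toLin' (⇑ₘ ((h * h' : L) : GL (Fin 3) K))) =
      (W.map (Matrix.toLin' (⇑ₘ (h' : GL (Fin 3) K)))).map (Matrix.toLin' (⇑ₘ (h : GL (Fin 3) K)))
    rw [Subgroup.coe_mul, Units.val_mul, Matrix.toLin'_mul, Submodule.map_comp]

/-- **Points on at most four lines are impossible.**  If an `L`-stable non-empty set `P` of non-zero
vectors (for an irreducible, simple non-commutative `L`) is covered by four lines, `L` permutes the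
(at most four) lines through `P`; the kernel is trivial (`|L| ∣ 24`, impossible) or everything (a
fixed line, contradicting irreducibility). [folklore] -/
theorem false_of_cover_by_four_lines [IsAlgClosed K] {L : Subgroup (GL (Fin 3) K)} [Finite L]
    (hirr : (glRepresentation L.subtype).IsIrreducible) (hsimple : IsSimpleGroup L)
    (hcomm : ¬∀ a b : L, a * b = b * a) (P : Set (Fin 3 → K)) (hP0 : ∀ p ∈ P, p ≠ 0)
    (hPne : P.Nonempty) (hPstab : ∀ h ∈ L, ∀ p ∈ P, (⇑ₘ h) *ᵥ p ∈ P)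
    (u : Fin 4 → (Fin 3 → K)) (hu : ∀ p ∈ P, ∃ i, ∃ c : K, p = c • u i) : False := by
  classical
  letI := submoduleAction L
  haveI := hsimple
  -- the lines through the points of `P`
  let ℒ : SubMulAction L (Submodule K (Fin 3 → K)) :=
    { carrier := {W | ∃ p ∈ P, W = K ∙ p}
      smul_mem' := by
        rintro h W ⟨p, hp, rfl⟩
        refine ⟨(⇑ₘ (h : GL (Fin 3) K)) *ᵥ p, hPstab _ h.2 p hp, ?_⟩
        change (K ∙ p).map (Matrix.toLin' _) = _
        rw [Submodule.map_span, Set.image_singleton, Matrix.toLin'_apply] }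
  have hsub : (ℒ : Set (Submodule K (Fin 3 → K))) ⊆ Set.range fun i : Fin 4 => K ∙ u i := by
    rintro W ⟨p, hp, rfl⟩
    obtain ⟨i, c, hpc⟩ := hu p hp
    have hc : c ≠ 0 := by rintro rfl; exact hP0 p hp (by rw [hpc, zero_smul])
    refine ⟨i, ?_⟩
    change K ∙ u i = K ∙ p
    rw [hpc, Submodule.span_singleton_smul_eq (isUnit_iff_ne_zero.mpr hc)]
  have hfin : Set.Finite (ℒ : Set (Submodule K (Fin 3 → K))) := (Set.finite_range _).subset hsub
  haveI : Finite ℒ := hfin.to_subtype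
  have hcard : Nat.card ℒ ≤ 4 := by
    calc Nat.card ℒ ≤ Nat.card (Set.range fun i : Fin 4 => K ∙ u i) :=
          Nat.card_mono (Set.finite_range _) hsub
      _ ≤ Nat.card (Fin 4) := Nat.card_le_card_of_surjective _ Set.rangeFactorization_surjective
      _ = 4 := by simp
  let φ : L →* Equiv.Perm ℒ := MulAction.toPermHom L ℒ
  rcases (inferInstance : φ.ker.Normal).eq_bot_or_eq_top with hk | hk
  · have hinj : Function.Injective φ := (MonoidHom.ker_eq_bot_iff φ).mp hk
    have hdvd : Nat.card L ∣ Nat.card (Equiv.Perm ℒ) := Subgroup.card_dvd_of_injective φ hinj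
    rw [Nat.card_perm] at hdvd
    exact false_of_isSimpleGroup_of_card_dvd hcomm
      (dvd_trans hdvd (Nat.factorial_dvd_factorial hcard))
  · obtain ⟨p₀, hp₀⟩ := hPne
    let W₀ : ℒ := ⟨K ∙ p₀, p₀, hp₀, rfl⟩
    have hstab : ∀ h ∈ L, ∀ v ∈ (K ∙ p₀), (⇑ₘ h) *ᵥ v ∈ (K ∙ p₀) := by
      intro h hh v hv
      have hker : φ ⟨h, hh⟩ = 1 := by
        rw [← MonoidHom.mem_ker, hk]; exact Subgroup.mem_top _
      have h1 : ((φ ⟨h, hh⟩ W₀ : ℒ) : Submodule K (Fin 3 → K)) = K ∙ p₀ := by rw [hker]; rfl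
      have h2 : ((φ ⟨h, hh⟩ W₀ : ℒ) : Submodule K (Fin 3 → K)) =
          (K ∙ p₀).map (Matrix.toLin' (⇑ₘ h)) := rfl
      rw [h2] at h1
      rw [← h1]
      have hmem := Submodule.mem_map_of_mem (f := Matrix.toLin' (⇑ₘ h)) hv
      rwa [Matrix.toLin'_apply] at hmem
    rcases PrimeDegreeClifford.eq_bot_or_eq_top_of_stable hirr (K ∙ p₀) hstab with h0 | h1
    · exact hP0 p₀ hp₀ (Submodule.span_singleton_eq_bot.mp h0)
    · have := finrank_span_singleton (K := K) (hP0 p₀ hp₀)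
      rw [h1, finrank_top, Module.finrank_fin_fun] at this
      norm_num at this

/-- Invertible matrices preserve independence of pairs. [folklore] -/
theorem linearIndependent_pair_mulVec (g : GL (Fin 3) K) {p q : Fin 3 → K}
    (h : LinearIndependent K ![p, q]) : LinearIndependent K ![(⇑ₘ g) *ᵥ p, (⇑ₘ g) *ᵥ q] := by
  rw [LinearIndependent.pair_iff] at h ⊢
  intro s t hst
  apply h s t
  have : (⇑ₘ g⁻¹) *ᵥ (s • (⇑ₘ g) *ᵥ p + t • (⇑ₘ g) *ᵥ q) = 0 := by rw [hst, Matrix.mulVec_zero]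
  rwa [Matrix.mulVec_add, Matrix.mulVec_smul, Matrix.mulVec_smul, Matrix.mulVec_mulVec,
    Matrix.mulVec_mulVec, val_inv_mul_val, Matrix.one_mulVec, Matrix.one_mulVec] at this

set_option maxHeartbeats 400000 in
/-- **A plane containing three independent points of `P`, off which `P` is one line, is
`L`-stable** — impossible for irreducible `L`. [folklore] -/
theorem false_of_plane [IsAlgClosed K] {L : Subgroup (GL (Fin 3) K)}
    (hirr : (glRepresentation L.subtype).IsIrreducible) (P : Set (Fin 3 → K))
    (hP0 : ∀ p ∈ P, p ≠ 0) (hPstab : ∀ h ∈ L, ∀ p ∈ P, (⇑ₘ h) *ᵥ p ∈ P) {l : Fin 3 → K}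
    (hl : l ≠ 0)
    (htriple : ∃ p₁ ∈ P, ∃ p₂ ∈ P, ∃ p₃ ∈ P, l ⬝ᵥ p₁ = 0 ∧ l ⬝ᵥ p₂ = 0 ∧ l ⬝ᵥ p₃ = 0 ∧
      LinearIndependent K ![p₁, p₂] ∧ LinearIndependent K ![p₁, p₃] ∧
      LinearIndependent K ![p₂, p₃])
    (hoff : ∀ p ∈ P, ∀ p' ∈ P, l ⬝ᵥ p ≠ 0 → l ⬝ᵥ p' ≠ 0 → ∃ c : K, p' = c • p) : False := by
  obtain ⟨p₁, hp₁, p₂, hp₂, p₃, hp₃, h1, h2, h3, i12, i13, i23⟩ := htriple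
  -- proportional pairs are dependent
  have hdep : ∀ q q' : Fin 3 → K, q ≠ 0 → (∃ c : K, q' = c • q) → ¬LinearIndependent K ![q, q'] := by
    rintro q q' hq ⟨c, rfl⟩ hli
    rw [LinearIndependent.pair_iff' hq] at hli
    exact hli c rfl
  -- for every `h ∈ L`, `ℓ ∘ h⁻¹` is proportional to `ℓ`
  have hprop : ∀ h ∈ L, ∃ c : K, c • l = l ᵥ* (⇑ₘ h⁻¹) := by
    intro h hh
    by_contra hno
    push Not at hno
    have hli : LinearIndependent K ![l, l ᵥ* (⇑ₘ h⁻¹)] := by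
      rw [LinearIndependent.pair_iff' hl]; exact hno
    -- the images `q_i = h p_i`
    have hq : ∀ p, l ⬝ᵥ p = 0 → (l ᵥ* (⇑ₘ h⁻¹)) ⬝ᵥ ((⇑ₘ h) *ᵥ p) = 0 := by
      intro p hp
      rw [← Matrix.dotProduct_mulVec, Matrix.mulVec_mulVec, val_inv_mul_val, Matrix.one_mulVec, hp]
    have hq0 : ∀ p ∈ P, (⇑ₘ h) *ᵥ p ≠ 0 := fun p hp => hP0 _ (hPstab h hh p hp)
    -- two of the three images have the same position relative to `ker ℓ`
    have key : ∀ p p' : Fin 3 → K, p ∈ P → p' ∈ P → l ⬝ᵥ p = 0 → l ⬝ᵥ p' = 0 →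
        LinearIndependent K ![p, p'] →
        ¬((l ⬝ᵥ ((⇑ₘ h) *ᵥ p) = 0 ↔ l ⬝ᵥ ((⇑ₘ h) *ᵥ p') = 0)) := by
      intro p p' hp hp' hlp hlp' hli' hiff
      have hind := linearIndependent_pair_mulVec h hli'
      by_cases hz : l ⬝ᵥ ((⇑ₘ h) *ᵥ p) = 0
      · have hz' := hiff.mp hz
        exact hdep _ _ (hq0 p hp) (exists_smul_of_dot_eq_zero hli hz (hq p hlp) hz' (hq p' hlp')
          (hq0 p hp)) hind
      · have hz' : l ⬝ᵥ ((⇑ₘ h) *ᵥ p') ≠ 0 := fun h' => hz (hiff.mpr h')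
        exact hdep _ _ (hq0 p hp) (hoff _ (hPstab h hh p hp) _ (hPstab h hh p' hp') hz hz') hind
    have k12 := key p₁ p₂ hp₁ hp₂ h1 h2 i12
    have k13 := key p₁ p₃ hp₁ hp₃ h1 h3 i13
    have k23 := key p₂ p₃ hp₂ hp₃ h2 h3 i23
    by_cases a1 : l ⬝ᵥ ((⇑ₘ h) *ᵥ p₁) = 0 <;> by_cases a2 : l ⬝ᵥ ((⇑ₘ h) *ᵥ p₂) = 0 <;>
      by_cases a3 : l ⬝ᵥ ((⇑ₘ h) *ᵥ p₃) = 0 <;> simp_all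
  -- hence `ker ℓ` is `L`-stable
  let W : Submodule K (Fin 3 → K) :=
    { carrier := {v | l ⬝ᵥ v = 0}
      add_mem' := fun {v w} hv hw => by
        simp only [Set.mem_setOf_eq] at hv hw ⊢; rw [dotProduct_add, hv, hw, add_zero]
      zero_mem' := by simp
      smul_mem' := fun c v hv => by
        simp only [Set.mem_setOf_eq] at hv ⊢; rw [dotProduct_smul, hv, smul_zero] }
  have hW : ∀ h ∈ L, ∀ v ∈ W, (⇑ₘ h) *ᵥ v ∈ W := by
    intro h hh v hv
    obtain ⟨c, hc⟩ := hprop h hh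
    have hc0 : c ≠ 0 := by
      rintro rfl
      rw [zero_smul] at hc
      have : l = 0 := by
        have := congrArg (fun w => w ᵥ* (⇑ₘ h)) hc
        simp only [Matrix.zero_vecMul, Matrix.vecMul_vecMul, val_inv_mul_val, Matrix.vecMul_one] at this
        exact this.symm
      exact hl this
    change l ⬝ᵥ ((⇑ₘ h) *ᵥ v) = 0
    have hv' : l ⬝ᵥ v = 0 := hv
    -- `ℓ (h v) = (ℓ h) v` and `ℓ h = c⁻¹ ℓ`
    have hlh : l ᵥ* (⇑ₘ h) = c⁻¹ • l := by
      have := congrArg (fun w => w ᵥ* (⇑ₘ h)) hc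
      simp only [Matrix.vecMul_vecMul, val_inv_mul_val, Matrix.vecMul_one, Matrix.smul_vecMul] at this
      exact (eq_inv_smul_iff₀ hc0).mpr this
    rw [Matrix.dotProduct_mulVec, hlh, smul_dotProduct, hv', smul_zero]
  rcases PrimeDegreeClifford.eq_bot_or_eq_top_of_stable hirr W hW with h0 | h0
  · have : p₁ ∈ W := h1
    rw [h0] at this
    exact hP0 p₁ hp₁ ((Submodule.mem_bot K).mp this)
  · apply hl
    ext i
    have : (Pi.single i 1 : Fin 3 → K) ∈ W := h0 ▸ Submodule.mem_top
    have h' : l ⬝ᵥ Pi.single i 1 = 0 := this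
    rwa [dotProduct_single_one] at h'

end LinesAction

section Main

variable {K : Type u} [Field K]

local notation "⇑ₘ" g => (((g : GL (Fin 3) K)) : Matrix (Fin 3) (Fin 3) K)

/-- The trace annihilator is stable under the `B`-adjoint `Y ↦ B⁻¹ Yᵀ B` (for `L ≤ O(B)`,
`tr (Y* g) = tr (Y g⁻¹)`). [folklore] -/
theorem adjB_mem_traceAnn {B : Matrix (Fin 3) (Fin 3) K} (hB : IsUnit B.det)
    {L : Subgroup (GL (Fin 3) K)} (hLO : ∀ g ∈ L, (⇑ₘ g)ᵀ * B * (⇑ₘ g) = B)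
    {Y : Matrix (Fin 3) (Fin 3) K} (hY : Y ∈ traceAnn L) : adjB B Y ∈ traceAnn L := by
  intro g hg
  have hBG : B * (⇑ₘ (g : GL (Fin 3) K)) * B⁻¹ = (⇑ₘ (g : GL (Fin 3) K)⁻¹)ᵀ := by
    rw [mul_eq_transpose_inv_mul_of_orthogonal _ (hLO _ g.2), Matrix.mul_assoc,
      Matrix.mul_nonsing_inv B hB, Matrix.mul_one]
  calc (adjB B Y * (⇑ₘ (g : GL (Fin 3) K))).trace
      = (B⁻¹ * (Yᵀ * B * (⇑ₘ (g : GL (Fin 3) K)))).trace := by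
        rw [adjB]; simp only [Matrix.mul_assoc]
    _ = (Yᵀ * (B * (⇑ₘ (g : GL (Fin 3) K)) * B⁻¹)).trace := by
        rw [Matrix.trace_mul_comm]; simp only [Matrix.mul_assoc]
    _ = ((⇑ₘ (g : GL (Fin 3) K)⁻¹) * Y).trace := by
        rw [hBG, ← Matrix.transpose_mul, Matrix.trace_transpose]
    _ = (Y * (⇑ₘ (g : GL (Fin 3) K)⁻¹)).trace := Matrix.trace_mul_comm _ _
    _ = 0 := trace_mul_inv_eq_zero hY g hg

/-- `qf (gᵀ S g) v = qf S (g v)`. [folklore] -/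
theorem qf_conj (S G : Matrix (Fin 3) (Fin 3) K) (v : Fin 3 → K) :
    qf (Gᵀ * S * G) v = qf S (G *ᵥ v) := by
  rw [qf, qf, ← Matrix.mulVec_mulVec, ← Matrix.mulVec_mulVec, Matrix.dotProduct_mulVec,
    Matrix.vecMul_transpose]

/-- **The symmetric part of the annihilator vanishes.**  For `Y` in the trace annihilator of an
irreducible simple non-commutative `L ≤ SO(B)` (char. `3`, `K = K̄`) with `S = B Y` symmetric,
`Q_S` vanishes on the `L`-stable set `P` of axes of the `p`-regular non-involutions.  If every
conic through `P` is a multiple of `S`, the `gᵀ S g` are multiples `c_g S`, so `g⁻¹ Y g = c_g Y`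
with `c_g³ = 1`, i.e. `c_g = 1` (char. `3`; `det Y ≠ 0` as `ker Y` is `L`-stable), and
Schur's lemma gives `Y = c · 1`, `S = c B`, `c Q(axis) = 0`, `c = 0`.  Otherwise two independent
conics pass through `P`, and `conics_through_points` with `false_of_cover_by_four_lines` /
`false_of_plane` gives a contradiction. [folklore] -/
theorem eq_zero_of_mem_traceAnn_of_symm [IsAlgClosed K] [CharP K 3] (h2 : (2 : K) ≠ 0)
    {B : Matrix (Fin 3) (Fin 3) K} (hBs : Bᵀ = B) (hB : IsUnit B.det)
    {L : Subgroup (GL (Fin 3) K)} [Finite L]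
    (hLO : ∀ g ∈ L, (⇑ₘ g)ᵀ * B * (⇑ₘ g) = B)
    (hLdet : ∀ g ∈ L, Matrix.det (⇑ₘ g) = 1)
    (hirr : (glRepresentation L.subtype).IsIrreducible)
    (hsimple : IsSimpleGroup L) (hcomm : ¬∀ a b : L, a * b = b * a)
    (g₀ : L) (hg₀ : (orderOf (g₀ : GL (Fin 3) K)).Coprime (ringChar K))
    (hg₀ne : (⇑ₘ (g₀ : GL (Fin 3) K)) ≠ (⇑ₘ (g₀ : GL (Fin 3) K)⁻¹))
    {Y : Matrix (Fin 3) (Fin 3) K} (hY : Y ∈ traceAnn L) (hsym : (B * Y)ᵀ = B * Y) : Y = 0 := by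
  classical
  by_contra hY0
  have hchar : ringChar K = 3 := ringChar.eq K 3
  set S := B * Y with hSdef
  have hYS : Y = B⁻¹ * S := by
    rw [hSdef, ← Matrix.mul_assoc, Matrix.nonsing_inv_mul B hB, Matrix.one_mul]
  have hS0 : S ≠ 0 := by
    intro h; apply hY0; rw [hYS, h, Matrix.mul_zero]
  -- the `L`-stable set of axes of the `p`-regular non-involutions
  let P : Set (Fin 3 → K) := {p | ∃ g : L, (orderOf (g : GL (Fin 3) K)).Coprime (ringChar K) ∧
    (⇑ₘ (g : GL (Fin 3) K)) ≠ (⇑ₘ (g : GL (Fin 3) K)⁻¹) ∧ p = axisOf B (g : GL (Fin 3) K)}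
  have hP0 : ∀ p ∈ P, p ≠ 0 := by
    rintro p ⟨g, -, hne, rfl⟩ h0
    exact hne ((axisOf_eq_zero_iff hBs hB _ (hLO _ g.2)).mp h0)
  have hPS : ∀ p ∈ P, qf S p = 0 := by
    rintro p ⟨g, hg, -, rfl⟩
    exact qf_axisOf_eq_zero hBs hB hY g hg (hLO _ g.2)
  have hPstab : ∀ h ∈ L, ∀ p ∈ P, (⇑ₘ h) *ᵥ p ∈ P := by
    rintro h hh p ⟨g, hg, hne, rfl⟩
    let h' : L := ⟨h, hh⟩
    have hsc : SemiconjBy (h : GL (Fin 3) K) (g : GL (Fin 3) K)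
        (((h' * g * h'⁻¹ : L)) : GL (Fin 3) K) := by
      rw [SemiconjBy]; simp [h', mul_assoc]
    refine ⟨h' * g * h'⁻¹, by rwa [← hsc.orderOf_eq], ?_, ?_⟩
    · intro heq
      apply hne
      have e1 : (⇑ₘ ((h' * g * h'⁻¹ : L) : GL (Fin 3) K)) =
          (⇑ₘ h) * (⇑ₘ (g : GL (Fin 3) K)) * (⇑ₘ h⁻¹) := by simp [h', Units.val_mul]
      have e2 : (⇑ₘ ((h' * g * h'⁻¹ : L) : GL (Fin 3) K)⁻¹) =
          (⇑ₘ h) * (⇑ₘ (g : GL (Fin 3) K)⁻¹) * (⇑ₘ h⁻¹) := by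
        simp only [h', Subgroup.coe_mul, Subgroup.coe_inv, mul_inv_rev, inv_inv, ← mul_assoc]
        simp [Units.val_mul]
      rw [e1, e2] at heq
      calc (⇑ₘ (g : GL (Fin 3) K))
          = (⇑ₘ h⁻¹) * ((⇑ₘ h) * (⇑ₘ (g : GL (Fin 3) K)) * (⇑ₘ h⁻¹)) * (⇑ₘ h) := by
            simp only [Matrix.mul_assoc]
            rw [← Matrix.mul_assoc (⇑ₘ h⁻¹), val_inv_mul_val, Matrix.one_mul, Matrix.mul_one]
        _ = (⇑ₘ h⁻¹) * ((⇑ₘ h) * (⇑ₘ (g : GL (Fin 3) K)⁻¹) * (⇑ₘ h⁻¹)) * (⇑ₘ h) := by rw [heq]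
        _ = (⇑ₘ (g : GL (Fin 3) K)⁻¹) := by
            simp only [Matrix.mul_assoc]
            rw [← Matrix.mul_assoc (⇑ₘ h⁻¹), val_inv_mul_val, Matrix.one_mul, Matrix.mul_one]
    · have := axisOf_conj hBs hB (g : GL (Fin 3) K) h (hLO _ g.2) (hLO h hh) (hLdet h hh)
        (by simpa [h'] using hLO _ (h' * g * h'⁻¹).2)
      simpa [h'] using this.symm
  have ha₀P : axisOf B (g₀ : GL (Fin 3) K) ∈ P := ⟨g₀, hg₀, hg₀ne, rfl⟩
  have hPne : P.Nonempty := ⟨_, ha₀P⟩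
  have hm₀ : ((orderOf (g₀ : GL (Fin 3) K) : ℕ) : K) ≠ 0 := by
    intro h0
    rw [CharP.cast_eq_zero_iff K 3] at h0
    rw [hchar] at hg₀
    exact (Nat.Prime.coprime_iff_not_dvd Nat.prime_three).mp hg₀.symm h0
  have hfin₀ : IsOfFinOrder (g₀ : GL (Fin 3) K) := by
    rw [← orderOf_pos_iff, Subgroup.orderOf_coe]
    exact orderOf_pos g₀
  have hQ₀ : (B *ᵥ axisOf B (g₀ : GL (Fin 3) K)) ⬝ᵥ axisOf B (g₀ : GL (Fin 3) K) ≠ 0 :=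
    dot_axisOf_ne_zero hBs hB _ (hLO _ g₀.2) hfin₀ hm₀ hg₀ne
  by_cases hA : ∀ S' : Matrix (Fin 3) (Fin 3) K, S'ᵀ = S' → (∀ p ∈ P, qf S' p = 0) →
      ∃ c : K, S' = c • S
  · -- Case A: every conic through the axes is a multiple of `S`
    have hsemi : ∀ h : L, ∃ c : K,
        (⇑ₘ (h : GL (Fin 3) K)⁻¹) * Y * (⇑ₘ (h : GL (Fin 3) K)) = c • Y := by
      intro h
      obtain ⟨c, hc⟩ := hA ((⇑ₘ (h : GL (Fin 3) K))ᵀ * S * (⇑ₘ (h : GL (Fin 3) K)))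
        (by rw [Matrix.transpose_mul, Matrix.transpose_mul, Matrix.transpose_transpose, hsym,
              ← Matrix.mul_assoc])
        (fun p hp => by rw [qf_conj]; exact hPS _ (hPstab _ h.2 p hp))
      refine ⟨c, ?_⟩
      have e1 : (⇑ₘ (h : GL (Fin 3) K)⁻¹) * B⁻¹ = B⁻¹ * (⇑ₘ (h : GL (Fin 3) K))ᵀ := by
        have := mul_inv_eq_of_orthogonal hB (h : GL (Fin 3) K)⁻¹ (hLO _ (h⁻¹).2)
        rwa [inv_inv] at this
      calc (⇑ₘ (h : GL (Fin 3) K)⁻¹) * Y * (⇑ₘ (h : GL (Fin 3) K))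
          = (⇑ₘ (h : GL (Fin 3) K)⁻¹) * B⁻¹ * S * (⇑ₘ (h : GL (Fin 3) K)) := by
            rw [hYS, ← Matrix.mul_assoc]
        _ = B⁻¹ * ((⇑ₘ (h : GL (Fin 3) K))ᵀ * S * (⇑ₘ (h : GL (Fin 3) K))) := by
            rw [e1]; simp only [Matrix.mul_assoc]
        _ = c • Y := by rw [hc, Matrix.mul_smul, ← hYS]
    -- `det Y ≠ 0`: otherwise `ker Y` is a non-zero `L`-stable subspace
    have hdetY : Y.det ≠ 0 := by
      intro hd
      obtain ⟨v, hv0, hv⟩ := Matrix.exists_mulVec_eq_zero_iff.mpr hd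
      let W : Submodule K (Fin 3 → K) := LinearMap.ker (Matrix.toLin' Y)
      have hW : ∀ h ∈ L, ∀ w ∈ W, (⇑ₘ h) *ᵥ w ∈ W := by
        intro h hh w hw
        rw [LinearMap.mem_ker, Matrix.toLin'_apply] at hw ⊢
        obtain ⟨c, hc⟩ := hsemi ⟨h, hh⟩
        have hYH : Y * (⇑ₘ h) = c • ((⇑ₘ h) * Y) := by
          calc Y * (⇑ₘ h) = (⇑ₘ h) * ((⇑ₘ h⁻¹) * Y * (⇑ₘ h)) := by
                simp only [← Matrix.mul_assoc]
                rw [val_mul_val_inv, Matrix.one_mul]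
            _ = c • ((⇑ₘ h) * Y) := by
                have hc' : (⇑ₘ h⁻¹) * Y * (⇑ₘ h) = c • Y := hc
                rw [hc', Matrix.mul_smul]
        rw [Matrix.mulVec_mulVec, hYH, Matrix.smul_mulVec, ← Matrix.mulVec_mulVec, hw,
          Matrix.mulVec_zero, smul_zero]
      rcases PrimeDegreeClifford.eq_bot_or_eq_top_of_stable hirr W hW with h0 | h1
      · have : v ∈ W := by rw [LinearMap.mem_ker, Matrix.toLin'_apply]; exact hv
        rw [h0] at this
        exact hv0 ((Submodule.mem_bot K).mp this)
      · apply hY0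
        ext i j
        have : (Pi.single j 1 : Fin 3 → K) ∈ W := h1 ▸ Submodule.mem_top
        rw [LinearMap.mem_ker, Matrix.toLin'_apply, Matrix.mulVec_single_one] at this
        have := congrFun this i
        rw [Matrix.col_apply, Pi.zero_apply] at this
        rw [this, Matrix.zero_apply]
    -- all the scalars are `1`: `Y` commutes with `L`
    have h3 : (3 : K) = 0 := by exact_mod_cast CharP.cast_eq_zero K 3
    have hcommY : ∀ h ∈ L, (⇑ₘ h) * Y = Y * (⇑ₘ h) := by
      intro h hh
      obtain ⟨c, hc⟩ := hsemi ⟨h, hh⟩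
      have hc' : (⇑ₘ h⁻¹) * Y * (⇑ₘ h) = c • Y := hc
      have hc3 : c ^ 3 = 1 := by
        have hd := congrArg Matrix.det hc'
        rw [Matrix.det_mul, Matrix.det_mul, Matrix.det_smul, Fintype.card_fin, mul_comm,
          ← mul_assoc, ← Matrix.det_mul, val_mul_val_inv, Matrix.det_one, one_mul] at hd
        have : (c ^ 3 - 1) * Y.det = 0 := by rw [sub_mul, one_mul, ← hd, sub_self]
        exact sub_eq_zero.mp ((mul_eq_zero.mp this).resolve_right hdetY)
      have hc1 : c = 1 := by
        have : (c - 1) ^ 3 = 0 := by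
          have e : (c - 1) ^ 3 = c ^ 3 - 1 - 3 * (c ^ 2 - c) := by ring
          rw [e, hc3, h3]; ring
        exact sub_eq_zero.mp (pow_eq_zero_iff (n := 3) (by norm_num) |>.mp this)
      rw [hc1, one_smul] at hc'
      calc (⇑ₘ h) * Y = (⇑ₘ h) * ((⇑ₘ h⁻¹) * Y * (⇑ₘ h)) := by rw [hc']
        _ = Y * (⇑ₘ h) := by
            simp only [← Matrix.mul_assoc]
            rw [val_mul_val_inv, Matrix.one_mul]
    obtain ⟨c', hc'⟩ := PrimeDegreeClifford.exists_eq_smul_one_of_forall_commute hirr (M := Y) hcommY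
    have hq := hPS _ ha₀P
    rw [hSdef, hc', Matrix.mul_smul, Matrix.mul_one, qf, Matrix.smul_mulVec, dotProduct_smul,
      smul_eq_mul] at hq
    rcases mul_eq_zero.mp hq with h | h
    · apply hY0; rw [hc', h, zero_smul]
    · exact hQ₀ (by rwa [dotProduct_comm] at h)
  · -- Case B: two independent conics through the axes
    push Not at hA
    obtain ⟨S', hS's, hS'P, hS'ne⟩ := hA
    have hind : ∀ a b : K, a • S + b • S' = 0 → a = 0 ∧ b = 0 := by
      intro a b hab
      by_cases hb : b = 0
      · rw [hb, zero_smul, add_zero] at hab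
        exact ⟨(smul_eq_zero.mp hab).resolve_right hS0, hb⟩
      · exfalso
        apply hS'ne (-(a / b))
        calc S' = b⁻¹ • (b • S') := by rw [smul_smul, inv_mul_cancel₀ hb, one_smul]
          _ = -(a / b) • S := by
              rw [eq_neg_of_add_eq_zero_right hab, smul_neg, smul_smul, neg_smul, div_eq_inv_mul]
    rcases conics_through_points h2 hsym hS's hind P hP0 hPS hS'P with ⟨u, hu⟩ | ⟨l, hl, htr, hoff⟩
    · exact false_of_cover_by_four_lines hirr hsimple hcomm P hP0 hPne hPstab u hu
    · exact false_of_plane hirr P hP0 hPstab hl htr hoff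

/-- **Weak adequacy of simple irreducible subgroups of `SO₃(B)` in characteristic `3`,
classification-free.**  Let `K = K̄` have characteristic `3`, `B` a non-degenerate symmetric
`3 × 3` matrix, and `L ≤ GL₃(K)` a finite subgroup which is irreducible on `K³`, simple and
non-commutative as an abstract group, and contained in `SO(B)` (`gᵀ B g = B`, `det g = 1`).  Then
`M₃(K)` is spanned by the elements of `L` of order prime to `3` (GHT's clause (iii), "weak
adequacy").  Proof (this file): a matrix `Y` trace-orthogonal to the `3`-regular elements splits
into `B`-skew and `B`-symmetric parts, both still orthogonal; the skew part vanishes by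
irreducibility of `L` on `so(B) ≅ K³` (`skewOf_eq_zero_of_mem_traceAnn`), the symmetric part by
the geometry of conics through the axes (`eq_zero_of_mem_traceAnn_of_symm`); the needed regular
non-involution exists by `exists_coprime_mul_self_ne_one`.  GHT obtain weak adequacy of the
degree-`p` cells through Theorem 2.2 (CFSG) and case-by-case character computations
(Props. 6.8–6.14, [GHT15]); for `p = 3` and orthogonal groups this is a uniform substitute.
[cite: GuralnickHerzigTiep2017, Theorem 1.7 with Props. 6.8–6.14 (weak adequacy of the
degree-`p` cells)] -/
theorem semisimpleSpan_eq_top_of_orthogonal [IsAlgClosed K] [CharP K 3]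
    {B : Matrix (Fin 3) (Fin 3) K} (hBs : Bᵀ = B) (hB : IsUnit B.det)
    {L : Subgroup (GL (Fin 3) K)} [Finite L]
    (hLO : ∀ g ∈ L, (⇑ₘ g)ᵀ * B * (⇑ₘ g) = B)
    (hLdet : ∀ g ∈ L, Matrix.det (⇑ₘ g) = 1)
    (hirr : (glRepresentation L.subtype).IsIrreducible)
    (hsimple : IsSimpleGroup L) (hcomm : ¬∀ a b : L, a * b = b * a) :
    Subgroup.semisimpleSpan L = ⊤ := by
  classical
  have h2 : (2 : K) ≠ 0 := by
    intro h
    have : ((2 : ℕ) : K) = 0 := by exact_mod_cast h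
    rw [CharP.cast_eq_zero_iff K 3] at this
    norm_num at this
  have hchar : ringChar K = 3 := ringChar.eq K 3
  obtain ⟨g₀, hg₀L, hg₀reg, hg₀sq⟩ := exists_coprime_mul_self_ne_one hsimple hcomm hLdet
  let g₀' : L := ⟨g₀, hg₀L⟩
  have hg₀' : (orderOf (g₀' : GL (Fin 3) K)).Coprime (ringChar K) := by rw [hchar]; exact hg₀reg
  have hg₀ne : (⇑ₘ (g₀' : GL (Fin 3) K)) ≠ (⇑ₘ (g₀' : GL (Fin 3) K)⁻¹) := by
    intro h
    apply hg₀sq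
    apply Units.ext
    change (⇑ₘ g₀) * (⇑ₘ g₀) = 1
    have h' : (⇑ₘ g₀) = (⇑ₘ g₀⁻¹) := h
    nth_rewrite 1 [h']
    exact val_inv_mul_val g₀
  apply semisimpleSpan_eq_top_of_traceAnn
  intro Y hY
  have hadj : adjB B Y ∈ traceAnn L := adjB_mem_traceAnn hB hLO hY
  set Y₁ := (2 : K)⁻¹ • (Y + adjB B Y) with hY₁def
  set Y₂ := (2 : K)⁻¹ • (Y - adjB B Y) with hY₂def
  have hY₁ : Y₁ ∈ traceAnn L := Submodule.smul_mem _ _ (Submodule.add_mem _ hY hadj)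
  have hY₂ : Y₂ ∈ traceAnn L := Submodule.smul_mem _ _ (Submodule.sub_mem _ hY hadj)
  have hBadj : B * adjB B Y = (B * Y)ᵀ := by
    rw [adjB, ← Matrix.mul_assoc, ← Matrix.mul_assoc, Matrix.mul_nonsing_inv B hB, Matrix.one_mul,
      Matrix.transpose_mul, hBs]
  have hsym : (B * Y₁)ᵀ = B * Y₁ := by
    rw [hY₁def, Matrix.mul_smul, Matrix.mul_add, hBadj, Matrix.transpose_smul, Matrix.transpose_add,
      Matrix.transpose_transpose, add_comm]
  have hskew : (B * Y₂)ᵀ = -(B * Y₂) := by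
    rw [hY₂def, Matrix.mul_smul, Matrix.mul_sub, hBadj, Matrix.transpose_smul, Matrix.transpose_sub,
      Matrix.transpose_transpose, ← smul_neg, neg_sub]
  have hd : ∀ i, (B * Y₂) i i = 0 := by
    intro i
    rw [hY₂def, Matrix.mul_smul, Matrix.mul_sub, hBadj, Matrix.smul_apply, Matrix.sub_apply,
      Matrix.transpose_apply, sub_self, smul_zero]
  obtain ⟨a₂, ha₂⟩ := exists_eq_skewOf hB hskew hd
  have h1 : Y₁ = 0 :=
    eq_zero_of_mem_traceAnn_of_symm h2 hBs hB hLO hLdet hirr hsimple hcomm g₀' hg₀' hg₀ne hY₁ hsym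
  have ha : a₂ = 0 :=
    skewOf_eq_zero_of_mem_traceAnn h2 hBs hB hLO hLdet hirr g₀' hg₀' hg₀ne (ha₂ ▸ hY₂)
  calc Y = Y₁ + Y₂ := by
        rw [hY₁def, hY₂def, ← smul_add, show Y + adjB B Y + (Y - adjB B Y) = (2 : K) • Y by
          rw [two_smul]; abel, smul_smul, inv_mul_cancel₀ h2, one_smul]
    _ = 0 := by rw [h1, ha₂, ha, ← skewOfLin_apply, map_zero, add_zero]

end Main

end OrthogonalDegreeThree

/-! ## Consequences: weak adequacy of primitive subgroups of `GO₃`, and Theorem 1.7 for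
subgroups of `GO₃` with `9 ∤ |G|` -/

section Consequences

open OrthogonalDegreeThree

/-- The `p`-regular elements of a smaller subgroup span less. [folklore] -/
theorem Subgroup.semisimpleSpan_mono {k : Type u} [Field k] {n : ℕ} {L H : Subgroup (GL (Fin n) k)}
    (hLH : L ≤ H) : Subgroup.semisimpleSpan L ≤ Subgroup.semisimpleSpan H := by
  rw [Subgroup.semisimpleSpan_def, Subgroup.semisimpleSpan_def]
  refine Submodule.span_mono ?_
  rintro M ⟨h, hh, rfl⟩
  exact ⟨⟨h, hLH h.2⟩, by simpa using hh, rfl⟩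

/-- A similitude of determinant `1` of a non-degenerate form in dimension `3` and characteristic
`3` is an isometry (`μ³ = 1` forces `μ = 1`). [folklore] -/
theorem transpose_mul_mul_eq_of_det_eq_one {K : Type u} [Field K] [CharP K 3]
    {B : Matrix (Fin 3) (Fin 3) K} (hB : IsUnit B.det) {G : Matrix (Fin 3) (Fin 3) K}
    (hdet : G.det = 1) {μ : K} (hμ : Gᵀ * B * G = μ • B) : Gᵀ * B * G = B := by
  have h3 : (3 : K) = 0 := by exact_mod_cast CharP.cast_eq_zero K 3
  have hd := congrArg Matrix.det hμ
  rw [Matrix.det_mul, Matrix.det_mul, Matrix.det_transpose, hdet, one_mul, mul_one, Matrix.det_smul,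
    Fintype.card_fin] at hd
  have hμ3 : μ ^ 3 = 1 := by
    have : (μ ^ 3 - 1) * B.det = 0 := by rw [sub_mul, one_mul, ← hd, sub_self]
    exact sub_eq_zero.mp ((mul_eq_zero.mp this).resolve_right hB.ne_zero)
  have hμ1 : μ = 1 := by
    have : (μ - 1) ^ 3 = 0 := by
      have e : (μ - 1) ^ 3 = μ ^ 3 - 1 - 3 * (μ ^ 2 - μ) := by ring
      rw [e, hμ3, h3]; ring
    exact sub_eq_zero.mp (pow_eq_zero_iff (n := 3) (by norm_num) |>.mp this)
  rw [hμ, hμ1, one_smul]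

/-- **Weak adequacy of primitive subgroups of `GO₃(B)` in characteristic `3`** (`K = K̄`),
classification-free.  A finite irreducible `H ≤ GL₃(K)` of similitudes of a non-degenerate
symmetric `B` (`gᵀ B g = μ_g B`), all of whose line-permutation structures have central kernel
(primitive), is weakly adequate: its `3`-regular elements span `M₃(K)`.  (The simple socle-layer
`L` of `H` — `Subgroup.exists_simple_normal_dvd_card_of_primitive` — lies in `SL₃ ∩ GO₃ = SO₃`
by `transpose_mul_mul_eq_of_det_eq_one`, and `semisimpleSpan_eq_top_of_orthogonal` applies to it.)
This is the clause-(iii) input that GHT draw from Theorem 2.2 (CFSG) with Props. 6.8–6.14 for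
the degree-`3` cells `A₅`, `PSL₂(3^a)`, `PGL₂(3^a)` of Theorem 1.7.
[cite: GuralnickHerzigTiep2017, Theorem 1.7 and proof of Theorem 6.15 (p. 24), Props. 6.8–6.14] -/
theorem Subgroup.semisimpleSpan_eq_top_of_primitive_of_similitude {K : Type u} [Field K]
    [IsAlgClosed K] [CharP K 3] {B : Matrix (Fin 3) (Fin 3) K} (hBs : Bᵀ = B) (hB : IsUnit B.det)
    {H : Subgroup (GL (Fin 3) K)} [Finite H]
    (hHO : ∀ g ∈ H, ∃ μ : K, ((g : GL (Fin 3) K) : Matrix (Fin 3) (Fin 3) K)ᵀ * B * g = μ • B)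
    (hirrH : (glRepresentation H.subtype).IsIrreducible)
    (hmono : ∀ (b : Module.Basis (Fin 3) K (Fin 3 → K)) (θ : ↥H →* Equiv.Perm (Fin 3)),
      (∀ (h : H) (i : Fin 3), ∃ c : K,
        ((h : GL (Fin 3) K) : Matrix (Fin 3) (Fin 3) K) *ᵥ b i = c • b (θ h i)) →
      θ.ker ≤ Subgroup.center H) :
    Subgroup.semisimpleSpan H = ⊤ := by
  obtain ⟨L, hLH, -, hirrL, -, hsimple, -, hdet, -⟩ :=
    Subgroup.exists_simple_normal_dvd_card_of_primitive hirrH hmono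
  haveI : Finite L := Finite.Set.subset (s := (H : Set (GL (Fin 3) K))) hLH
  have hLO : ∀ g ∈ L, ((g : GL (Fin 3) K) : Matrix (Fin 3) (Fin 3) K)ᵀ * B * g = B := by
    intro g hg
    obtain ⟨μ, hμ⟩ := hHO g (hLH hg)
    exact transpose_mul_mul_eq_of_det_eq_one hB (hdet g hg) hμ
  have hcomm : ¬∀ a b : L, a * b = b * a := fun hc =>
    PrimeDegreeClifford.not_isIrreducible_of_comm (A := L)
      (fun x hx y hy => congrArg Subtype.val (hc ⟨x, hx⟩ ⟨y, hy⟩)) hirrL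
  have hL := semisimpleSpan_eq_top_of_orthogonal hBs hB hLO hdet hirrL hsimple hcomm
  exact top_le_iff.mp (hL ▸ Subgroup.semisimpleSpan_mono hLH)

/-- **Theorem 1.7 for subgroups of `GO₃` with `9 ∤ |G|`, classification-free, over any field of
characteristic `3`.**  Let `k` be a field of characteristic `3`, `G` a finite group with `9 ∤ |G|`,
`σ : G →* GL₃(k)` faithful and absolutely irreducible whose image consists of similitudes of a
non-degenerate symmetric `B` (`σ(g)ᵀ B σ(g) = μ_g B`; e.g. the symmetric square of a
`2`-dimensional representation, `Sym² GL₂ ≤ GO₃`).  Then `σ(G)` is adequate in the extended sense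
of GHT, or `G` has an abelian normal subgroup of index `3` — alternatives (a), (b) of
Theorem 1.7; alternative (c) needs `9 ∣ |G|`.  (Over `k̄`: an imprimitive `σ(G)` is handled by
Prop. 6.6; a primitive one has clauses (i), (ii) by Lemmas 6.2–6.3 here classification-free
(`Subgroup.addMonoidHom_eq_zero_and_cocycles₁_le_of_primitive_of_not_sq_dvd`) and clause (iii)
by `Subgroup.semisimpleSpan_eq_top_of_primitive_of_similitude`; then descend to `k`.)  GHT's own
proof of these cells goes through Theorem 2.2 (CFSG: the socle is `A₅`) and [GHT15].
[cite: GuralnickHerzigTiep2017, Theorem 1.7, Proposition 6.6, Lemmas 6.2–6.3, proof of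
Theorem 6.15 (p. 24)] -/
theorem isExtendedAdequate_or_index_three_of_similitude_of_not_dvd
    {k : Type u} [Field k] [CharP k 3] {G : Type v} [Group G] [Finite G]
    (σ : G →* GL (Fin 3) k) (hinj : Function.Injective σ) (hirr : IsAbsIrreducible σ)
    {B : Matrix (Fin 3) (Fin 3) k} (hBs : Bᵀ = B) (hB : IsUnit B.det)
    (hσO : ∀ g, ∃ μ : k, ((σ g : GL (Fin 3) k) : Matrix (Fin 3) (Fin 3) k)ᵀ * B * σ g = μ • B)
    (h9 : ¬9 ∣ Nat.card G) :
    Subgroup.IsExtendedAdequate σ.range ∨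
      ∃ A : Subgroup G, A.Normal ∧ (∀ x ∈ A, ∀ y ∈ A, x * y = y * x) ∧ A.index = 3 := by
  classical
  let K := AlgebraicClosure k
  let ι : k →+* K := algebraMap k K
  haveI : CharP K 3 := charP_of_injective_ringHom ι.injective 3
  let τ : G →* GL (Fin 3) K := (Matrix.GeneralLinearGroup.map ι).comp σ
  have hτinj : Function.Injective τ := (glMap_injective_of_ringHom ι).comp hinj
  have hτirr : (glRepresentation τ).IsIrreducible := hirr K ι
  haveI : Finite τ.range := Finite.of_surjective _ τ.rangeRestrict_surjective
  have hirr' := isIrreducible_range_subtype τ hτirr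
  have hcard : Nat.card τ.range = Nat.card G :=
    (Nat.card_congr (MonoidHom.ofInjective hτinj).toEquiv).symm
  have hp2' : ¬3 ^ 2 ∣ Nat.card τ.range := by rw [hcard]; norm_num; exact h9
  -- the form over `K`
  set B' : Matrix (Fin 3) (Fin 3) K := B.map ι with hB'def
  have hBs' : B'ᵀ = B' := by rw [hB'def, ← Matrix.transpose_map, hBs]
  have hB' : IsUnit B'.det := by
    rw [hB'def, isUnit_iff_ne_zero, ← RingHom.mapMatrix_apply, ← RingHom.map_det,
      map_ne_zero_iff ι ι.injective]
    exact hB.ne_zero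
  have hτO : ∀ h ∈ τ.range, ∃ μ : K,
      ((h : GL (Fin 3) K) : Matrix (Fin 3) (Fin 3) K)ᵀ * B' * h = μ • B' := by
    rintro h ⟨g, rfl⟩
    obtain ⟨μ, hμ⟩ := hσO g
    refine ⟨ι μ, ?_⟩
    have e : ((τ g : GL (Fin 3) K) : Matrix (Fin 3) (Fin 3) K) =
        ((σ g : GL (Fin 3) k) : Matrix (Fin 3) (Fin 3) k).map ι := rfl
    rw [e, hB'def, ← Matrix.transpose_map, ← Matrix.map_mul, ← Matrix.map_mul, hμ]
    ext i j
    simp [Matrix.map_apply]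
  by_cases hmono : ∀ (b : Module.Basis (Fin 3) K (Fin 3 → K)) (θ : ↥τ.range →* Equiv.Perm (Fin 3)),
      (∀ (h : τ.range) (i : Fin 3), ∃ c : K,
        ((h : GL (Fin 3) K) : Matrix (Fin 3) (Fin 3) K) *ᵥ b i = c • b (θ h i)) →
      θ.ker ≤ Subgroup.center τ.range
  · -- primitive: (i), (ii) by Lemma 6.2, (iii) by the orthogonal weak adequacy theorem
    obtain ⟨h1, h2⟩ :=
      Subgroup.addMonoidHom_eq_zero_and_cocycles₁_le_of_primitive_of_not_sq_dvd hirr' hmono hp2'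
    have hw := Subgroup.semisimpleSpan_eq_top_of_primitive_of_similitude hBs' hB' hτO hirr' hmono
    have had : Subgroup.IsExtendedAdequate τ.range := ⟨h1, h2, hw⟩
    refine Or.inl (Subgroup.IsExtendedAdequate.of_map ι σ.range ?_)
    rw [MonoidHom.map_range]
    exact had
  simp only [not_forall] at hmono
  obtain ⟨b, θ, hθ, hA⟩ := hmono
  rcases eq_or_ne θ.ker.index 3 with hidx | hidx
  · -- `[τ(G) : A] = 3`: the pull-back of `A` is an abelian normal subgroup of index `3`
    refine Or.inr ⟨θ.ker.comap τ.rangeRestrict, inferInstance, ?_, ?_⟩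
    · choose c hc using hθ
      intro x hx y hy
      apply hτinj
      have hx' : θ (τ.rangeRestrict x) = 1 := (MonoidHom.mem_ker).1 hx
      have hy' : θ (τ.rangeRestrict y) = 1 := (MonoidHom.mem_ker).1 hy
      have hdx := MonomialAdequacy.mulVec_basis_of_ker b θ c hc (τ.rangeRestrict x) hx'
      have hdy := MonomialAdequacy.mulVec_basis_of_ker b θ c hc (τ.rangeRestrict y) hy'
      simp only [MonoidHom.coe_rangeRestrict] at hdx hdy
      rw [map_mul, map_mul]
      apply Units.ext
      rw [Units.val_mul, Units.val_mul]
      refine MonomialAdequacy.matrix_eq_of_mulVec_basis b fun i => ?_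
      rw [← Matrix.mulVec_mulVec, ← Matrix.mulVec_mulVec, hdx, hdy, Matrix.mulVec_smul,
        Matrix.mulVec_smul, hdx, hdy, smul_smul, smul_smul, mul_comm]
    · rw [Subgroup.index_comap_of_surjective θ.ker τ.rangeRestrict_surjective, hidx]
  · -- `[τ(G) : A] ≠ 3`: adequate by Prop. 6.6, then descend to `k`
    have had := Subgroup.isExtendedAdequate_of_monomial τ.range hirr' b θ hθ hA hidx
    refine Or.inl (Subgroup.IsExtendedAdequate.of_map ι σ.range ?_)
    rw [MonoidHom.map_range]
    exact had

/-- From the row convention `M B Mᵀ = μ B` to the column convention `Mᵀ B⁻¹ M = μ B⁻¹`.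
[folklore] -/
theorem transpose_mul_inv_mul_of_mul_mul_transpose {k : Type u} [Field k]
    {B : Matrix (Fin 3) (Fin 3) k} (hB : IsUnit B.det) (M : GL (Fin 3) k) {μ : k}
    (hμ : (M : Matrix (Fin 3) (Fin 3) k) * B * (M : Matrix (Fin 3) (Fin 3) k)ᵀ = μ • B) :
    (M : Matrix (Fin 3) (Fin 3) k)ᵀ * B⁻¹ * M = μ • B⁻¹ := by
  set N : Matrix (Fin 3) (Fin 3) k := (M : Matrix (Fin 3) (Fin 3) k) with hN
  have hNt : IsUnit Nᵀ.det := by rw [Matrix.det_transpose]; exact Matrix.isUnits_det_units M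
  -- `N B = μ B Nᵀ⁻¹`
  have h1 : N * B = μ • (B * Nᵀ⁻¹) := by
    calc N * B = N * B * Nᵀ * Nᵀ⁻¹ := by
          rw [Matrix.mul_assoc (N * B), Matrix.mul_nonsing_inv _ hNt, Matrix.mul_one]
      _ = μ • (B * Nᵀ⁻¹) := by rw [hμ, Matrix.smul_mul]
  -- `(Nᵀ B⁻¹ N) B = μ`
  have h2 : Nᵀ * B⁻¹ * N * B = μ • (1 : Matrix (Fin 3) (Fin 3) k) := by
    rw [Matrix.mul_assoc, h1, Matrix.mul_smul, ← Matrix.mul_assoc, Matrix.mul_assoc Nᵀ,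
      Matrix.nonsing_inv_mul B hB, Matrix.mul_one, Matrix.mul_nonsing_inv _ hNt]
  calc Nᵀ * B⁻¹ * N = Nᵀ * B⁻¹ * N * B * B⁻¹ := by
        rw [Matrix.mul_assoc (Nᵀ * B⁻¹ * N), Matrix.mul_nonsing_inv B hB, Matrix.mul_one]
    _ = μ • B⁻¹ := by rw [h2, Matrix.smul_mul, Matrix.one_mul]

/-- **Row-convention variant of `isExtendedAdequate_or_index_three_of_similitude_of_not_dvd`**
(`σ(g) B σ(g)ᵀ = μ_g B`, the convention of `Sym² GL₂` acting on Veronese row vectors, e.g. the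
tree's `TernaryPairs.symSq_mul_twoA1_mul_transpose`): the image consists of similitudes of `B⁻¹`
in the column convention. [cite: GuralnickHerzigTiep2017, Theorem 1.7] -/
theorem isExtendedAdequate_or_index_three_of_similitude_of_not_dvd'
    {k : Type u} [Field k] [CharP k 3] {G : Type v} [Group G] [Finite G]
    (σ : G →* GL (Fin 3) k) (hinj : Function.Injective σ) (hirr : IsAbsIrreducible σ)
    {B : Matrix (Fin 3) (Fin 3) k} (hBs : Bᵀ = B) (hB : IsUnit B.det)
    (hσO : ∀ g, ∃ μ : k, ((σ g : GL (Fin 3) k) : Matrix (Fin 3) (Fin 3) k) * B *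
      ((σ g : GL (Fin 3) k) : Matrix (Fin 3) (Fin 3) k)ᵀ = μ • B)
    (h9 : ¬9 ∣ Nat.card G) :
    Subgroup.IsExtendedAdequate σ.range ∨
      ∃ A : Subgroup G, A.Normal ∧ (∀ x ∈ A, ∀ y ∈ A, x * y = y * x) ∧ A.index = 3 := by
  have hBis : (B⁻¹)ᵀ = B⁻¹ := by rw [Matrix.transpose_nonsing_inv, hBs]
  have hBi : IsUnit B⁻¹.det := by
    rw [Matrix.det_nonsing_inv, isUnit_ringInverse]
    exact hB
  refine isExtendedAdequate_or_index_three_of_similitude_of_not_dvd σ hinj hirr hBis hBi ?_ h9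
  intro g
  obtain ⟨μ, hμ⟩ := hσO g
  exact ⟨μ, transpose_mul_inv_mul_of_mul_mul_transpose hB (σ g) hμ⟩

/-- A group with an abelian normal subgroup of prime index is solvable. [folklore] -/
theorem isSolvable_of_comm_normal_index {G : Type v} [Group G] (A : Subgroup G) [A.Normal]
    (hcomm : ∀ x ∈ A, ∀ y ∈ A, x * y = y * x) {p : ℕ} [hp : Fact p.Prime] (hidx : A.index = p) :
    IsSolvable G := by
  haveI : IsSolvable A := isSolvable_of_comm fun a b => Subtype.ext (hcomm a a.2 b b.2)
  haveI : IsCyclic (G ⧸ A) :=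
    isCyclic_of_prime_card (p := p) (by rw [← Subgroup.index_eq_card, hidx])
  haveI : IsSolvable (G ⧸ A) := isSolvable_of_comm mul_comm'
  exact solvable_of_ker_le_range A.subtype (QuotientGroup.mk' A)
    (by rw [QuotientGroup.ker_mk', Subgroup.range_subtype])

/-- **Non-solvable subgroups of `GO₃` with `9 ∤ |G|` are adequate** (characteristic `3`, any field;
e.g. the icosahedral cell `G/Z ≅ A₅` of the symmetric square): alternative (b) of Theorem 1.7
makes `G` solvable. [cite: GuralnickHerzigTiep2017, Theorem 1.7] -/
theorem isExtendedAdequate_of_similitude_of_not_isSolvable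
    {k : Type u} [Field k] [CharP k 3] {G : Type v} [Group G] [Finite G]
    (σ : G →* GL (Fin 3) k) (hinj : Function.Injective σ) (hirr : IsAbsIrreducible σ)
    {B : Matrix (Fin 3) (Fin 3) k} (hBs : Bᵀ = B) (hB : IsUnit B.det)
    (hσO : ∀ g, ∃ μ : k, ((σ g : GL (Fin 3) k) : Matrix (Fin 3) (Fin 3) k)ᵀ * B * σ g = μ • B)
    (h9 : ¬9 ∣ Nat.card G) (hns : ¬IsSolvable G) : Subgroup.IsExtendedAdequate σ.range := by
  rcases isExtendedAdequate_or_index_three_of_similitude_of_not_dvd σ hinj hirr hBs hB hσO h9 with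
    h | ⟨A, hAn, hAc, hAi⟩
  · exact h
  · haveI := hAn
    exact absurd (isSolvable_of_comm_normal_index A hAc hAi) hns

/-- **Range form** of `isExtendedAdequate_or_index_three_of_similitude_of_not_dvd`, for a finite
absolutely irreducible `H ≤ GO₃(B)` with `9 ∤ |H|`. [cite: GuralnickHerzigTiep2017, Theorem 1.7] -/
theorem Subgroup.isExtendedAdequate_or_index_three_of_similitude_of_not_dvd_card
    {k : Type u} [Field k] [CharP k 3] (H : Subgroup (GL (Fin 3) k)) [Finite H]
    (hirr : IsAbsIrreducible H.subtype) {B : Matrix (Fin 3) (Fin 3) k} (hBs : Bᵀ = B)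
    (hB : IsUnit B.det)
    (hHO : ∀ h ∈ H, ∃ μ : k, ((h : GL (Fin 3) k) : Matrix (Fin 3) (Fin 3) k)ᵀ * B * h = μ • B)
    (h9 : ¬9 ∣ Nat.card H) :
    Subgroup.IsExtendedAdequate H ∨
      ∃ A : Subgroup H, A.Normal ∧ (∀ x ∈ A, ∀ y ∈ A, x * y = y * x) ∧ A.index = 3 := by
  have h := isExtendedAdequate_or_index_three_of_similitude_of_not_dvd H.subtype
    H.subtype_injective hirr hBs hB (fun g => hHO g g.2) h9
  rwa [Subgroup.range_subtype] at h

/-- **Image form, no faithfulness needed**: for any `σ : G →* GL₃(k)` (`char k = 3`) absolutely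
irreducible with image in `GO₃(B)` (`σ(g)ᵀ B σ(g) = μ_g B`), finite, of order prime to `9` and
not solvable, the image `σ(G)` is adequate in the extended sense.
[cite: GuralnickHerzigTiep2017, Theorem 1.7] -/
theorem isExtendedAdequate_range_of_similitude_of_not_isSolvable
    {k : Type u} [Field k] [CharP k 3] {G : Type v} [Group G]
    (σ : G →* GL (Fin 3) k) [Finite σ.range] (hirr : IsAbsIrreducible σ)
    {B : Matrix (Fin 3) (Fin 3) k} (hBs : Bᵀ = B) (hB : IsUnit B.det)
    (hσO : ∀ g, ∃ μ : k, ((σ g : GL (Fin 3) k) : Matrix (Fin 3) (Fin 3) k)ᵀ * B * σ g = μ • B)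
    (h9 : ¬9 ∣ Nat.card σ.range) (hns : ¬IsSolvable σ.range) :
    Subgroup.IsExtendedAdequate σ.range := by
  have hHO : ∀ h ∈ σ.range, ∃ μ : k,
      ((h : GL (Fin 3) k) : Matrix (Fin 3) (Fin 3) k)ᵀ * B * h = μ • B := by
    rintro h ⟨g, rfl⟩
    exact hσO g
  rcases Subgroup.isExtendedAdequate_or_index_three_of_similitude_of_not_dvd_card σ.range
      hirr.range_subtype hBs hB hHO h9 with h | ⟨A, hAn, hAc, hAi⟩
  · exact h
  · haveI := hAn
    exact absurd (isSolvable_of_comm_normal_index A hAc hAi) hns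

/-- Row-convention variant of `isExtendedAdequate_range_of_similitude_of_not_isSolvable`
(`σ(g) B σ(g)ᵀ = μ_g B`, e.g. `σ = Sym² ∘ ρ` with `B = 2A₁` by
`TernaryPairs.symSq_mul_twoA1_mul_transpose`): the icosahedral cell of the symmetric square.
[cite: GuralnickHerzigTiep2017, Theorem 1.7] -/
theorem isExtendedAdequate_range_of_similitude_of_not_isSolvable'
    {k : Type u} [Field k] [CharP k 3] {G : Type v} [Group G]
    (σ : G →* GL (Fin 3) k) [Finite σ.range] (hirr : IsAbsIrreducible σ)
    {B : Matrix (Fin 3) (Fin 3) k} (hBs : Bᵀ = B) (hB : IsUnit B.det)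
    (hσO : ∀ g, ∃ μ : k, ((σ g : GL (Fin 3) k) : Matrix (Fin 3) (Fin 3) k) * B *
      ((σ g : GL (Fin 3) k) : Matrix (Fin 3) (Fin 3) k)ᵀ = μ • B)
    (h9 : ¬9 ∣ Nat.card σ.range) (hns : ¬IsSolvable σ.range) :
    Subgroup.IsExtendedAdequate σ.range := by
  have hBis : (B⁻¹)ᵀ = B⁻¹ := by rw [Matrix.transpose_nonsing_inv, hBs]
  have hBi : IsUnit B⁻¹.det := by
    rw [Matrix.det_nonsing_inv, isUnit_ringInverse]
    exact hB
  refine isExtendedAdequate_range_of_similitude_of_not_isSolvable σ hirr hBis hBi ?_ h9 hns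
  intro g
  obtain ⟨μ, hμ⟩ := hσO g
  exact ⟨μ, transpose_mul_inv_mul_of_mul_mul_transpose hB (σ g) hμ⟩

end Consequences

end Literature.NumberTheory.GaloisRepresentations
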